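import Literature.MathematicalPhysics.QuantumFieldTheory.Balaban1983to89.Step

/-!
# Bałaban's renormalization group for 4-d lattice Yang–Mills — the inductive step `k → k+1` over the INHABITED carriers of
# `Setup` v1.3 (`StepInhabited`; `Step` Part I, v8 of the f2 skeleton)

CITATION HEADER (lean-in-tree rule 2026-08-18). Companion to `Step` (same directory, same audit cell `pub-balaban`, unit
b2b-balaban-f2, FOUNDATIONS 2 — THE INDUCTIVE STEP), and like it a TYPED SKELETON, at statement level, of the inductive step of the
published series T. Bałaban, *Renormalization group approach to lattice gauge field theories. I*, Comm. Math. Phys. **109** 249–301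
(1987) [Balaban1987RG1] (§0 (0.17)–(0.20), §2 (2.1), (2.12)–(2.15), Thm 3 p.264); *Convergent renormalization expansions for lattice gauge
theories*, Comm. Math. Phys. **119** 243–285 (1988) [Balaban1988Convergent] (Thm 1 and the preceding paragraph p.262, (2.50)); *Large
field renormalization. I*, **122** 175–202 (1989) [Balaban1989LargeFieldI] ((0.2)–(0.4) p.176); *Large field renormalization. II*, **122**
355–392 (1989) [Balaban1989LargeFieldII] ((0.1) p.355); *Ultraviolet stability of three-dimensional lattice pure gauge field theories*,
**102** 255–275 (1985) [Balaban1985UV3] ((1), (6) pp.256–257).  WHAT IS REPRODUCED: (I1) the density-level step `ρ_{k+1} = 𝐑_k(T_k ρ_k)`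
of `Step` Part D1/G4 RE-TYPED over the inhabited carrier `RTOpI` of `Setup` v1.3, with its kernel-checked bookkeeping (the integral
invariant `∫dV_k ρ_k = Z` with integrability threaded through the induction, `Z ≤ e^c` from a pointwise UV bound, the vacuum-energy
constant `E` of the Wilson start pinned against the Wilson partition function); (I2) the SHAPES of [Balaban1987RG1] Thm 3 and of its
per-step obligation (`Step` Parts B2/E1) over an abstract one-step law, with their kernel-checked equivalence; (I3, v8.1) the same shapes INSTANTIATED non-vacuously at `Setup` v1.4's `SmallFieldStepI` (carrier `RTOpI`) and `SmallFieldStepOp` (operator level), with the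
definitional bridges from the `RTOp` forms of `Step`; (J, v9) the CLASS of gauge transformations in the inductive clause (1.19) of
[Balaban1987RG1] p.263 made a PARAMETER of the hypotheses / new-term obligation of `Step` Parts B1/E1 (`SFHypOn`, `SFNewTermOn`), with the
kernel-checked split of Thm 3's per-step obligation into (class-relative delivery) ∧ (per-step gauge lift) — the typed locus of the
cell's question which class the printed step delivers for `E^{(k+1)}` ([Balaban1987RG1] p.276 (3.29), [Balaban1988RG2Cluster] Lemma 2
p.11, pp.21–22) versus which class the next step consumes ((2.6), (3.3), (3.6), (3.37) of [Balaban1987RG1]); (K, v10) the reduction of Part J's per-step gauge lift to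
the gauge clauses for a RESIDUAL class whenever admissible × residual transformations exhaust `𝒢` at each new index — classes per scale AND
localization domain, under the composition law (1.10) p.262 of the action taken as a hypothesis — with the block / off-block instance
(the `(j, X)`-dependent form of the bridge `B12Inv329` §8 of the cell's b03 lineage, an importer of this module); (L, v11) the flow input
`R_n ≤ LR_j` of the majorant (1.81) of [Balaban1989LargeFieldII] p.385 IDENTIFIED with the first member of (2.9) of [Balaban1988Convergent]
p.256 (a typed display in raw-sequence form, `Budget.RStepLe`) and the binder `hR` of `Step`'s `Budget.majorant_181` (Part F) discharged from it
(`Budget.majorant_181_of_rStepLe`; the cell's GAPS G-f2.6 resolved); (M, v12) the seam from that majorant to the induction over `j` of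
[Balaban1989LargeFieldII] p.385 — the printed third expression `O(1)(64)^dM^dL^{d+1}R_j^{d+2}(d′_j(Z) + 1)` of (1.81) reached over the actual
control range of (1.80) from the second-to-third bound for every tail length (Part L; delivered with the geometric profile bounds discharged in
the ℤ^d index model of the operation `S` by the cell's b02 lineage, module `B16SProfile`, an importer of this module), the stopping rule
«K ≤ n₀ − j + R_j» being the one named binder (`Budget.sum_le_third_181`), and (1.80) at the creation scale from (1.82) and the located
smallness of p.385 (`Budget.controls_of_182` = `Step`'s `base_182` with both majorant hypotheses discharged); (N, v13) AN AMORTISED FORM OF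
(1.80) — NOT PRINTED, the cell's substitute bookkeeping for case 2 of the induction of [Balaban1989LargeFieldII] pp.386–387 after the
cell's b02 lineage refuted, in the ℤ^d index model of `S`, the absorption sentence of p.387 on which the printed sub-additivity of the
(1.80)-sums with a uniform remainder rests (module `B16Absorption`, an importer of this module): (1.80) with a multiplicative reserve
(`Budget.ControlsAm`, implying (1.80)), carried through the printed updates of cases 1/1′ and through the base case with the located
smallness strengthened by the factor `1 + θ`, and re-established at a merger from the printed exponent gain and cost sub-additivity SUMMED
over the merging family plus ONE new geometric hypothesis, the overhang budget (`Budget.merge_amortised`, `Budget.controlsAm_merge`; the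
hypothesis is OPEN — the cell's `STEP.md` §7.11).  NO theorem of the series
is asserted: theorem SHAPES are `def … : Prop`; the only `theorem`s are kernel-checked facts of elementary measure theory / real arithmetic / bookkeeping
(no `sorry`, no `axiom`; `#print axioms` ⊆ {propext, Classical.choice, Quot.sound}).  VALUE = typed skeleton + gap census, NOT summit
progress.  Prose companion: the cell's `STEP.md` (v11: §5.2, §7.6, §7.9, §11; v11.4 for Part M: §7.6, §11; v11.9 for Part N: §7.11, §11 O-F4).  Staged byte-identically in the cell package
`run/shared/lean/pub/pub-balaban/lean/BalabanYm4/Literature/…`.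

WHY A SEPARATE MODULE.  `Step` grows append-only, one Part per generation (A–H, v1–v7.1); at v7.1 the file is 199 179 bytes and the
gate's per-file cap is 200 000 bytes, so Part I (v8) opens this continuation module instead of being appended.  Declarations keep the
namespace `…Balaban1983to89.Step` (one vocabulary; `Step.DensityRGI` next to `Step.DensityRG`).  IMPORTS: `Step` ONLY (hence `Setup`),
so that every importer of `Step` (`B14`, `B14Cor3`, `B15BasicStep`, `B16`, `DagBinding`, `FlowStep`, `MissingProofs`, …) can import it
without cycles; consequently the two facts that would discharge its hypotheses for the printed objects — measurability of the Wilson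
action (`Missing.measurable_wilsonAction4`, module `MissingProofs`, which imports `Step`) and an inhabitant of `(av, ∀ k, RTOpI P k G (av k))`
(`AveragingRT.nonempty_averaging_rtOpI_family`) — are NAMED here and supplied by the consumer, never imported.  Page conventions,
boldface and the « » quotation rule as in `Step` / the cell's `STEP.md`; B12–B16 are the manuscripts UNDER AUDIT, quoted as the objects of
adjudication, never cited as facts.

READING NOTES ON DECLARATIONS OF `Step` (v13; docstring items owed since the cell's `STEP.md` v11.8 §6.14, recorded here because `Step` is
frozen at the byte cap).  (1) THE ANALYTICITY CLAUSE IS TYPED BY ITS BOUND ONLY.  Clause (ii) of (2.27) p.259 / (2.41) p.261 of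
[Balaban1988Convergent] («there exists an analytic function E^{(j)}(X,(𝐔,𝐉),z) of the variables (𝐔,𝐉) ∈ U^c_j(X, α_{0,j}, α_{1,j}), which is
an extension of this term»; «it has an extension to an analytic function on the space Ũ^c_j(X,α̃_0,α̃_1)») is carried by `Step.LFHyp` /
`Step.LFHypImproved` / `Step.LFNewTerms` AS THE BOUND at every point of the complex space (`boundE`, `boundR`, `boundB`), clauses (i), (iii)
as `localDepE/R`, `gaugeInvE/R`; there is NO predicate «`T.E j X · z` is analytic on `T.space j X α₀ α₁`» in `Step` / `StepInhabited` (an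
`LFTower`'s configuration type `Φ` is a bare type — `Step` D-f2.1 typing decision, restated with the clause numbers as the cell's
DIVERGENCE D-f2.19).  Every Cauchy-estimate use of clause (ii) in the series is therefore a HYPOTHESIS its consumer adds by name over a
concrete complex configuration space — `DifferentiableOn ℂ (fun φ => T.R j X φ) (T.space j X α₀ α₁)` once `Φ` carries
`[NormedAddCommGroup Φ] [NormedSpace ℂ Φ]` —, never a consequence of `LFHyp`.  (2) WHAT `Step.LFCov.cov232` / `Step.LFNewCov.cov232` TYPE.
(2.32) of [Balaban1988Convergent] p.260 AT EACH SCALE `j` over that scale's own transformation type `S.Euc j` and predicate `S.cubePres j`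
(«r leaves the partition of the lattice T_ξ in MR_j-cubes invariant»); `Step.LFSymm` imposes no group structure on `Euc j` and no relation
between `Euc j` and `Euc k` (D-f2.13 (a)); (2.33) is the theorem `LFCov.inv233`.  Delivering `LFNewCov` for the new 𝐑-terms along
[Balaban1989LargeFieldII] p.390 («By their construction it is also clear that they are Euclidean covariant, i.e., they have the property
(2.32) [III]») rests on four inputs not printed there and not typed by `Step` (the cell's census, GAPS G-adv3-36 / C-f2.22, DIVERGENCE
D-f2.20): (T) translation covariance of the tree prescription of (1.71), (N) the NESTING of the covariance groups `G_k ⊆ ⋂_{j≤k} G_j`, which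
for the translations is `R_j ≤ L^{k−j}R_k` and follows from the SECOND member of (2.9) of [Balaban1988Convergent] p.256 (`R_m ≤ L(1 +
g_n²β′(n−m))^{β₀}R_n`; in the tree the right conjunct of `B14FlowStep.FlowIneq29`) with (2.5) and the cube-corner convention (0.1) of
[Balaban1987RG1], (C) covariance of every ingredient of (1.71)–(1.72) inductively, (P) the re-indexing of the localization sums.  An
instantiator of `LFSymm` EITHER takes `cubePres k r` := «r preserves the MR_j-partition for every j ≤ k» (then (N) holds by definition) OR
takes the printed `G_k` and proves (N) from `FlowIneq29`'s right conjunct; either way (2.9) is load-bearing for the covariance clause (the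
cell's `STEP.md` §10 item 10, §11 O-G1).  Nothing in `LFSymm` / `LFCov` / `LFNewCov` is wrong or vacuous; the kernel hypothesis is silent
about the chain and about the translation/point-group split, and says so here.
-/

namespace Literature.MathematicalPhysics.QuantumFieldTheory.Balaban1983to89.Step

open _root_.Finset _root_.Real

/-! ## Part I — THE DENSITY LEVEL OVER THE INHABITED CARRIER `RTOpI` (Setup v1.3): INTEGRABILITY THREADED THROUGH THE INTEGRAL
INVARIANT; THE SMALL-FIELD STEP OBLIGATIONS OVER AN ABSTRACT ONE-STEP LAW

I1.  REACT-ONLY ADDITION answering the cell's SETUP-VACUITY-AUDIT (unit f1 gen 6; `Setup` v1.3, module `AveragingRT`; cell DIVERGENCE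
F17, GAPS G-f1-3).  The carrier `RTOp` of `Step` Parts B2/D1/E/G4 demands the push-forward identity `IsRT` for EVERY density,
non-integrable signed ones included, for which the Bochner integrals are junk; as soon as Haar measure on `G` has a measurable set of
measure strictly between `0` and `1` and a non-negative measurable non-integrable function — every non-finite compact Lie group — NO
operator satisfies this (kernel certificate `AveragingRT.isEmpty_rtOp_family`), so every binder `D : DensityRG P G av` /
`Tk : ∀ k, RTOp P k G (av k)` of `Step` is then a hypothesis that cannot be instantiated (the conclusions of the theorems of `Step` Parts
D1/G4 are unaffected and remain kernel-checked implications; they are vacuous for such `G`).  `Setup` v1.3 keeps `RTOp` (importers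
project its fields) and adds the INHABITED carrier `RTOpI` — same fields, `isRT` demanded only of densities integrable for the product
Haar measure (every printed density `exp(−A)`, `χ exp(−A)`, … is bounded and measurable on a compact configuration space); an averaging
family with an `RTOpI` at every level exists (`AveragingRT.nonempty_averaging_rtOpI_family`).  This Part re-types the density level over
`RTOpI` (`DensityRGI`; `DensityRG.toI` embeds the old carrier field by field, `rfl`; `DensityRGI.free` / `nonempty_densityRGI`: inhabited as
soon as an `RTOpI` family is).  The one logical use of `isRT` in `Step` is the step
`∫dV T ρ = ∫dU ρ` of `DensityRG.integral_invariant`; over `RTOpI` that step needs `Integrable ρ_k`, and integrability is CARRIED ALONG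
THE INDUCTION: `∫ρ_{k+1} = ∫ρ_k = Z` by (0.4) [B15] and the push-forward identity, and `Z ≠ 0 ⇒ Integrable ρ_{k+1}` because a
non-integrable function has Bochner integral `0` (`MeasureTheory.Integrable.of_integral_ne_zero`).  For the Wilson start,
`Z = e^{−E} Z_W(g₀) > 0` and `Integrable ρ₀` follow from the measurability of the Wilson action alone (`0 ≤ A`, Setup
`wilsonAction4_nonneg`, so the weight is bounded by `e^{−E}` on a probability space); measurability of `A` is
`Missing.measurable_wilsonAction4` of the sibling module `MissingProofs` (from `Measurable reTr`, an axiom of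
`UnitaryModel.RegularGaugeGroup`) and enters HERE as the hypothesis `hA` (this module imports `Step` only, see WHY A SEPARATE MODULE).
Net effect: the `RTOpI` forms of G4 (`DensityRGI.exp_neg_mul_wilsonZ_le` / `log_wilsonZ_sub_le` / `integral_minorant_le` /
`partitionFn_le_exp_of_wilsonStart`) need FEWER hypotheses than the `RTOp` forms of `Step`: `0 < Z_W(g₀)` and `Integrable ρ_K` are now
DERIVED (`wilsonZ_pos_of_measurable`, `DensityRGI.integrable_all`), not assumed.  The normalization (0.4) [B15] is CONSUMED only at the
transformed densities `T_k ρ_k` of the trajectory (`DensityRGI.StepNormalized`, implied by Setup's `PreservesIntegral (R k)`); the cores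
`integral_invariant'` / `integrable_and_integral_eq'` / `integrable_T` run on it, the last recording that what the `(k+1)`-st large-field
operation receives is integrable with integral `Z`.  No declaration of `Step` is modified.

I2.  `Step` Parts B2/E1 (`GeneratedBySmallFieldRT`, `B12Thm3Shape`, `SFStepObligation`, `B12Thm3Shape_iff_obligation`) bind
`Tk : ∀ k, RTOp …` only to state the one-step law `SmallFieldStep (Tk k)` (B12 (0.19)/(2.1)), and the bookkeeping proved about them never
uses that law.  `GeneratedBySteps` / `B12Thm3ShapeS` / `SFStepObligationS` / `B12Thm3ShapeS_iff_obligationS` take the law as a PARAMETER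
`law k g_k A_k A_{k+1}`; the `RTOp` forms are the instance `smallFieldLaw av Tk χ GF` (bridges `generatedBySmallFieldRT_iff_steps`,
`B12Thm3Shape_iff_steps`, `SFStepObligation_iff_steps`, by unpacking), and the instance over `RTOpI` is one line once `Setup` carries the
corresponding predicate — `Setup`'s binder to re-type, not this module's (cell journal NOTE → f1, 2026-08-18; STEP.md §11 row O-I1);
`Setup` v1.4 supplies it (`SmallFieldStepI`, `SmallFieldStepOp`) and I3 below writes that line (v8.1). -/

/-! ### I1. The density level `ρ_{k+1} = 𝐑_k(T_k ρ_k)` over `RTOpI` (B14 p.262; B10 (6) p.257; B15 (0.4) p.176; B16 (0.1) p.355) -/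

section DensityLevelI
open _root_.MeasureTheory

variable {P : Params} {G : Type*} [GaugeGroup G] [MeasurableSpace G] [HaarData G]

/-- THE SEQUENCE OF EFFECTIVE DENSITIES at the density level, exactly as `DensityRG` (B14 p.262: "the sequence of densities {ρ_k},
generated by successive applications of the operations 𝐑T to the density ρ₀ = exp[−(1/g₀²)A − E]"), with the renormalization
transformations in the INHABITED carrier `RTOpI` of Setup v1.3 (push-forward identity for integrable densities only, DIVERGENCE F7/F17)
and the large-field operations `R k` applied after them (reader-owned, DIVERGENCE F9), step law `ρ_{k+1} = R_k (T_k ρ_k)`. [cite: Balaban1988Convergent, Thm 1 and preceding paragraph p.262] -/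
structure DensityRGI (P : Params) (G : Type*) [GaugeGroup G] [MeasurableSpace G] [HaarData G]
    (av : ∀ j, Averaging P j G) where
  ρ : (k : ℕ) → Density P k G
  T : (k : ℕ) → RTOpI P k G (av k)
  R : (k : ℕ) → Density P (k+1) G → Density P (k+1) G
  step : ∀ k, ρ (k+1) = R k ((T k).T (ρ k))

variable {av : ∀ j, Averaging P j G}

/-- The old carrier embeds in the new one: forget the push-forward identity on non-integrable densities (Setup `RTOp.toRTOpI`),
keep everything else. [folklore] -/
def DensityRG.toI (D : DensityRG P G av) : DensityRGI P G av where
  ρ := D.ρ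
  T := fun k => (D.T k).toRTOpI
  R := D.R
  step := D.step

/-- `toI` keeps the densities. [folklore] -/
theorem DensityRG.toI_ρ (D : DensityRG P G av) : D.toI.ρ = D.ρ := rfl

/-- `toI` keeps the large-field operations. [folklore] -/
theorem DensityRG.toI_R (D : DensityRG P G av) : D.toI.R = D.R := rfl

/-- `toI` keeps the renormalization transformations as operators. [folklore] -/
theorem DensityRG.toI_T_T (D : DensityRG P G av) (k : ℕ) : (D.toI.T k).T = (D.T k).T := rfl

/-- NON-VACUITY WITNESS: given renormalization transformations in the inhabited carrier at every level and any starting density, the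
FREE trajectory `ρ_{k+1} = T_k ρ_k` (every large-field operation the identity — the small-field approximation of B12 §0, where no 𝐑 is
applied) is a `DensityRGI`; together with `AveragingRT.nonempty_averaging_rtOpI_family` this makes the hypothesis `D : DensityRGI P G av`
of the theorems below satisfiable, in contrast with `D : Step.DensityRG P G av` (cell GAPS G-f1-3).  A witness of consistency only —
Bałaban's trajectory applies the operations 𝐑_k of [B15]/[B16]. [folklore] -/
def DensityRGI.free (T : ∀ k, RTOpI P k G (av k)) (ρ₀ : Density P 0 G) : DensityRGI P G av where
  ρ := fun k => Nat.rec (motive := fun k => Density P k G) ρ₀ (fun k ρk => (T k).T ρk) k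
  T := T
  R := fun _ => id
  step := fun _ => rfl

/-- The free trajectory starts at the prescribed density. [folklore] -/
theorem DensityRGI.free_ρ_zero (T : ∀ k, RTOpI P k G (av k)) (ρ₀ : Density P 0 G) : (DensityRGI.free T ρ₀).ρ 0 = ρ₀ := rfl

/-- The free trajectory's step `ρ_{k+1} = T_k ρ_k`. [folklore] -/
theorem DensityRGI.free_ρ_succ (T : ∀ k, RTOpI P k G (av k)) (ρ₀ : Density P 0 G) (k : ℕ) :
    (DensityRGI.free T ρ₀).ρ (k+1) = (T k).T ((DensityRGI.free T ρ₀).ρ k) := rfl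

/-- `DensityRGI P G av` is inhabited as soon as `∀ k, RTOpI P k G (av k)` is (`AveragingRT.nonempty_averaging_rtOpI_family` supplies
such a pair `(av, T)`). [folklore] -/
theorem nonempty_densityRGI (h : Nonempty (∀ k, RTOpI P k G (av k))) : Nonempty (DensityRGI P G av) :=
  h.elim fun T => ⟨DensityRGI.free T fun _ => 1⟩

/-- The Wilson start `ρ₀ = exp[−(1/g₀²)A − E]` (B14 Thm 1 p.262), as `DensityRG.IsWilsonStart`. [cite: Balaban1988Convergent, Thm 1 p.262] -/
def DensityRGI.IsWilsonStart (D : DensityRGI P G av) (g₀ E : ℝ) : Prop :=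
  ∀ U, D.ρ 0 U = Real.exp (-(1 / g₀ ^ 2) * wilsonAction4 U - E)

/-- The partition function `Z = ∫ dU ρ₀(U)` (B10 (6) p.257), as `DensityRG.partitionFn`. [cite: Balaban1985UV3, (6) p.257] -/
noncomputable def DensityRGI.partitionFn (D : DensityRGI P G av) : ℝ :=
  ∫ U, D.ρ 0 U ∂(fieldMeasure P 0 G)

/-- `toI` keeps the Wilson-start predicate. [folklore] -/
theorem DensityRG.toI_isWilsonStart_iff (D : DensityRG P G av) (g₀ E : ℝ) :
    D.toI.IsWilsonStart g₀ E ↔ D.IsWilsonStart g₀ E := Iff.rfl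

/-- `toI` keeps the partition function. [folklore] -/
theorem DensityRG.toI_partitionFn (D : DensityRG P G av) : D.toI.partitionFn = D.partitionFn := rfl

/-- One renormalization transformation of the inhabited carrier preserves the integral of an INTEGRABLE density (the push-forward
identity tested against `f ≡ 1`, as `integral_RT_eq`; B10 (6) "∫dU Tρ = ∫dU ρ").  Bookkeeping. [folklore] -/
theorem integral_RTI_eq {j : ℕ} {av₁ : Averaging P j G} (T : RTOpI P j G av₁) {ρ : Density P j G}
    (hρ : Integrable ρ (fieldMeasure P j G)) :
    ∫ V, T.T ρ V ∂(fieldMeasure P (j+1) G) = ∫ U, ρ U ∂(fieldMeasure P j G) :=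
  integral_RT_eq (T.isRT ρ hρ)

/-- THE NORMALIZATION (0.4) [B15] AS CONSUMED: `∫dV(𝐑ρ)(V) = ∫dVρ(V)` at the transformed densities `T_k ρ_k` that occur
along the trajectory, `k < K` (B15 p.176 states (0.4) for the density of (0.2) at hand).  Setup's `PreservesIntegral (R k)` (all
densities) implies it (`stepNormalized_of_preservesIntegral`); the theorems below are stated with Setup's form and proved from this one. [cite: Balaban1989LargeFieldI, (0.4) p.176] -/
def DensityRGI.StepNormalized (D : DensityRGI P G av) (K : ℕ) : Prop :=
  ∀ k, k < K → ∫ V, D.R k ((D.T k).T (D.ρ k)) V ∂(fieldMeasure P (k+1) G) = ∫ V, (D.T k).T (D.ρ k) V ∂(fieldMeasure P (k+1) G)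

/-- Setup's `PreservesIntegral (R k)` for `k < K` gives the trajectory-wise normalization. [folklore] -/
theorem DensityRGI.stepNormalized_of_preservesIntegral (D : DensityRGI P G av) {K : ℕ}
    (hR : ∀ k, k < K → PreservesIntegral (D.R k)) : D.StepNormalized K :=
  fun k hk => hR k hk ((D.T k).T (D.ρ k))

/-- The free trajectory (identity large-field operations) is normalized. [folklore] -/
theorem DensityRGI.free_stepNormalized (T : ∀ k, RTOpI P k G (av k)) (ρ₀ : Density P 0 G) (K : ℕ) :
    (DensityRGI.free T ρ₀).StepNormalized K := fun _ _ => rfl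

/-- The free trajectory started at the Wilson density is a Wilson start. [folklore] -/
theorem DensityRGI.free_isWilsonStart (T : ∀ k, RTOpI P k G (av k)) (g₀ E : ℝ) :
    (DensityRGI.free T fun U => Real.exp (-(1 / g₀ ^ 2) * wilsonAction4 U - E)).IsWilsonStart g₀ E := fun _ => rfl

/-- THE INTEGRAL INVARIANT over the inhabited carrier, core form: if the large-field operations are normalized along the trajectory up
to step `K` ((0.4)/(1.102) [B15]) AND every density fed to a renormalization transformation before step `K` is integrable, then
`∫ dV_k ρ_k = Z` for all `k ≤ K` (B10 (6) p.257).  The integrability hypothesis is what `RTOpI` makes visible; it is discharged below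
when `Z ≠ 0` (`integrable_and_integral_eq`).  Bookkeeping by induction on `k`. [folklore] -/
theorem DensityRGI.integral_invariant' (D : DensityRGI P G av) (K : ℕ) (hN : D.StepNormalized K)
    (hint : ∀ k, k < K → Integrable (D.ρ k) (fieldMeasure P k G)) :
    ∀ k, k ≤ K → ∫ V, D.ρ k V ∂(fieldMeasure P k G) = D.partitionFn := by
  intro k
  induction k with
  | zero => intro _; rfl
  | succ k ih =>
    intro hk
    have hk' : k < K := Nat.lt_of_succ_le hk
    rw [D.step k, hN k hk', integral_RTI_eq (D.T k) (hint k hk')]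
    exact ih (le_of_lt hk')

/-- THE INTEGRAL INVARIANT over the inhabited carrier, with Setup's `PreservesIntegral` (as `DensityRG.integral_invariant`, plus the
integrability of the densities along the trajectory). [folklore] -/
theorem DensityRGI.integral_invariant (D : DensityRGI P G av) (K : ℕ)
    (hR : ∀ k, k < K → PreservesIntegral (D.R k))
    (hint : ∀ k, k < K → Integrable (D.ρ k) (fieldMeasure P k G)) :
    ∀ k, k ≤ K → ∫ V, D.ρ k V ∂(fieldMeasure P k G) = D.partitionFn :=
  D.integral_invariant' K (D.stepNormalized_of_preservesIntegral hR) hint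

/-- INTEGRABILITY IS CARRIED ALONG THE INDUCTION when `Z ≠ 0` (core form, normalization along the trajectory): from `Integrable ρ₀`,
`Z = ∫ρ₀ ≠ 0` and (0.4), every `ρ_k`, `k ≤ K`, is integrable with `∫ dV_k ρ_k = Z` — because `∫ρ_{k+1} = ∫ R_k(T_k ρ_k) = ∫ T_k ρ_k = ∫ ρ_k`
(push-forward identity for the integrable `ρ_k`) and a function with non-zero Bochner integral is integrable
(`MeasureTheory.Integrable.of_integral_ne_zero`).  Bookkeeping. [folklore] -/
theorem DensityRGI.integrable_and_integral_eq' (D : DensityRGI P G av) (K : ℕ) (hN : D.StepNormalized K)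
    (h0 : Integrable (D.ρ 0) (fieldMeasure P 0 G)) (hZ : D.partitionFn ≠ 0) :
    ∀ k, k ≤ K → Integrable (D.ρ k) (fieldMeasure P k G) ∧ ∫ V, D.ρ k V ∂(fieldMeasure P k G) = D.partitionFn := by
  intro k
  induction k with
  | zero => intro _; exact ⟨h0, rfl⟩
  | succ k ih =>
    intro hk
    have hk' : k < K := Nat.lt_of_succ_le hk
    obtain ⟨hik, heq⟩ := ih (le_of_lt hk')
    have hstep : ∫ V, D.ρ (k+1) V ∂(fieldMeasure P (k+1) G) = D.partitionFn := by
      rw [D.step k, hN k hk', integral_RTI_eq (D.T k) hik, heq]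
    exact ⟨Integrable.of_integral_ne_zero (by rw [hstep]; exact hZ), hstep⟩

/-- INTEGRABILITY IS CARRIED ALONG THE INDUCTION when `Z ≠ 0`, with Setup's `PreservesIntegral`. [folklore] -/
theorem DensityRGI.integrable_and_integral_eq (D : DensityRGI P G av) (K : ℕ)
    (hR : ∀ k, k < K → PreservesIntegral (D.R k))
    (h0 : Integrable (D.ρ 0) (fieldMeasure P 0 G)) (hZ : D.partitionFn ≠ 0) :
    ∀ k, k ≤ K → Integrable (D.ρ k) (fieldMeasure P k G) ∧ ∫ V, D.ρ k V ∂(fieldMeasure P k G) = D.partitionFn :=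
  D.integrable_and_integral_eq' K (D.stepNormalized_of_preservesIntegral hR) h0 hZ

/-- The TRANSFORMED densities `T_k ρ_k`, `k < K`, are integrable too, with `∫ dV T_k ρ_k = Z` (push-forward identity for the integrable
`ρ_k`, then `Z ≠ 0`) — what the large-field operation of the `(k+1)`-st step receives (B15 (0.2)–(0.4)). [folklore] -/
theorem DensityRGI.integrable_T (D : DensityRGI P G av) (K : ℕ) (hN : D.StepNormalized K)
    (h0 : Integrable (D.ρ 0) (fieldMeasure P 0 G)) (hZ : D.partitionFn ≠ 0) :
    ∀ k, k < K → Integrable ((D.T k).T (D.ρ k)) (fieldMeasure P (k+1) G) ∧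
      ∫ V, (D.T k).T (D.ρ k) V ∂(fieldMeasure P (k+1) G) = D.partitionFn := by
  intro k hk
  obtain ⟨hik, heq⟩ := D.integrable_and_integral_eq' K hN h0 hZ k hk.le
  have hT : ∫ V, (D.T k).T (D.ρ k) V ∂(fieldMeasure P (k+1) G) = D.partitionFn := by
    rw [integral_RTI_eq (D.T k) hik, heq]
  exact ⟨Integrable.of_integral_ne_zero (by rw [hT]; exact hZ), hT⟩

/-- Corollary: every `ρ_k`, `k ≤ K`, is integrable (hypotheses as in `integrable_and_integral_eq`). [folklore] -/
theorem DensityRGI.integrable_all (D : DensityRGI P G av) (K : ℕ)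
    (hR : ∀ k, k < K → PreservesIntegral (D.R k))
    (h0 : Integrable (D.ρ 0) (fieldMeasure P 0 G)) (hZ : D.partitionFn ≠ 0) :
    ∀ k, k ≤ K → Integrable (D.ρ k) (fieldMeasure P k G) :=
  fun k hk => (D.integrable_and_integral_eq K hR h0 hZ k hk).1

/-- Corollary: the integral invariant `∫ dV_k ρ_k = Z`, `k ≤ K`, with the integrability hypotheses of `integral_invariant` discharged
from `Integrable ρ₀` and `Z ≠ 0`. [folklore] -/
theorem DensityRGI.integral_invariant_of_ne_zero (D : DensityRGI P G av) (K : ℕ)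
    (hR : ∀ k, k < K → PreservesIntegral (D.R k))
    (h0 : Integrable (D.ρ 0) (fieldMeasure P 0 G)) (hZ : D.partitionFn ≠ 0) :
    ∀ k, k ≤ K → ∫ V, D.ρ k V ∂(fieldMeasure P k G) = D.partitionFn :=
  fun k hk => (D.integrable_and_integral_eq K hR h0 hZ k hk).2

/-- The Wilson weight `exp[−(1/g₀²)A(U)]` shifted by a constant is integrable for the product Haar measure as soon as the Wilson action
is measurable: it is measurable and bounded by `exp(−E)` (`0 ≤ A`, Setup `wilsonAction4_nonneg`) on a probability space
(`fieldMeasure_isProbabilityMeasure`).  Measurability of `A` is `MissingProofs.measurable_wilsonAction4` (from measurability of `reTr`),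
kept a hypothesis here. [folklore] -/
theorem integrable_wilsonWeight (hA : Measurable fun U : GaugeField P 0 G => wilsonAction4 U) (g₀ E : ℝ) :
    Integrable (fun U : GaugeField P 0 G => Real.exp (-(1 / g₀ ^ 2) * wilsonAction4 U - E)) (fieldMeasure P 0 G) := by
  have hm : Measurable fun U : GaugeField P 0 G => Real.exp (-(1 / g₀ ^ 2) * wilsonAction4 U - E) :=
    ((measurable_const.mul hA).sub measurable_const).exp
  refine (integrable_const (Real.exp (-E))).mono' hm.aestronglyMeasurable (Filter.Eventually.of_forall fun U => ?_)
  rw [Real.norm_eq_abs, abs_of_pos (Real.exp_pos _)]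
  refine Real.exp_le_exp.mpr ?_
  have h1 : 0 ≤ (1 / g₀ ^ 2) * wilsonAction4 U := mul_nonneg (by positivity) (wilsonAction4_nonneg U)
  linarith

/-- `0 < Z_W(g₀)` from the measurability of the Wilson action (G4 addendum `wilsonZ_pos_of_integrable` with its integrability hypothesis
discharged by `integrable_wilsonWeight`). [folklore] -/
theorem wilsonZ_pos_of_measurable (hA : Measurable fun U : GaugeField P 0 G => wilsonAction4 U) (g₀ : ℝ) :
    0 < wilsonZ P G g₀ := by
  refine wilsonZ_pos_of_integrable ?_
  have h := integrable_wilsonWeight (P := P) (G := G) hA g₀ 0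
  simpa using h

/-- A Wilson start is integrable, given measurability of the Wilson action. [folklore] -/
theorem DensityRGI.integrable_wilsonStart (D : DensityRGI P G av) {g₀ E : ℝ} (h0 : D.IsWilsonStart g₀ E)
    (hA : Measurable fun U : GaugeField P 0 G => wilsonAction4 U) :
    Integrable (D.ρ 0) (fieldMeasure P 0 G) := by
  have hρ : D.ρ 0 = fun U => Real.exp (-(1 / g₀ ^ 2) * wilsonAction4 U - E) := funext h0
  rw [hρ]
  exact integrable_wilsonWeight hA g₀ E

/-- With a Wilson start the partition function is `exp(−E)·Z_W(g₀)` (as `DensityRG.partitionFn_eq_of_wilsonStart`; no integrability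
needed). [folklore] -/
theorem DensityRGI.partitionFn_eq_of_wilsonStart (D : DensityRGI P G av) {g₀ E : ℝ} (h : D.IsWilsonStart g₀ E) :
    D.partitionFn = Real.exp (-E) * wilsonZ P G g₀ := by
  unfold DensityRGI.partitionFn wilsonZ
  have hρ : (fun U => D.ρ 0 U) = fun U => Real.exp (-(1 / g₀ ^ 2) * wilsonAction4 U) * Real.exp (-E) := by
    funext U
    rw [h U, sub_eq_add_neg, Real.exp_add]
  rw [hρ, integral_mul_const, mul_comm]

/-- With a Wilson start and a measurable Wilson action, `Z = exp(−E)·Z_W(g₀) > 0`. [folklore] -/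
theorem DensityRGI.partitionFn_pos_of_wilsonStart (D : DensityRGI P G av) {g₀ E : ℝ} (h0 : D.IsWilsonStart g₀ E)
    (hA : Measurable fun U : GaugeField P 0 G => wilsonAction4 U) : 0 < D.partitionFn := by
  rw [D.partitionFn_eq_of_wilsonStart h0]
  exact mul_pos (Real.exp_pos _) (wilsonZ_pos_of_measurable hA g₀)

/-- WHAT THE UPPER HALF OF (0.1) [B16] / (2.50) [III] BUYS, over the inhabited carrier: a pointwise bound `ρ_K ≤ exp c`, the
normalization of the large-field operations and integrability of the densities before step `K` give `Z ≤ exp c` (B10 (6) p.257; as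
`DensityRG.partitionFn_le_exp`).  Bookkeeping. [folklore] -/
theorem DensityRGI.partitionFn_le_exp (D : DensityRGI P G av) (K : ℕ) (c : ℝ)
    (hR : ∀ k, k < K → PreservesIntegral (D.R k))
    (hint : ∀ k, k < K → Integrable (D.ρ k) (fieldMeasure P k G)) (hup : ∀ V, D.ρ K V ≤ Real.exp c) :
    D.partitionFn ≤ Real.exp c := by
  rw [← D.integral_invariant K hR hint K le_rfl]
  by_cases hi : Integrable (D.ρ K) (fieldMeasure P K G)
  · calc ∫ V, D.ρ K V ∂(fieldMeasure P K G)
        ≤ ∫ _V, Real.exp c ∂(fieldMeasure P K G) := integral_mono hi (integrable_const _) hup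
      _ = Real.exp c := by simp
  · rw [integral_undef hi]; exact (Real.exp_pos c).le

/-- The same with the integrability hypotheses DISCHARGED for a Wilson start with measurable action (`Z > 0`, `integrable_all`). [folklore] -/
theorem DensityRGI.partitionFn_le_exp_of_wilsonStart (D : DensityRGI P G av) (K : ℕ) {g₀ E c : ℝ}
    (h0 : D.IsWilsonStart g₀ E) (hA : Measurable fun U : GaugeField P 0 G => wilsonAction4 U)
    (hR : ∀ k, k < K → PreservesIntegral (D.R k)) (hup : ∀ V, D.ρ K V ≤ Real.exp c) :
    D.partitionFn ≤ Real.exp c :=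
  D.partitionFn_le_exp K c hR
    (fun k hk => D.integrable_all K hR (D.integrable_wilsonStart h0 hA) (D.partitionFn_pos_of_wilsonStart h0 hA).ne' k hk.le)
    hup

/-- B14 p.262, the STEP ON SPACES over the inhabited carrier (verbatim as `DensityRG.MapsSpaces`: "the operation 𝐑T transforms the
space with the index k into the space with the index k+1"). [cite: Balaban1988Convergent, remark after Thm 1 p.262] -/
def DensityRGI.MapsSpaces (D : DensityRGI P G av) (S : (k : ℕ) → Density P k G → Prop) (K : ℕ) : Prop :=
  ∀ k, k < K → ∀ ρ : Density P k G, S k ρ → S (k+1) (D.R k ((D.T k).T ρ))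

/-- `toI` keeps the step-on-spaces predicate. [folklore] -/
theorem DensityRG.toI_mapsSpaces_iff (D : DensityRG P G av) (S : (k : ℕ) → Density P k G → Prop) (K : ℕ) :
    D.toI.MapsSpaces S K ↔ D.MapsSpaces S K := Iff.rfl

/-- The induction skeleton of B14 Thm 1 / B16 Thm 1 at the density level, inhabited carrier (as `DensityRG.inSpace_all`).
Pure logic. [folklore] -/
theorem DensityRGI.inSpace_all (D : DensityRGI P G av) (S : (k : ℕ) → Density P k G → Prop) (K : ℕ)
    (h0 : S 0 (D.ρ 0)) (hstep : D.MapsSpaces S K) : ∀ k, k ≤ K → S k (D.ρ k) := by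
  intro k
  induction k with
  | zero => intro _; exact h0
  | succ k ih =>
    intro hk
    have hk' : k < K := Nat.lt_of_succ_le hk
    rw [D.step k]
    exact hstep k hk' (D.ρ k) (ih (le_of_lt hk'))

/-- THE UPPER UV BOUND PINS `E` FROM BELOW, inhabited carrier (as `DensityRG.exp_neg_mul_wilsonZ_le`, with the integrability of the
densities derived from the measurability of the Wilson action): `exp(−E)·Z_W(g₀) ≤ exp c`.  Bookkeeping. [folklore] -/
theorem DensityRGI.exp_neg_mul_wilsonZ_le (D : DensityRGI P G av) (K : ℕ) {g₀ E c : ℝ} (h0 : D.IsWilsonStart g₀ E)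
    (hA : Measurable fun U : GaugeField P 0 G => wilsonAction4 U)
    (hR : ∀ k, k < K → PreservesIntegral (D.R k)) (hup : ∀ V, D.ρ K V ≤ Real.exp c) :
    Real.exp (-E) * wilsonZ P G g₀ ≤ Real.exp c := by
  rw [← D.partitionFn_eq_of_wilsonStart h0]
  exact D.partitionFn_le_exp_of_wilsonStart K h0 hA hR hup

/-- The logarithmic form, inhabited carrier: `log Z_W(g₀) − c ≤ E`; the hypothesis `0 < Z_W(g₀)` of `DensityRG.log_wilsonZ_sub_le` is
now DERIVED (`wilsonZ_pos_of_measurable`). [folklore] -/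
theorem DensityRGI.log_wilsonZ_sub_le (D : DensityRGI P G av) (K : ℕ) {g₀ E c : ℝ} (h0 : D.IsWilsonStart g₀ E)
    (hA : Measurable fun U : GaugeField P 0 G => wilsonAction4 U)
    (hR : ∀ k, k < K → PreservesIntegral (D.R k)) (hup : ∀ V, D.ρ K V ≤ Real.exp c) :
    Real.log (wilsonZ P G g₀) - c ≤ E := by
  have hZ := wilsonZ_pos_of_measurable (P := P) (G := G) hA g₀
  have h := D.exp_neg_mul_wilsonZ_le K h0 hA hR hup
  have hlog : Real.log (Real.exp (-E) * wilsonZ P G g₀) ≤ c := by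
    rw [← Real.log_exp c]
    exact Real.log_le_log (mul_pos (Real.exp_pos _) hZ) h
  rw [Real.log_mul (Real.exp_pos _).ne' hZ.ne', Real.log_exp] at hlog
  linarith

/-- THE LOWER UV BOUND PINS `E` FROM ABOVE, inhabited carrier (as `DensityRG.integral_minorant_le`, with `Integrable ρ_K` now DERIVED):
any integrable pointwise minorant `l ≤ ρ_K` has `∫dV l ≤ exp(−E)·Z_W(g₀)`.  Bookkeeping. [folklore] -/
theorem DensityRGI.integral_minorant_le (D : DensityRGI P G av) (K : ℕ) {g₀ E : ℝ} (h0 : D.IsWilsonStart g₀ E)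
    (hA : Measurable fun U : GaugeField P 0 G => wilsonAction4 U)
    (hR : ∀ k, k < K → PreservesIntegral (D.R k)) {l : Density P K G} (hl : Integrable l (fieldMeasure P K G))
    (hlo : ∀ V, l V ≤ D.ρ K V) :
    ∫ V, l V ∂(fieldMeasure P K G) ≤ Real.exp (-E) * wilsonZ P G g₀ := by
  have hi0 := D.integrable_wilsonStart h0 hA
  have hZ := (D.partitionFn_pos_of_wilsonStart h0 hA).ne'
  rw [← D.partitionFn_eq_of_wilsonStart h0, ← D.integral_invariant_of_ne_zero K hR hi0 hZ K le_rfl]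
  exact integral_mono hl (D.integrable_all K hR hi0 hZ K le_rfl) hlo

end DensityLevelI

/-! ### I2. The small-field step obligations of Parts B2/E over an ABSTRACT ONE-STEP LAW (carrier-agnostic; B12 (0.17)–(0.20), Thm 3 p.264) -/

section StepSFGen
variable {P : Params} {G : Type*} [GaugeGroup G] {Φ 𝒢 : Type*} {av : ∀ j, Averaging P j G}

/-- "The sequence of actions `A_k` defined inductively by the … renormalization transformations" (B12 Thm 3 p.264) over an abstract
one-step law `law k g_k A_k A_{k+1}` (for B12: (0.19)/(2.1)), with the form (1.3) on the background-field domain and (0.20), exactly as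
`GeneratedBySmallFieldRT`. [cite: Balaban1987RG1, (0.17)–(0.20) p.255–256] -/
structure GeneratedBySteps (law : (k : ℕ) → ℝ → Density P k G → Density P (k+1) G → Prop)
    (bg : Background P G av) (A : ∀ k, Density P k G) (T : SFTower P G Φ 𝒢) (K : ℕ) : Prop where
  step : ∀ k, k < K → law k (T.flow.g k) (A k) (A (k+1))
  form13 : ∀ k, k ≤ K → ∀ V, V ∈ bg.dom k → A k V = T.action13 k (bg.U k V)
  rg : T.flow.SatisfiesRG K

/-- SHAPE OF B12 THEOREM 3 over an abstract one-step law (as `B12Thm3Shape`). [cite: Balaban1987RG1, Thm 3 p.264] -/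
def B12Thm3ShapeS (law : (k : ℕ) → ℝ → Density P k G → Density P (k+1) G → Prop)
    (bg : Background P G av) (A : ∀ k, Density P k G) (T : SFTower P G Φ 𝒢) (c : SFConsts) (K : ℕ) : Prop :=
  GeneratedBySteps law bg A T K → T.flow.InInterval c.γ K → ∀ k, k ≤ K → SFHyp T c k

/-- THE PER-STEP OBLIGATION FORM of B12 Theorem 3 over an abstract one-step law (as `SFStepObligation`). [cite: Balaban1987RG1, (2.12)–(2.15) p.268] -/
def SFStepObligationS (law : (k : ℕ) → ℝ → Density P k G → Density P (k+1) G → Prop)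
    (bg : Background P G av) (A : ∀ k, Density P k G) (T : SFTower P G Φ 𝒢) (c : SFConsts) (K : ℕ) : Prop :=
  GeneratedBySteps law bg A T K → T.flow.InInterval c.γ K → ∀ k, k < K → SFHyp T c k → SFNewTerm T c k

/-- `B12Thm3ShapeS ↔ SFStepObligationS` (as `B12Thm3Shape_iff_obligation`; the one-step law is not used). Kernel-checked bookkeeping. [folklore] -/
theorem B12Thm3ShapeS_iff_obligationS (law : (k : ℕ) → ℝ → Density P k G → Density P (k+1) G → Prop)
    (bg : Background P G av) (A : ∀ k, Density P k G) (T : SFTower P G Φ 𝒢) (c : SFConsts) (K : ℕ) :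
    B12Thm3ShapeS law bg A T c K ↔ SFStepObligationS law bg A T c K := by
  constructor
  · intro h hgen hI k hk _
    exact (h hgen hI (k+1) hk).newTerm
  · intro h hgen hI
    exact sfHyp_all_of_steps (h hgen hI)

variable [MeasurableSpace G] [HaarData G]

/-- The one-step law of Parts B2/E: Setup's `SmallFieldStep (Tk k) (χ k) (GF k) g_k` (B12 (0.19)) over the carrier `RTOp`. [cite: Balaban1987RG1, (0.19) p.255] -/
def smallFieldLaw (av : ∀ j, Averaging P j G) (Tk : ∀ k, RTOp P k G (av k)) (χ GF : ∀ k, Density P k G) :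
    (k : ℕ) → ℝ → Density P k G → Density P (k+1) G → Prop :=
  fun k gk A A' => SmallFieldStep (Tk k) (χ k) (GF k) gk A A'

/-- `GeneratedBySmallFieldRT` IS `GeneratedBySteps` for the law `smallFieldLaw` (unpacking). [folklore] -/
theorem generatedBySmallFieldRT_iff_steps (av : ∀ j, Averaging P j G) (Tk : ∀ k, RTOp P k G (av k)) (χ GF : ∀ k, Density P k G)
    (bg : Background P G av) (A : ∀ k, Density P k G) (T : SFTower P G Φ 𝒢) (K : ℕ) :
    GeneratedBySmallFieldRT av Tk χ GF bg A T K ↔ GeneratedBySteps (smallFieldLaw av Tk χ GF) bg A T K :=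
  ⟨fun h => ⟨h.step, h.form13, h.rg⟩, fun h => ⟨h.step, h.form13, h.rg⟩⟩

/-- `B12Thm3Shape` IS `B12Thm3ShapeS` for the law `smallFieldLaw`. [folklore] -/
theorem B12Thm3Shape_iff_steps (av : ∀ j, Averaging P j G) (Tk : ∀ k, RTOp P k G (av k)) (χ GF : ∀ k, Density P k G)
    (bg : Background P G av) (A : ∀ k, Density P k G) (T : SFTower P G Φ 𝒢) (c : SFConsts) (K : ℕ) :
    B12Thm3Shape av Tk χ GF bg A T c K ↔ B12Thm3ShapeS (smallFieldLaw av Tk χ GF) bg A T c K := by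
  unfold B12Thm3Shape B12Thm3ShapeS
  rw [generatedBySmallFieldRT_iff_steps]

/-- `SFStepObligation` IS `SFStepObligationS` for the law `smallFieldLaw`. [folklore] -/
theorem SFStepObligation_iff_steps (av : ∀ j, Averaging P j G) (Tk : ∀ k, RTOp P k G (av k)) (χ GF : ∀ k, Density P k G)
    (bg : Background P G av) (A : ∀ k, Density P k G) (T : SFTower P G Φ 𝒢) (c : SFConsts) (K : ℕ) :
    SFStepObligation av Tk χ GF bg A T c K ↔ SFStepObligationS (smallFieldLaw av Tk χ GF) bg A T c K := by
  unfold SFStepObligation SFStepObligationS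
  rw [generatedBySmallFieldRT_iff_steps]

end StepSFGen

/-! ### I3. Parts B2/E1 INSTANTIATED over the inhabited carrier `RTOpI` and at operator level (`Setup` v1.4 `SmallFieldStepI` /
`SmallFieldStepOp`; B12 (0.17)–(0.20) p.255–256, (2.1) p.265, Thm 3 p.264) — v8.1

The one-step law (0.19) — B12 p.255 «A_{k+1}(g_{k+1}, V) = (𝐓_kA_k)(g_{k+1}, V) = log 𝐍_k^{−1} ∫dU Π_{c∈T^{(k+1)}} δ(Ū(c)V^{−1}(c))
× χ_k exp[−(1/g_k²) Σ_{y∈T^{(k+1)}} Σ_{x∈B(y),x≠y} [1 − Re tr U(y,x)] + A_k(g_k, U)]», p.256 «where the constant 𝐍_k is given by the integral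
above with V = 1» (renders of pp.255–256 re-read by f2 gen 7; transcription as in the cell's STEP.md §2) — uses the renormalization transformation
only as an OPERATOR on densities (`Setup.SmallFieldStepOp`: `T(χ_k e^{−GF/g_k² + A_k}) = N_k e^{A_{k+1}}`, `N_k > 0`, `A_{k+1}(1) = 0`);
`Setup.SmallFieldStepI T … := SmallFieldStepOp T.T …` is its form over `RTOpI`, and `Setup.smallFieldStep_iff_I` /
`smallFieldStep_eq_op` identify the `RTOp` form of `Step` Part B2 with both, definitionally.  Below: the laws `smallFieldLawOp`,
`smallFieldLawI` (instances of I2's parameter `law`), the named shapes `GeneratedBySmallFieldOp` / `B12Thm3ShapeOp` / `SFStepObligationOp`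
(operator level — the form a holder of `D : DensityRGI P G av` binds, at `Tk k := (D.T k).T`) and `GeneratedBySmallFieldRTI` /
`B12Thm3ShapeI` / `SFStepObligationI` (carrier `RTOpI`, whose family type `∀ k, RTOpI P k G (av k)` is INHABITED,
`AveragingRT.nonempty_averaging_rtOpI_family`), their `Thm-3-shape ↔ per-step-obligation` equivalences (I2's, instantiated), and the
bridges `*_iff_op` / `*_iff_I` from the `RTOp` forms of `Step` (definitional unpacking).  Nothing of `Step` or `Setup` is restated: every
declaration here is an instance of I2 at a `Setup` predicate. -/

section StepSFLawI
variable {P : Params} {G : Type*} [GaugeGroup G] {Φ 𝒢 : Type*}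

/-- The one-step law (0.19) at OPERATOR LEVEL: `law k g_k A_k A_{k+1} := SmallFieldStepOp (Tk k) (χ k) (GF k) g_k A_k A_{k+1}` for a bare
family of operators `Tk k : Density_k → Density_{k+1}`. [cite: Balaban1987RG1, (0.19) p.255] -/
def smallFieldLawOp (Tk : ∀ k, Density P k G → Density P (k+1) G) (χ GF : ∀ k, Density P k G) :
    (k : ℕ) → ℝ → Density P k G → Density P (k+1) G → Prop :=
  fun k gk A A' => SmallFieldStepOp (Tk k) (χ k) (GF k) gk A A'

/-- Part B2 at OPERATOR LEVEL: "the sequence of actions `A_k` defined inductively by the renormalization transformations" (B12 Thm 3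
p.264; (0.17)–(0.20)) for a bare family of operators `Tk k : Density_k → Density_{k+1}` = `GeneratedBySteps` at `smallFieldLawOp`.
[cite: Balaban1987RG1, (0.17)–(0.20) p.255–256] -/
def GeneratedBySmallFieldOp {av : ∀ j, Averaging P j G} (Tk : ∀ k, Density P k G → Density P (k+1) G)
    (χ GF : ∀ k, Density P k G) (bg : Background P G av) (A : ∀ k, Density P k G) (T : SFTower P G Φ 𝒢) (K : ℕ) : Prop :=
  GeneratedBySteps (smallFieldLawOp Tk χ GF) bg A T K

/-- SHAPE OF B12 THEOREM 3 at operator level (`B12Thm3ShapeS` at `smallFieldLawOp`). [cite: Balaban1987RG1, Thm 3 p.264] -/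
def B12Thm3ShapeOp {av : ∀ j, Averaging P j G} (Tk : ∀ k, Density P k G → Density P (k+1) G)
    (χ GF : ∀ k, Density P k G) (bg : Background P G av) (A : ∀ k, Density P k G) (T : SFTower P G Φ 𝒢) (c : SFConsts) (K : ℕ) :
    Prop :=
  B12Thm3ShapeS (smallFieldLawOp Tk χ GF) bg A T c K

/-- THE PER-STEP OBLIGATION FORM of B12 Theorem 3 at operator level (`SFStepObligationS` at `smallFieldLawOp`).
[cite: Balaban1987RG1, (2.12)–(2.15) p.268] -/
def SFStepObligationOp {av : ∀ j, Averaging P j G} (Tk : ∀ k, Density P k G → Density P (k+1) G)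
    (χ GF : ∀ k, Density P k G) (bg : Background P G av) (A : ∀ k, Density P k G) (T : SFTower P G Φ 𝒢) (c : SFConsts) (K : ℕ) :
    Prop :=
  SFStepObligationS (smallFieldLawOp Tk χ GF) bg A T c K

/-- `B12Thm3ShapeOp ↔ SFStepObligationOp` (I2's equivalence, instantiated). Kernel-checked bookkeeping. [folklore] -/
theorem B12Thm3ShapeOp_iff_obligationOp {av : ∀ j, Averaging P j G} (Tk : ∀ k, Density P k G → Density P (k+1) G)
    (χ GF : ∀ k, Density P k G) (bg : Background P G av) (A : ∀ k, Density P k G) (T : SFTower P G Φ 𝒢) (c : SFConsts) (K : ℕ) :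
    B12Thm3ShapeOp Tk χ GF bg A T c K ↔ SFStepObligationOp Tk χ GF bg A T c K :=
  B12Thm3ShapeS_iff_obligationS _ bg A T c K

variable [MeasurableSpace G] [HaarData G]

/-- The one-step law (0.19) over the INHABITED carrier `RTOpI` (`Setup` v1.4 `SmallFieldStepI`). [cite: Balaban1987RG1, (0.19) p.255] -/
def smallFieldLawI {av : ∀ j, Averaging P j G} (Tk : ∀ k, RTOpI P k G (av k)) (χ GF : ∀ k, Density P k G) :
    (k : ℕ) → ℝ → Density P k G → Density P (k+1) G → Prop :=
  fun k gk A A' => SmallFieldStepI (Tk k) (χ k) (GF k) gk A A'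

/-- `smallFieldLawI Tk = smallFieldLawOp (k ↦ (Tk k).T)` (definitional, `Setup.smallFieldStepI_eq_op`). [folklore] -/
theorem smallFieldLawI_eq_op {av : ∀ j, Averaging P j G} (Tk : ∀ k, RTOpI P k G (av k)) (χ GF : ∀ k, Density P k G) :
    smallFieldLawI Tk χ GF = smallFieldLawOp (fun k => (Tk k).T) χ GF := rfl

/-- `smallFieldLaw av Tk = smallFieldLawOp (k ↦ (Tk k).T)` for the `RTOp` carrier of `Step` Part B2 (definitional,
`Setup.smallFieldStep_eq_op`). [folklore] -/
theorem smallFieldLaw_eq_op (av : ∀ j, Averaging P j G) (Tk : ∀ k, RTOp P k G (av k)) (χ GF : ∀ k, Density P k G) :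
    smallFieldLaw av Tk χ GF = smallFieldLawOp (fun k => (Tk k).T) χ GF := rfl

/-- `smallFieldLaw av Tk = smallFieldLawI (k ↦ (Tk k).toRTOpI)` (definitional, `Setup.smallFieldStep_iff_I`). [folklore] -/
theorem smallFieldLaw_eq_I (av : ∀ j, Averaging P j G) (Tk : ∀ k, RTOp P k G (av k)) (χ GF : ∀ k, Density P k G) :
    smallFieldLaw av Tk χ GF = smallFieldLawI (fun k => (Tk k).toRTOpI) χ GF := rfl

/-- Part B2 over the INHABITED carrier `RTOpI` (`Setup` v1.3/v1.4): "the sequence of actions `A_k` defined inductively by the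
renormalization transformations (0.19)" with `Tk : ∀ k, RTOpI P k G (av k)` = `GeneratedBySteps` at `smallFieldLawI` — the NON-VACUOUS
replacement of `Step.GeneratedBySmallFieldRT` (whose binder family `∀ k, RTOp …` is empty for infinite compact `G`,
`AveragingRT.isEmpty_rtOp_family`). [cite: Balaban1987RG1, (0.17)–(0.20) p.255–256] -/
def GeneratedBySmallFieldRTI {av : ∀ j, Averaging P j G} (Tk : ∀ k, RTOpI P k G (av k))
    (χ GF : ∀ k, Density P k G) (bg : Background P G av) (A : ∀ k, Density P k G) (T : SFTower P G Φ 𝒢) (K : ℕ) : Prop :=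
  GeneratedBySteps (smallFieldLawI Tk χ GF) bg A T K

/-- SHAPE OF B12 THEOREM 3 over the inhabited carrier `RTOpI` (`B12Thm3ShapeS` at `smallFieldLawI`). [cite: Balaban1987RG1, Thm 3 p.264] -/
def B12Thm3ShapeI {av : ∀ j, Averaging P j G} (Tk : ∀ k, RTOpI P k G (av k))
    (χ GF : ∀ k, Density P k G) (bg : Background P G av) (A : ∀ k, Density P k G) (T : SFTower P G Φ 𝒢) (c : SFConsts) (K : ℕ) :
    Prop :=
  B12Thm3ShapeS (smallFieldLawI Tk χ GF) bg A T c K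

/-- THE PER-STEP OBLIGATION FORM of B12 Theorem 3 over the inhabited carrier `RTOpI` (`SFStepObligationS` at `smallFieldLawI`).
[cite: Balaban1987RG1, (2.12)–(2.15) p.268] -/
def SFStepObligationI {av : ∀ j, Averaging P j G} (Tk : ∀ k, RTOpI P k G (av k))
    (χ GF : ∀ k, Density P k G) (bg : Background P G av) (A : ∀ k, Density P k G) (T : SFTower P G Φ 𝒢) (c : SFConsts) (K : ℕ) :
    Prop :=
  SFStepObligationS (smallFieldLawI Tk χ GF) bg A T c K

/-- `B12Thm3ShapeI ↔ SFStepObligationI` (I2's equivalence, instantiated). Kernel-checked bookkeeping. [folklore] -/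
theorem B12Thm3ShapeI_iff_obligationI {av : ∀ j, Averaging P j G} (Tk : ∀ k, RTOpI P k G (av k))
    (χ GF : ∀ k, Density P k G) (bg : Background P G av) (A : ∀ k, Density P k G) (T : SFTower P G Φ 𝒢) (c : SFConsts) (K : ℕ) :
    B12Thm3ShapeI Tk χ GF bg A T c K ↔ SFStepObligationI Tk χ GF bg A T c K :=
  B12Thm3ShapeS_iff_obligationS _ bg A T c K

/-- The `RTOpI` forms ARE the operator-level forms at `k ↦ (Tk k).T` (definitional). [folklore] -/
theorem generatedBySmallFieldRTI_iff_op {av : ∀ j, Averaging P j G} (Tk : ∀ k, RTOpI P k G (av k))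
    (χ GF : ∀ k, Density P k G) (bg : Background P G av) (A : ∀ k, Density P k G) (T : SFTower P G Φ 𝒢) (K : ℕ) :
    GeneratedBySmallFieldRTI Tk χ GF bg A T K ↔ GeneratedBySmallFieldOp (fun k => (Tk k).T) χ GF bg A T K := Iff.rfl

/-- `B12Thm3ShapeI Tk ↔ B12Thm3ShapeOp (k ↦ (Tk k).T)` (definitional). [folklore] -/
theorem B12Thm3ShapeI_iff_op {av : ∀ j, Averaging P j G} (Tk : ∀ k, RTOpI P k G (av k))
    (χ GF : ∀ k, Density P k G) (bg : Background P G av) (A : ∀ k, Density P k G) (T : SFTower P G Φ 𝒢) (c : SFConsts) (K : ℕ) :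
    B12Thm3ShapeI Tk χ GF bg A T c K ↔ B12Thm3ShapeOp (fun k => (Tk k).T) χ GF bg A T c K := Iff.rfl

/-- `SFStepObligationI Tk ↔ SFStepObligationOp (k ↦ (Tk k).T)` (definitional). [folklore] -/
theorem SFStepObligationI_iff_op {av : ∀ j, Averaging P j G} (Tk : ∀ k, RTOpI P k G (av k))
    (χ GF : ∀ k, Density P k G) (bg : Background P G av) (A : ∀ k, Density P k G) (T : SFTower P G Φ 𝒢) (c : SFConsts) (K : ℕ) :
    SFStepObligationI Tk χ GF bg A T c K ↔ SFStepObligationOp (fun k => (Tk k).T) χ GF bg A T c K := Iff.rfl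

/-- BRIDGE from `Step` Part B2: `GeneratedBySmallFieldRT av Tk …` (carrier `RTOp`) IS `GeneratedBySmallFieldRTI (k ↦ (Tk k).toRTOpI) …`
(unpacking; `Setup.smallFieldStep_iff_I`). [folklore] -/
theorem generatedBySmallFieldRT_iff_I (av : ∀ j, Averaging P j G) (Tk : ∀ k, RTOp P k G (av k)) (χ GF : ∀ k, Density P k G)
    (bg : Background P G av) (A : ∀ k, Density P k G) (T : SFTower P G Φ 𝒢) (K : ℕ) :
    GeneratedBySmallFieldRT av Tk χ GF bg A T K ↔ GeneratedBySmallFieldRTI (fun k => (Tk k).toRTOpI) χ GF bg A T K :=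
  ⟨fun h => ⟨h.step, h.form13, h.rg⟩, fun h => ⟨h.step, h.form13, h.rg⟩⟩

/-- BRIDGE: `GeneratedBySmallFieldRT av Tk …` IS `GeneratedBySmallFieldOp (k ↦ (Tk k).T) …` (unpacking; `Setup.smallFieldStep_eq_op`).
[folklore] -/
theorem generatedBySmallFieldRT_iff_op (av : ∀ j, Averaging P j G) (Tk : ∀ k, RTOp P k G (av k)) (χ GF : ∀ k, Density P k G)
    (bg : Background P G av) (A : ∀ k, Density P k G) (T : SFTower P G Φ 𝒢) (K : ℕ) :
    GeneratedBySmallFieldRT av Tk χ GF bg A T K ↔ GeneratedBySmallFieldOp (fun k => (Tk k).T) χ GF bg A T K :=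
  ⟨fun h => ⟨h.step, h.form13, h.rg⟩, fun h => ⟨h.step, h.form13, h.rg⟩⟩

/-- BRIDGE: `Step.B12Thm3Shape av Tk …` (carrier `RTOp`) ↔ `B12Thm3ShapeI (k ↦ (Tk k).toRTOpI) …`. [folklore] -/
theorem B12Thm3Shape_iff_I (av : ∀ j, Averaging P j G) (Tk : ∀ k, RTOp P k G (av k)) (χ GF : ∀ k, Density P k G)
    (bg : Background P G av) (A : ∀ k, Density P k G) (T : SFTower P G Φ 𝒢) (c : SFConsts) (K : ℕ) :
    B12Thm3Shape av Tk χ GF bg A T c K ↔ B12Thm3ShapeI (fun k => (Tk k).toRTOpI) χ GF bg A T c K := by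
  unfold B12Thm3Shape B12Thm3ShapeI B12Thm3ShapeS
  rw [generatedBySmallFieldRT_iff_steps, smallFieldLaw_eq_I]

/-- BRIDGE: `Step.B12Thm3Shape av Tk …` ↔ `B12Thm3ShapeOp (k ↦ (Tk k).T) …`. [folklore] -/
theorem B12Thm3Shape_iff_op (av : ∀ j, Averaging P j G) (Tk : ∀ k, RTOp P k G (av k)) (χ GF : ∀ k, Density P k G)
    (bg : Background P G av) (A : ∀ k, Density P k G) (T : SFTower P G Φ 𝒢) (c : SFConsts) (K : ℕ) :
    B12Thm3Shape av Tk χ GF bg A T c K ↔ B12Thm3ShapeOp (fun k => (Tk k).T) χ GF bg A T c K := by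
  unfold B12Thm3Shape B12Thm3ShapeOp B12Thm3ShapeS
  rw [generatedBySmallFieldRT_iff_steps, smallFieldLaw_eq_op]

/-- BRIDGE: `Step.SFStepObligation av Tk …` (carrier `RTOp`) ↔ `SFStepObligationI (k ↦ (Tk k).toRTOpI) …`. [folklore] -/
theorem SFStepObligation_iff_I (av : ∀ j, Averaging P j G) (Tk : ∀ k, RTOp P k G (av k)) (χ GF : ∀ k, Density P k G)
    (bg : Background P G av) (A : ∀ k, Density P k G) (T : SFTower P G Φ 𝒢) (c : SFConsts) (K : ℕ) :
    SFStepObligation av Tk χ GF bg A T c K ↔ SFStepObligationI (fun k => (Tk k).toRTOpI) χ GF bg A T c K := by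
  unfold SFStepObligation SFStepObligationI SFStepObligationS
  rw [generatedBySmallFieldRT_iff_steps, smallFieldLaw_eq_I]

/-- BRIDGE: `Step.SFStepObligation av Tk …` ↔ `SFStepObligationOp (k ↦ (Tk k).T) …`. [folklore] -/
theorem SFStepObligation_iff_op (av : ∀ j, Averaging P j G) (Tk : ∀ k, RTOp P k G (av k)) (χ GF : ∀ k, Density P k G)
    (bg : Background P G av) (A : ∀ k, Density P k G) (T : SFTower P G Φ 𝒢) (c : SFConsts) (K : ℕ) :
    SFStepObligation av Tk χ GF bg A T c K ↔ SFStepObligationOp (fun k => (Tk k).T) χ GF bg A T c K := by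
  unfold SFStepObligation SFStepObligationOp SFStepObligationS
  rw [generatedBySmallFieldRT_iff_steps, smallFieldLaw_eq_op]

/-- The per-step obligation over `RTOpI` DISCHARGES Thm 3's shape over `RTOpI` (the direction consumers use; I2's `.mpr`). [folklore] -/
theorem b12Thm3ShapeI_of_obligationI {av : ∀ j, Averaging P j G} (Tk : ∀ k, RTOpI P k G (av k))
    (χ GF : ∀ k, Density P k G) (bg : Background P G av) (A : ∀ k, Density P k G) (T : SFTower P G Φ 𝒢) (c : SFConsts) (K : ℕ)
    (h : SFStepObligationI Tk χ GF bg A T c K) : B12Thm3ShapeI Tk χ GF bg A T c K :=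
  (B12Thm3ShapeI_iff_obligationI Tk χ GF bg A T c K).mpr h

/-- NON-VACUITY of the binder family of the `RTOpI` forms: given an `RTOpI` family (which exists for a suitable averaging,
`AveragingRT.nonempty_averaging_rtOpI_family`), the data `(Tk, χ, GF)` of `B12Thm3ShapeI` can be instantiated — in contrast with the
`RTOp` forms of `Step` Part B2 (`AveragingRT.isEmpty_rtOp_family`). [folklore] -/
theorem nonempty_sfLawI_data {av : ∀ j, Averaging P j G} (h : Nonempty (∀ k, RTOpI P k G (av k))) :
    ∃ (Tk : ∀ k, RTOpI P k G (av k)) (χ GF : ∀ k, Density P k G),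
      smallFieldLawI Tk χ GF = smallFieldLawOp (fun k => (Tk k).T) χ GF :=
  ⟨Classical.choice h, fun _ _ => 1, fun _ _ => 0, rfl⟩

end StepSFLawI

/-! ## Part J — THE CLASS OF GAUGE TRANSFORMATIONS IN (1.19) MADE A PARAMETER: what the step DELIVERS for `E^{(k+1)}` versus what
the NEXT step CONSUMES; the per-step GAUGE LIFT as a located obligation (v9, react-only; cell GAPS G-adv7-7 / C-adv7-17)

J.  REACT-ONLY ADDITION answering the cell's adversarial note on the class of `u` in B12 (1.19) (GAPS G-adv7-7, adversarial reader 7,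
gen 8; its inheritance into B14 §2 (2.27)(iii) certified in C-adv7-17, gen 9).  In `SFHyp` / `SFNewTerm` (`Step` Parts B1/E1) the
clauses `spaceInv` and `gaugeInv119` — B12 p.263 «We assume that all functions E^{(j)}(X, g_{j−1}, 𝐔, 𝐉) are gauge invariant with
respect to the group of all gauge transformations (1.10). Explicitly (1.19) E^{(j)}(X, g_{j−1}, 𝐔^u, R(u)𝐉) = E^{(j)}(X, g_{j−1}, 𝐔, 𝐉)
for all G^c-valued gauge transformations u. The spaces U^c_j(X,α_0,α_1) are, by the definition, gauge invariant also.» — quantify over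
EVERY `u : 𝒢`; the type `𝒢` with its action `T.act` (1.10) is the reader's instantiation, so the CLASS of transformations for which
(1.19) is hypothesised at the scales `j ≤ k` and must be re-proved for the new term `E^{(k+1)}` is whatever `𝒢` is — one class for all
`(j, X)`, the same on the hypothesis side and on the obligation side.  The print, as the cell reads it, separates two classes.
DELIVERED for `E^{(k+1)}`: B12 p.276 «The functions (3.25), (3.26) are gauge invariant with respect to the simultaneous gauge
transformations 𝐔 → 𝐔^u, 𝐉 → R(u)𝐉, B → R(u)B, (3.29) for G^c-valued transformations u in a sufficiently small neighborhood of
G-valued transformations, so that the configurations after the transformations belong to proper spaces also. The expressions in (3.28)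
transform in a very simple way under (3.29), namely by R(u(y₀)) (where y₀ is the center of the cube □).», carried to the new term by
B13 Lemma 2 p.11 «The functions 𝐕_k(Y, 𝐔, 𝐉, B), and both terms in (1.42), are gauge invariant with respect to the simultaneous gauge
transformations (I.3.29), for G^c-valued transformations u in a sufficiently small neighborhood of all G-valued transformations. Let
us remark that the last statement is a simple consequence of the statement in Sect. I.3, in the paragraph containing (I.3.29), and of
the fact that the operations in this section preserve the gauge invariance.» and by B13 pp.21–22 «By Lemma 2, and the transformation
properties of the operators in (2.14) with respect to gauge transformations, e.g. see (3.28)–(3.34) [13], the expressions (2.14) are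
gauge invariant with respect to all G-valued transformations. The expressions are analytic functions of (𝐔,𝐉), hence the invariance
can be extended, by the analyticity, to G^c-valued gauge transformations in a small neighborhood of the space of G-valued ones. This
means that the expressions are constant on intersections of orbits with the corresponding space of configurations (𝐔,𝐉) satisfying
the conditions I.(i)–(iv). We extend them to constant functions on whole orbits having non-empty intersections with the space. The
above remark completes the proof of the inductive assumptions for the action A_{k+1}, hence the proof of Theorem I.3.»; the cell's
reading of the p.276 paragraph (GAPS G-adv7-7, with its displayed witness) is that the (3.29)-invariance of the function defined by
the p.275 recipe holds ONLY for `u` block-constant on the multiscale blocks of the determining configuration `U_{k+1}(□₀,·)` — a class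
depending on the scale AND on the localization domain.  CONSUMED at the next step, for the OLD terms `E^{(j)}`, `j ≤ k+1`, with FINE
(site-dependent) transformations: B12 p.265 «Next we apply the gauge transformation u_k constructed in [14] and changing the axial
gauge into the Landau gauge», (2.6) p.266 «Using the gauge invariance of the action, and the formulas (41), (174) [15] we have
A(U_k(V′V^{(k)})⟦sic: one closing parenthesis short in print; (2.8) prints A(U_k(V′V^{(k)}))⟧ = A(exp iη𝐇_k(B′)U_{k+1})», (3.3) p.270 «Making use of the gauge invariance we have 𝐄^{(j)}(U_k(exp iB′V^{(k)})) −
𝐄^{(j)}(U_k(V^{(k)})) = … where we have used the results of Sect. G [15], and the equality (97) [12]», (3.6) p.271 «Making use of the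
gauge invariance … 𝐄^{(j)}(X, U_j(exp iB_□Ū^j_{k+1})) = 𝐄^{(j)}(X, exp iξ𝐇_j(B_□)U_{k+1})», and (3.37)–(3.38) pp.277–278
«U_j(□₀, exp iτQ(L^{−1}η𝐇_{k+1})) = (exp iξ𝐇_j(□₀, τQ(L^{−1}η𝐇_{k+1})))^{u_j}, … |u_j − 1| < B₃²O(1)Mα₀. (3.37) Assume now that
B₃²O(1)Mα₀ < 1/2α₁, then the orbit of the configuration U_j(□₀, …) above contains the configuration exp iξ𝐇_j(…) satisfying the
conditions (i), (ii)», where (3.38) «ū_j is a gauge transformation constant on blocks naturally connected with the function U_n(X,·),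
and equal to u_j at centers of the blocks».
WHAT THIS PART TYPES (no declaration of `Step` or of Parts I1–I3 is modified; NO reading is adjudicated here — that is the referees'
business, GAPS G-adv7-7 / C-adv7-17): the class becomes a PARAMETER `adm : ∀ j, (T.sys j).Dom → 𝒢 → Prop` ("u is admissible for the
term E^{(j)}(X,·)", the module's gloss); the two gauge clauses at one index for the class only are `SFTower.GaugeInvOn` (antitone in the class; for the
class `SFTower.allGauge` of all of `𝒢` they are the clauses of Parts B1/E1: `SFHyp.gaugeInvOn`, `SFNewTerm.gaugeInvOn`); the
class-relative hypotheses / new-term obligation are `SFHypOn` / `SFNewTermOn`, with the bookkeeping of Part E1 (`zero`, `mono`, `succ`,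
`newTermOn`, `succ_iff`, `sfHypOn_all_of_steps`: the induction CLOSES INSIDE ANY ONE CLASS that the step both consumes and delivers)
and `sfHyp_iff_on_allGauge`, `sfNewTerm_iff_on_allGauge`.  THE LOCATED IMPLICATION: `SFNewTermOn T c adm k →
T.GaugeInvOn c T.allGauge (k+1) → SFNewTerm T c k` (`SFNewTermOn.newTerm_of_lift`) and, over the abstract one-step law of Part I2,
`SFStepObligationS law … K ↔ SFStepObligationOnS law … adm K ∧ SFGaugeLiftS law … adm K` (`sfStepObligationS_iff_on_and_lift`,
kernel-checked `Iff`, for ANY class `adm`; the `RTOp`-carrier form `sfStepObligation_iff_on_and_lift`): B12 Theorem 3's per-step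
obligation SPLITS EXACTLY into (the new-term obligation with (1.19) for the class `adm` only) ∧ (the per-step GAUGE LIFT `SFGaugeLift`
from the class to all of `𝒢` = the class the old-term manipulations (2.6)/(3.3)/(3.6)/(3.37) quantify over).  With `adm` := the
block-constant class of G-adv7-7 the first conjunct is what the cell reads the print as delivering and the second is the lemma the
cell finds unprinted (G-adv7-7's repair R1 «covariant re-gauging — …», in the words of the cell journal NOTE adv7-g8 2026-08-18T19:22:41Z
«one unprinted lemma of the G-IF-05 family»; in B13 p.22's own words, the well-definedness
of «We extend them to constant functions on whole orbits» for fine `u`); with `adm := T.allGauge` the lift is trivial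
(`sfGaugeLift_allGauge`) and the split is Part E1 again.  The alternative closing — a step that CONSUMES only the class it delivers
(the cell's reading of the scheme of [Balaban1989LargeFieldI] §1, GAPS G-adv7-8 (1)) — is `sfHypOn_all_of_steps` /
`b12Thm3ShapeWithinS_iff_obligationWithinS`, with the WEAKER conclusion `∀ k ≤ K, SFHypOn T c adm k` (Theorem 3 with (1.19) for the
class only; `B12Thm3ShapeS.within`: the printed shape implies it for every class).  The large-field clauses `LFHyp.gaugeInvE/R/B`
(Part B3) quantify over all of `𝒢` in the same way; their class-relative form is not typed (B14 §2 inherits the clause and its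
step-(k+1) proof from [I]/[II] verbatim, C-adv7-17).  Prose: the cell's `STEP.md` v9 §5.2 and §11 row O-J1; GAPS C-f2.12;
DIVERGENCE D-f2.17. -/

section GaugeClassSF
variable {P : Params} {G : Type*} [GaugeGroup G] {Φ 𝒢 : Type*}

namespace SFTower

/-- The class of ALL transformations of the reader's type `𝒢`, at every scale and localization domain — the class over which
`SFHyp.spaceInv` / `SFHyp.gaugeInv119` quantify (B12 (1.19) p.263 «for all G^c-valued gauge transformations u», `𝒢` being the
reader's instantiation). [cite: Balaban1987RG1, (1.19) p.263] -/
def allGauge (T : SFTower P G Φ 𝒢) : ∀ j, (T.sys j).Dom → 𝒢 → Prop := fun _ _ _ => True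

/-- (1.19) AND THE GAUGE INVARIANCE OF THE SPACE AT ONE INDEX `j`, FOR THE TRANSFORMATIONS OF A CLASS `adm j X` ONLY («u admissible for
the term E^{(j)}(X,·)»; the class may depend on the scale and on the localization domain — the block-constant class of the cell's GAPS
G-adv7-7 does): `spaceInv` — «The spaces U^c_j(X,α_0,α_1) are, by the definition, gauge invariant also» restricted to the class;
`gaugeInv119` — (1.19) «E^{(j)}(X, g_{j−1}, 𝐔^u, R(u)𝐉) = E^{(j)}(X, g_{j−1}, 𝐔, 𝐉)» for `u` in the class.  A shape: which class the
printed step delivers is the object of GAPS G-adv7-7 and is not asserted here. [cite: Balaban1987RG1, (1.19) p.263] -/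
structure GaugeInvOn (T : SFTower P G Φ 𝒢) (c : SFConsts) (adm : ∀ j, (T.sys j).Dom → 𝒢 → Prop) (j : ℕ) : Prop where
  spaceInv : ∀ X u φ, adm j X u → φ ∈ T.space j X c.α₀ c.α₁ → T.act u φ ∈ T.space j X c.α₀ c.α₁
  gaugeInv119 : ∀ X g u φ, adm j X u → T.E j X g (T.act u φ) = T.E j X g φ

/-- The class-relative gauge clauses are ANTITONE in the class: invariance for a bigger class gives it for a smaller one. [folklore] -/
theorem GaugeInvOn.anti {T : SFTower P G Φ 𝒢} {c : SFConsts} {adm adm' : ∀ j, (T.sys j).Dom → 𝒢 → Prop} {j : ℕ}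
    (h : T.GaugeInvOn c adm j) (hle : ∀ X u, adm' j X u → adm j X u) : T.GaugeInvOn c adm' j where
  spaceInv := fun X u φ hu hφ => h.spaceInv X u φ (hle X u hu) hφ
  gaugeInv119 := fun X g u φ hu => h.gaugeInv119 X g u φ (hle X u hu)

/-- The clauses for ALL of `𝒢` give them for any class. [folklore] -/
theorem GaugeInvOn.of_allGauge {T : SFTower P G Φ 𝒢} {c : SFConsts} {j : ℕ} (h : T.GaugeInvOn c T.allGauge j)
    (adm : ∀ j, (T.sys j).Dom → 𝒢 → Prop) : T.GaugeInvOn c adm j :=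
  h.anti fun _ _ _ => trivial

/-- For the class of all of `𝒢` the structure IS the pair of all-`u` clauses of Parts B1/E1 at the index `j`. [folklore] -/
theorem gaugeInvOn_allGauge_iff (T : SFTower P G Φ 𝒢) (c : SFConsts) (j : ℕ) :
    T.GaugeInvOn c T.allGauge j ↔
      (∀ X u φ, φ ∈ T.space j X c.α₀ c.α₁ → T.act u φ ∈ T.space j X c.α₀ c.α₁) ∧
        (∀ X g u φ, T.E j X g (T.act u φ) = T.E j X g φ) :=
  ⟨fun h => ⟨fun X u φ hφ => h.spaceInv X u φ trivial hφ, fun X g u φ => h.gaugeInv119 X g u φ trivial⟩,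
    fun h => ⟨fun X u φ _ hφ => h.1 X u φ hφ, fun X g u φ _ => h.2 X g u φ⟩⟩

end SFTower

/-- The hypotheses `SFHyp T c k` (Part B1) contain the gauge clauses at every `1 ≤ j ≤ k` for EVERY class (they hold for all of `𝒢`). [folklore] -/
theorem SFHyp.gaugeInvOn {T : SFTower P G Φ 𝒢} {c : SFConsts} {k : ℕ} (h : SFHyp T c k)
    (adm : ∀ j, (T.sys j).Dom → 𝒢 → Prop) {j : ℕ} (h1 : 1 ≤ j) (hj : j ≤ k) : T.GaugeInvOn c adm j where
  spaceInv := fun X u φ _ hφ => h.spaceInv j h1 hj X u φ hφ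
  gaugeInv119 := fun X g u φ _ => h.gaugeInv119 j h1 hj X g u φ

/-- The new-term obligation `SFNewTerm T c k` (Part E1) contains the gauge clauses at `k+1` for EVERY class. [folklore] -/
theorem SFNewTerm.gaugeInvOn {T : SFTower P G Φ 𝒢} {c : SFConsts} {k : ℕ} (h : SFNewTerm T c k)
    (adm : ∀ j, (T.sys j).Dom → 𝒢 → Prop) : T.GaugeInvOn c adm (k+1) where
  spaceInv := fun X u φ _ hφ => h.spaceInv X u φ hφ
  gaugeInv119 := fun X g u φ _ => h.gaugeInv119 X g u φ

/-- THE SMALL-FIELD INDUCTIVE HYPOTHESES AT SCALE `k` WITH (1.19) AND THE SPACE CLAUSE FOR A CLASS `adm` ONLY: the clauses of `SFHyp`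
(Part B1: `rg` (2.15) = (0.20), `localDep` (1.7), `bound118` (1.18), `betaSmooth`/`betaBound` p.264) verbatim, and
`gaugeOn j : T.GaugeInvOn c adm j` in place of `spaceInv`/`gaugeInv119` over all of `𝒢`.  For `adm = T.allGauge` this is `SFHyp`
(`sfHyp_iff_on_allGauge`).  With `adm` := the block-constant class it is the inductive clause the cell's C-adv7-17 calls «the honest
inductive clause for 𝐄^{(j)}» — a reading recorded, not endorsed, by this shape. [cite: Balaban1987RG1, (1.18)–(1.19) p.263] -/
structure SFHypOn (T : SFTower P G Φ 𝒢) (c : SFConsts) (adm : ∀ j, (T.sys j).Dom → 𝒢 → Prop) (k : ℕ) : Prop where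
  rg : ∀ j, j < k → 1 / (T.flow.g j) ^ 2 = 1 / (T.flow.g (j+1)) ^ 2 + T.flow.β (j+1) (T.flow.g j)
  localDep : ∀ j, 1 ≤ j → j ≤ k → ∀ X g φ ψ, T.agreeOn j X φ ψ → T.E j X g φ = T.E j X g ψ
  bound118 : ∀ j, 1 ≤ j → j ≤ k → ∀ X g φ, 0 ≤ g → g ≤ c.γ → φ ∈ T.space j X c.α₀ c.α₁ →
    ‖T.E j X g φ‖ ≤ c.E₀ * Real.exp (-c.κ * (T.sys j).dj X)
  gaugeOn : ∀ j, 1 ≤ j → j ≤ k → T.GaugeInvOn c adm j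
  betaSmooth : ∀ j, 1 ≤ j → j ≤ k → ∀ n : ℕ, ContDiffOn ℝ n (T.flow.β j) (Set.Icc 0 c.γ)
  betaBound : ∀ j, 1 ≤ j → j ≤ k → ∀ x ∈ Set.Icc (0:ℝ) c.γ, |T.flow.β j x| ≤ c.β'

/-- THE NEW-TERM OBLIGATION OF THE STEP `k → k+1` WITH (1.19) AND THE SPACE CLAUSE FOR THE NEW TERM `E^{(k+1)}` FOR A CLASS `adm` ONLY:
the clauses of `SFNewTerm` (Part E1) verbatim except `gaugeOn : T.GaugeInvOn c adm (k+1)`.  With `adm` := the block-constant class this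
is the shape the cell reads B12 p.276 (3.29) with B13 Lemma 2 p.11 and pp.21–22 as delivering (GAPS G-adv7-7); with `adm = T.allGauge`
it is `SFNewTerm` (`sfNewTerm_iff_on_allGauge`). [cite: Balaban1988RG2Cluster, Lemma 2 p.11; pp.21–22] -/
structure SFNewTermOn (T : SFTower P G Φ 𝒢) (c : SFConsts) (adm : ∀ j, (T.sys j).Dom → 𝒢 → Prop) (k : ℕ) : Prop where
  rg : 1 / (T.flow.g k) ^ 2 = 1 / (T.flow.g (k+1)) ^ 2 + T.flow.β (k+1) (T.flow.g k)
  localDep : ∀ X g φ ψ, T.agreeOn (k+1) X φ ψ → T.E (k+1) X g φ = T.E (k+1) X g ψ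
  bound118 : ∀ X g φ, 0 ≤ g → g ≤ c.γ → φ ∈ T.space (k+1) X c.α₀ c.α₁ →
    ‖T.E (k+1) X g φ‖ ≤ c.E₀ * Real.exp (-c.κ * (T.sys (k+1)).dj X)
  gaugeOn : T.GaugeInvOn c adm (k+1)
  betaSmooth : ∀ n : ℕ, ContDiffOn ℝ n (T.flow.β (k+1)) (Set.Icc 0 c.γ)
  betaBound : ∀ x ∈ Set.Icc (0:ℝ) c.γ, |T.flow.β (k+1) x| ≤ c.β'

/-- `SFHyp T c k` gives the class-relative hypotheses for every class. [folklore] -/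
theorem SFHyp.toOn {T : SFTower P G Φ 𝒢} {c : SFConsts} {k : ℕ} (h : SFHyp T c k)
    (adm : ∀ j, (T.sys j).Dom → 𝒢 → Prop) : SFHypOn T c adm k where
  rg := h.rg
  localDep := h.localDep
  bound118 := h.bound118
  gaugeOn := fun _ h1 hj => h.gaugeInvOn adm h1 hj
  betaSmooth := h.betaSmooth
  betaBound := h.betaBound

/-- The class-relative hypotheses for the class of ALL of `𝒢` give back `SFHyp T c k`. [folklore] -/
theorem SFHypOn.sfHyp {T : SFTower P G Φ 𝒢} {c : SFConsts} {k : ℕ} (h : SFHypOn T c T.allGauge k) : SFHyp T c k where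
  rg := h.rg
  localDep := h.localDep
  bound118 := h.bound118
  spaceInv := fun j h1 hj X u φ hφ => (h.gaugeOn j h1 hj).spaceInv X u φ trivial hφ
  gaugeInv119 := fun j h1 hj X g u φ => (h.gaugeOn j h1 hj).gaugeInv119 X g u φ trivial
  betaSmooth := h.betaSmooth
  betaBound := h.betaBound

/-- `SFHyp T c k ↔ SFHypOn T c T.allGauge k`: Part B1's hypotheses ARE the class-relative ones for the class of all of `𝒢`. [folklore] -/
theorem sfHyp_iff_on_allGauge (T : SFTower P G Φ 𝒢) (c : SFConsts) (k : ℕ) : SFHyp T c k ↔ SFHypOn T c T.allGauge k :=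
  ⟨fun h => h.toOn T.allGauge, fun h => h.sfHyp⟩

/-- The class-relative hypotheses are ANTITONE in the class. [folklore] -/
theorem SFHypOn.anti {T : SFTower P G Φ 𝒢} {c : SFConsts} {adm adm' : ∀ j, (T.sys j).Dom → 𝒢 → Prop} {k : ℕ}
    (h : SFHypOn T c adm k) (hle : ∀ j X u, adm' j X u → adm j X u) : SFHypOn T c adm' k where
  rg := h.rg
  localDep := h.localDep
  bound118 := h.bound118
  gaugeOn := fun j h1 hj => (h.gaugeOn j h1 hj).anti (hle j)
  betaSmooth := h.betaSmooth
  betaBound := h.betaBound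

/-- `SFNewTerm T c k` gives the class-relative new-term obligation for every class. [folklore] -/
theorem SFNewTerm.toOn {T : SFTower P G Φ 𝒢} {c : SFConsts} {k : ℕ} (h : SFNewTerm T c k)
    (adm : ∀ j, (T.sys j).Dom → 𝒢 → Prop) : SFNewTermOn T c adm k where
  rg := h.rg
  localDep := h.localDep
  bound118 := h.bound118
  gaugeOn := h.gaugeInvOn adm
  betaSmooth := h.betaSmooth
  betaBound := h.betaBound

/-- The class-relative new-term obligation is ANTITONE in the class. [folklore] -/
theorem SFNewTermOn.anti {T : SFTower P G Φ 𝒢} {c : SFConsts} {adm adm' : ∀ j, (T.sys j).Dom → 𝒢 → Prop} {k : ℕ}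
    (h : SFNewTermOn T c adm k) (hle : ∀ X u, adm' (k+1) X u → adm (k+1) X u) : SFNewTermOn T c adm' k where
  rg := h.rg
  localDep := h.localDep
  bound118 := h.bound118
  gaugeOn := h.gaugeOn.anti hle
  betaSmooth := h.betaSmooth
  betaBound := h.betaBound

/-- THE LOCATED IMPLICATION OF GAPS G-adv7-7 AT THE TYPED LEVEL: the new-term obligation with (1.19) for a class only, TOGETHER WITH the
gauge clauses at `k+1` for ALL of `𝒢` (the per-step gauge lift, discharged by whatever proves it — in the cell's reading an unprinted
lemma, repair R1 of G-adv7-7), is the new-term obligation `SFNewTerm T c k` of Part E1. [folklore] -/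
theorem SFNewTermOn.newTerm_of_lift {T : SFTower P G Φ 𝒢} {c : SFConsts} {adm : ∀ j, (T.sys j).Dom → 𝒢 → Prop} {k : ℕ}
    (h : SFNewTermOn T c adm k) (hl : T.GaugeInvOn c T.allGauge (k+1)) : SFNewTerm T c k where
  rg := h.rg
  localDep := h.localDep
  bound118 := h.bound118
  spaceInv := fun X u φ hφ => hl.spaceInv X u φ trivial hφ
  gaugeInv119 := fun X g u φ => hl.gaugeInv119 X g u φ trivial
  betaSmooth := h.betaSmooth
  betaBound := h.betaBound

/-- `SFNewTerm T c k ↔ SFNewTermOn T c T.allGauge k`. [folklore] -/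
theorem sfNewTerm_iff_on_allGauge (T : SFTower P G Φ 𝒢) (c : SFConsts) (k : ℕ) :
    SFNewTerm T c k ↔ SFNewTermOn T c T.allGauge k :=
  ⟨fun h => h.toOn T.allGauge, fun h => h.newTerm_of_lift h.gaugeOn⟩

/-- At `k = 0` the class-relative hypotheses are vacuous (as `SFHyp.zero`; B12 (0.17)). [folklore] -/
theorem SFHypOn.zero (T : SFTower P G Φ 𝒢) (c : SFConsts) (adm : ∀ j, (T.sys j).Dom → 𝒢 → Prop) : SFHypOn T c adm 0 where
  rg := fun j hj => absurd hj (Nat.not_lt_zero j)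
  localDep := fun j h1 hj => absurd hj (by omega)
  bound118 := fun j h1 hj => absurd hj (by omega)
  gaugeOn := fun j h1 hj => absurd hj (by omega)
  betaSmooth := fun j h1 hj => absurd hj (by omega)
  betaBound := fun j h1 hj => absurd hj (by omega)

/-- Monotonicity in `k` of the class-relative hypotheses (as `SFHyp.mono`). [folklore] -/
theorem SFHypOn.mono {T : SFTower P G Φ 𝒢} {c : SFConsts} {adm : ∀ j, (T.sys j).Dom → 𝒢 → Prop} {k j : ℕ}
    (h : SFHypOn T c adm k) (hjk : j ≤ k) : SFHypOn T c adm j where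
  rg := fun i hi => h.rg i (lt_of_lt_of_le hi hjk)
  localDep := fun i h1 hi => h.localDep i h1 (le_trans hi hjk)
  bound118 := fun i h1 hi => h.bound118 i h1 (le_trans hi hjk)
  gaugeOn := fun i h1 hi => h.gaugeOn i h1 (le_trans hi hjk)
  betaSmooth := fun i h1 hi => h.betaSmooth i h1 (le_trans hi hjk)
  betaBound := fun i h1 hi => h.betaBound i h1 (le_trans hi hjk)

/-- ONE STEP INSIDE A CLASS (as `SFHyp.succ`): the class-relative hypotheses at `k` and the class-relative new-term obligation of the step
`k → k+1` give the class-relative hypotheses at `k+1`. [folklore] -/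
theorem SFHypOn.succ {T : SFTower P G Φ 𝒢} {c : SFConsts} {adm : ∀ j, (T.sys j).Dom → 𝒢 → Prop} {k : ℕ}
    (h : SFHypOn T c adm k) (hn : SFNewTermOn T c adm k) : SFHypOn T c adm (k+1) where
  rg := fun j hj => by
    rcases Nat.lt_succ_iff_lt_or_eq.mp hj with hj' | rfl
    · exact h.rg j hj'
    · exact hn.rg
  localDep := fun j h1 hj => by
    rcases Nat.of_le_succ hj with hj' | rfl
    · exact h.localDep j h1 hj'
    · exact hn.localDep
  bound118 := fun j h1 hj => by
    rcases Nat.of_le_succ hj with hj' | rfl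
    · exact h.bound118 j h1 hj'
    · exact hn.bound118
  gaugeOn := fun j h1 hj => by
    rcases Nat.of_le_succ hj with hj' | rfl
    · exact h.gaugeOn j h1 hj'
    · exact hn.gaugeOn
  betaSmooth := fun j h1 hj => by
    rcases Nat.of_le_succ hj with hj' | rfl
    · exact h.betaSmooth j h1 hj'
    · exact hn.betaSmooth
  betaBound := fun j h1 hj => by
    rcases Nat.of_le_succ hj with hj' | rfl
    · exact h.betaBound j h1 hj'
    · exact hn.betaBound

/-- Conversely the class-relative hypotheses at `k+1` contain the class-relative new-term clauses of the step `k → k+1`. [folklore] -/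
theorem SFHypOn.newTermOn {T : SFTower P G Φ 𝒢} {c : SFConsts} {adm : ∀ j, (T.sys j).Dom → 𝒢 → Prop} {k : ℕ}
    (h : SFHypOn T c adm (k+1)) : SFNewTermOn T c adm k where
  rg := h.rg k (Nat.lt_succ_self k)
  localDep := h.localDep (k+1) k.succ_pos le_rfl
  bound118 := h.bound118 (k+1) k.succ_pos le_rfl
  gaugeOn := h.gaugeOn (k+1) k.succ_pos le_rfl
  betaSmooth := h.betaSmooth (k+1) k.succ_pos le_rfl
  betaBound := h.betaBound (k+1) k.succ_pos le_rfl

/-- `SFHypOn T c adm (k+1) ↔ SFHypOn T c adm k ∧ SFNewTermOn T c adm k`. [folklore] -/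
theorem SFHypOn.succ_iff {T : SFTower P G Φ 𝒢} {c : SFConsts} {adm : ∀ j, (T.sys j).Dom → 𝒢 → Prop} {k : ℕ} :
    SFHypOn T c adm (k+1) ↔ SFHypOn T c adm k ∧ SFNewTermOn T c adm k :=
  ⟨fun h => ⟨h.mono (Nat.le_succ k), h.newTermOn⟩, fun h => h.1.succ h.2⟩

/-- THE INDUCTION INSIDE ONE CLASS: if every step `k < K` delivers the class-relative new-term obligation GIVEN the class-relative
hypotheses at `k` (a step that CONSUMES (1.19) only for the class it DELIVERS — the cell's reading of the scheme of
[Balaban1989LargeFieldI] §1, GAPS G-adv7-8 (1); NOT the printed B12 §§2–3 step, which consumes fine `u` at (2.6)/(3.3)/(3.6)/(3.37)),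
then the class-relative hypotheses hold at every `k ≤ K`.  No gauge lift is needed in this closing. [folklore] -/
theorem sfHypOn_all_of_steps {T : SFTower P G Φ 𝒢} {c : SFConsts} {adm : ∀ j, (T.sys j).Dom → 𝒢 → Prop} {K : ℕ}
    (hstep : ∀ k, k < K → SFHypOn T c adm k → SFNewTermOn T c adm k) : ∀ k, k ≤ K → SFHypOn T c adm k := by
  intro k
  induction k with
  | zero => intro _; exact SFHypOn.zero T c adm
  | succ k ih =>
    intro hk
    have hk' : k < K := Nat.lt_of_succ_le hk
    exact (ih hk'.le).succ (hstep k hk' (ih hk'.le))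

/-- THE PER-STEP GAUGE LIFT over the steps `k < K` (law-free form): GIVEN the hypotheses at `k` (all of `𝒢`, as the printed step consumes
them) and the new-term obligation delivered for the class `adm`, the gauge clauses for `E^{(k+1)}` and its space hold for ALL of `𝒢`.
With `adm` := the block-constant class this is the statement the cell finds unprinted (GAPS G-adv7-7, repair R1 «covariant re-gauging —
…»; «one unprinted lemma of the G-IF-05 family» in the words of the cell journal NOTE adv7-g8 2026-08-18T19:22:41Z; B13 p.22 «We extend them to constant functions on whole orbits» presupposes it for fine `u`); with
`adm = T.allGauge` it is trivial (`sfGaugeLift_allGauge`).  A shape, not asserted. [cite: Balaban1988RG2Cluster, pp.21–22] -/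
def SFGaugeLift (T : SFTower P G Φ 𝒢) (c : SFConsts) (adm : ∀ j, (T.sys j).Dom → 𝒢 → Prop) (K : ℕ) : Prop :=
  ∀ k, k < K → SFHyp T c k → SFNewTermOn T c adm k → T.GaugeInvOn c T.allGauge (k+1)

/-- For the class of all of `𝒢` the lift is trivial. [folklore] -/
theorem sfGaugeLift_allGauge (T : SFTower P G Φ 𝒢) (c : SFConsts) (K : ℕ) : SFGaugeLift T c T.allGauge K :=
  fun _ _ _ hn => hn.gaugeOn

/-- More generally the lift is trivial for any class containing every transformation at the new indices. [folklore] -/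
theorem sfGaugeLift_of_all {T : SFTower P G Φ 𝒢} {c : SFConsts} {adm : ∀ j, (T.sys j).Dom → 𝒢 → Prop} {K : ℕ}
    (hall : ∀ k, k < K → ∀ X u, adm (k+1) X u) : SFGaugeLift T c adm K :=
  fun k hk _ hn => hn.gaugeOn.anti fun X u _ => hall k hk X u

/-- The lift is MONOTONE in the class (a lift from a smaller class is a stronger statement). [folklore] -/
theorem SFGaugeLift.mono {T : SFTower P G Φ 𝒢} {c : SFConsts} {adm adm' : ∀ j, (T.sys j).Dom → 𝒢 → Prop} {K : ℕ}
    (h : SFGaugeLift T c adm K) (hle : ∀ j X u, adm j X u → adm' j X u) : SFGaugeLift T c adm' K :=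
  fun k hk hH hn => h k hk hH (hn.anti (hle (k+1)))

/-- THE MIXED INDUCTION (the printed architecture as the cell reads it): hypotheses for ALL of `𝒢` below, class-relative delivery at each
step, and the per-step lift, give the hypotheses `SFHyp T c k` of Part B1 at every `k ≤ K`. [folklore] -/
theorem sfHyp_all_of_stepsOn_of_lift {T : SFTower P G Φ 𝒢} {c : SFConsts} {adm : ∀ j, (T.sys j).Dom → 𝒢 → Prop} {K : ℕ}
    (hstep : ∀ k, k < K → SFHyp T c k → SFNewTermOn T c adm k) (hlift : SFGaugeLift T c adm K) :
    ∀ k, k ≤ K → SFHyp T c k :=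
  sfHyp_all_of_steps fun k hk h => (hstep k hk h).newTerm_of_lift (hlift k hk h (hstep k hk h))

/-! ### J2. The split of B12 Theorem 3's per-step obligation over the abstract one-step law of Part I2 -/

variable {av : ∀ j, Averaging P j G}

/-- THE CLASS-RELATIVE PER-STEP OBLIGATION over an abstract one-step law (cf. `SFStepObligationS`, Part I2): for the generated sequence with
the couplings in the interval, each step `k < K`, GIVEN the hypotheses at `k` for all of `𝒢`, delivers the new-term obligation with
(1.19) for the class `adm` only.  With `adm` := the block-constant class: what the cell reads B12 §§2–5 with B13 (Lemma 2, pp.21–22) as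
delivering (GAPS G-adv7-7).  A shape, not asserted. [cite: Balaban1987RG1, (2.12)–(2.15) p.268] -/
def SFStepObligationOnS (law : (k : ℕ) → ℝ → Density P k G → Density P (k+1) G → Prop)
    (bg : Background P G av) (A : ∀ k, Density P k G) (T : SFTower P G Φ 𝒢) (c : SFConsts)
    (adm : ∀ j, (T.sys j).Dom → 𝒢 → Prop) (K : ℕ) : Prop :=
  GeneratedBySteps law bg A T K → T.flow.InInterval c.γ K → ∀ k, k < K → SFHyp T c k → SFNewTermOn T c adm k

/-- THE PER-STEP GAUGE LIFT over an abstract one-step law: `SFGaugeLift` under the generation and interval hypotheses of Theorem 3's shape. [cite: Balaban1988RG2Cluster, pp.21–22] -/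
def SFGaugeLiftS (law : (k : ℕ) → ℝ → Density P k G → Density P (k+1) G → Prop)
    (bg : Background P G av) (A : ∀ k, Density P k G) (T : SFTower P G Φ 𝒢) (c : SFConsts)
    (adm : ∀ j, (T.sys j).Dom → 𝒢 → Prop) (K : ℕ) : Prop :=
  GeneratedBySteps law bg A T K → T.flow.InInterval c.γ K → SFGaugeLift T c adm K

/-- B12 THEOREM 3'S PER-STEP OBLIGATION SPLITS EXACTLY, for ANY class `adm`, into the class-relative obligation and the per-step gauge lift:
`SFStepObligationS ↔ SFStepObligationOnS adm ∧ SFGaugeLiftS adm`.  Kernel-checked `Iff`; the cell's GAPS G-adv7-7 is thereby a statement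
about which conjunct the print proves for `adm` := the block-constant class (the first) and which it does not (the second). [folklore] -/
theorem sfStepObligationS_iff_on_and_lift (law : (k : ℕ) → ℝ → Density P k G → Density P (k+1) G → Prop)
    (bg : Background P G av) (A : ∀ k, Density P k G) (T : SFTower P G Φ 𝒢) (c : SFConsts)
    (adm : ∀ j, (T.sys j).Dom → 𝒢 → Prop) (K : ℕ) :
    SFStepObligationS law bg A T c K ↔ SFStepObligationOnS law bg A T c adm K ∧ SFGaugeLiftS law bg A T c adm K := by
  constructor
  · intro h
    exact ⟨fun hgen hI k hk hH => (h hgen hI k hk hH).toOn adm,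
      fun hgen hI k hk hH _ => (h hgen hI k hk hH).gaugeInvOn T.allGauge⟩
  · rintro ⟨hOn, hL⟩ hgen hI k hk hH
    exact (hOn hgen hI k hk hH).newTerm_of_lift (hL hgen hI k hk hH (hOn hgen hI k hk hH))

/-- Hence the class-relative obligation and the lift DISCHARGE Theorem 3's shape over the law (`B12Thm3ShapeS`, Part I2). [folklore] -/
theorem b12Thm3ShapeS_of_on_of_lift (law : (k : ℕ) → ℝ → Density P k G → Density P (k+1) G → Prop)
    (bg : Background P G av) (A : ∀ k, Density P k G) (T : SFTower P G Φ 𝒢) (c : SFConsts)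
    (adm : ∀ j, (T.sys j).Dom → 𝒢 → Prop) (K : ℕ)
    (hOn : SFStepObligationOnS law bg A T c adm K) (hL : SFGaugeLiftS law bg A T c adm K) : B12Thm3ShapeS law bg A T c K :=
  (B12Thm3ShapeS_iff_obligationS law bg A T c K).mpr ((sfStepObligationS_iff_on_and_lift law bg A T c adm K).mpr ⟨hOn, hL⟩)

/-- For the class of all of `𝒢` the lift conjunct is trivially true. [folklore] -/
theorem sfGaugeLiftS_allGauge (law : (k : ℕ) → ℝ → Density P k G → Density P (k+1) G → Prop)
    (bg : Background P G av) (A : ∀ k, Density P k G) (T : SFTower P G Φ 𝒢) (c : SFConsts) (K : ℕ) :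
    SFGaugeLiftS law bg A T c T.allGauge K :=
  fun _ _ => sfGaugeLift_allGauge T c K

/-- … so for `adm = T.allGauge` the split is Part I2's obligation again: `SFStepObligationS ↔ SFStepObligationOnS allGauge`. [folklore] -/
theorem sfStepObligationS_iff_onS_allGauge (law : (k : ℕ) → ℝ → Density P k G → Density P (k+1) G → Prop)
    (bg : Background P G av) (A : ∀ k, Density P k G) (T : SFTower P G Φ 𝒢) (c : SFConsts) (K : ℕ) :
    SFStepObligationS law bg A T c K ↔ SFStepObligationOnS law bg A T c T.allGauge K := by
  rw [sfStepObligationS_iff_on_and_lift law bg A T c T.allGauge K]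
  exact ⟨fun h => h.1, fun h => ⟨h, sfGaugeLiftS_allGauge law bg A T c K⟩⟩

/-- SHAPE OF THEOREM 3 WITH (1.19) FOR A CLASS ONLY (the weaker theorem: conclusion `SFHypOn T c adm k` at every `k ≤ K`). [cite: Balaban1987RG1, Thm 3 p.264] -/
def B12Thm3ShapeWithinS (law : (k : ℕ) → ℝ → Density P k G → Density P (k+1) G → Prop)
    (bg : Background P G av) (A : ∀ k, Density P k G) (T : SFTower P G Φ 𝒢) (c : SFConsts)
    (adm : ∀ j, (T.sys j).Dom → 𝒢 → Prop) (K : ℕ) : Prop :=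
  GeneratedBySteps law bg A T K → T.flow.InInterval c.γ K → ∀ k, k ≤ K → SFHypOn T c adm k

/-- THE PER-STEP OBLIGATION INSIDE A CLASS: each step consumes AND delivers (1.19) for the class `adm` only. [cite: Balaban1987RG1, (2.12)–(2.15) p.268] -/
def SFStepObligationWithinS (law : (k : ℕ) → ℝ → Density P k G → Density P (k+1) G → Prop)
    (bg : Background P G av) (A : ∀ k, Density P k G) (T : SFTower P G Φ 𝒢) (c : SFConsts)
    (adm : ∀ j, (T.sys j).Dom → 𝒢 → Prop) (K : ℕ) : Prop :=
  GeneratedBySteps law bg A T K → T.flow.InInterval c.γ K → ∀ k, k < K → SFHypOn T c adm k → SFNewTermOn T c adm k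

/-- `B12Thm3ShapeWithinS ↔ SFStepObligationWithinS` (as `B12Thm3ShapeS_iff_obligationS`, inside the class). Kernel-checked bookkeeping. [folklore] -/
theorem b12Thm3ShapeWithinS_iff_obligationWithinS (law : (k : ℕ) → ℝ → Density P k G → Density P (k+1) G → Prop)
    (bg : Background P G av) (A : ∀ k, Density P k G) (T : SFTower P G Φ 𝒢) (c : SFConsts)
    (adm : ∀ j, (T.sys j).Dom → 𝒢 → Prop) (K : ℕ) :
    B12Thm3ShapeWithinS law bg A T c adm K ↔ SFStepObligationWithinS law bg A T c adm K := by
  constructor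
  · intro h hgen hI k hk _
    exact (h hgen hI (k+1) hk).newTermOn
  · intro h hgen hI
    exact sfHypOn_all_of_steps (h hgen hI)

/-- The printed shape (conclusion for all of `𝒢`) implies the class-relative shape for every class. [folklore] -/
theorem B12Thm3ShapeS.within {law : (k : ℕ) → ℝ → Density P k G → Density P (k+1) G → Prop}
    {bg : Background P G av} {A : ∀ k, Density P k G} {T : SFTower P G Φ 𝒢} {c : SFConsts} {K : ℕ}
    (h : B12Thm3ShapeS law bg A T c K) (adm : ∀ j, (T.sys j).Dom → 𝒢 → Prop) : B12Thm3ShapeWithinS law bg A T c adm K :=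
  fun hgen hI k hk => (h hgen hI k hk).toOn adm

/-- … and for `adm = T.allGauge` the two shapes coincide. [folklore] -/
theorem b12Thm3ShapeS_iff_within_allGauge (law : (k : ℕ) → ℝ → Density P k G → Density P (k+1) G → Prop)
    (bg : Background P G av) (A : ∀ k, Density P k G) (T : SFTower P G Φ 𝒢) (c : SFConsts) (K : ℕ) :
    B12Thm3ShapeS law bg A T c K ↔ B12Thm3ShapeWithinS law bg A T c T.allGauge K :=
  ⟨fun h => h.within T.allGauge, fun h hgen hI k hk => (h hgen hI k hk).sfHyp⟩

/-- `SFStepObligationWithinS → SFStepObligationOnS`: a step that makes do with the class-relative hypotheses a fortiori delivers the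
class-relative new term from the hypotheses for all of `𝒢` (the converse is not formal: the printed B12 §§2–3 step consumes (1.19) for
fine `u`, i.e. for more than the class it delivers — GAPS G-adv7-7). [folklore] -/
theorem SFStepObligationWithinS.onS {law : (k : ℕ) → ℝ → Density P k G → Density P (k+1) G → Prop}
    {bg : Background P G av} {A : ∀ k, Density P k G} {T : SFTower P G Φ 𝒢} {c : SFConsts}
    {adm : ∀ j, (T.sys j).Dom → 𝒢 → Prop} {K : ℕ} (h : SFStepObligationWithinS law bg A T c adm K) :
    SFStepObligationOnS law bg A T c adm K :=
  fun hgen hI k hk hH => h hgen hI k hk (hH.toOn adm)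

variable [MeasurableSpace G] [HaarData G]

/-- THE SPLIT FOR THE `RTOp`-CARRIER FORM of `Step` Part E1: `SFStepObligation av Tk … ↔ SFStepObligationOnS (smallFieldLaw av Tk χ GF) … adm
∧ SFGaugeLiftS (smallFieldLaw av Tk χ GF) … adm` (via `SFStepObligation_iff_steps`, Part I2); the `RTOpI` / operator-level forms of Part
I3 are the instances `law := smallFieldLawI Tk χ GF` / `smallFieldLawOp Tk χ GF` of `sfStepObligationS_iff_on_and_lift` by `rfl`. [folklore] -/
theorem sfStepObligation_iff_on_and_lift (av : ∀ j, Averaging P j G) (Tk : ∀ k, RTOp P k G (av k)) (χ GF : ∀ k, Density P k G)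
    (bg : Background P G av) (A : ∀ k, Density P k G) (T : SFTower P G Φ 𝒢) (c : SFConsts)
    (adm : ∀ j, (T.sys j).Dom → 𝒢 → Prop) (K : ℕ) :
    SFStepObligation av Tk χ GF bg A T c K ↔
      SFStepObligationOnS (smallFieldLaw av Tk χ GF) bg A T c adm K ∧ SFGaugeLiftS (smallFieldLaw av Tk χ GF) bg A T c adm K := by
  rw [SFStepObligation_iff_steps]
  exact sfStepObligationS_iff_on_and_lift (smallFieldLaw av Tk χ GF) bg A T c adm K

end GaugeClassSF

/-! ## Part K (v10) — THE PER-STEP GAUGE LIFT IS THE RESIDUAL-CLASS CLAUSES: the gauge clauses factor through a product of classes,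
per scale AND localization domain (react-only, f2 gen 9)

REACT-ONLY ADDITION answering the kernel bridge landed by the cell's b03 lineage (`B12Inv329` v1.1 §8, an IMPORTER of this module;
cell GAPS C-b03g5-3): there, for a class `adm` containing the block-constant transformations of a SCALE-indexed idempotent
homomorphism `bc : ℕ → (𝒢 →* 𝒢)`, and under the composition law of the action, Part J's per-step gauge lift `SFGaugeLift T c adm K`
is proved equivalent to the (1.19)+space clauses on the purely fine transformations `ker (bc (k+1))` at each new index
(`B12Inv329.sfGaugeLift_iff_fine`, with `Set`-valued classes `GaugeInv119On` / `SpaceInvOn`).  In the print the blocks depend on the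
LOCALIZATION DOMAIN as well as on the scale — [Balaban1987RG1] p.262, condition (iv) of the definition of `U^c_j(X, α₀, α₁, γ₀)`:
«We consider X as Ω₀, and we construct the sequence {Ω_n}, n = 1, ..., j, of maximal possible domains satisfying the conditions
(1.3)–(1.6) [14] (with j, ξ instead of k, η, R = R₁). For this sequence, or rather for its subsequences {Ω₀, Ω₁, ..., Ω_n},
n = 1, ..., j, we construct the functions U_n(V) in the axial gauges, for regular G^c-valued configurations V.»; p.278, after (3.38):
«where ū_j is a gauge transformation constant on blocks naturally connected with the function U_n(X,·), and equal to u_j at centers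
of the blocks.» — and in the cell's reduction (∗) of GAPS G-adv7-7 the residual transformation `g = ũ⁻¹u` is «= 1 at block centres
and outside □₀», `□₀ ⊂ X` the cube of the term (a class per `(k+1, X)`, which is why Part J's `adm` takes the domain as an argument).
This Part states the reduction at Part J's own generality — classes `adm`, `res` depending on `(j, X)`, no block homomorphism
needed.  The composition law is the HYPOTHESIS `hact : ∀ u v φ, T.act (u * v) φ = T.act u (T.act v φ)`, stated inline (it is
`B12Inv329.ActMul T` of the b03 module; the abstract `SFTower.act` of `Step` carries no group structure) and read off (1.10) p.262
«A G^c-valued gauge transformation u acts on pairs (𝐔, 𝐉) in the following way (𝐔, 𝐉)^u = (𝐔^u, R(u)𝐉) = (u_−𝐔u_+^{−1}, R(u_−)𝐉),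
(1.10) where for a bond b = ⟨b_−, b_+⟩ we define u_±(b) = u(b_±).» (so `(𝐔^v)^u = 𝐔^{uv}`, i.e. `T.act (u * v) = T.act u ∘ T.act v`
for `T.act u 𝐔 := 𝐔^u`).  CONTENT (all [folklore] bookkeeping; K1) the gauge clauses at `j` for two classes give them for the
pointwise PRODUCT class (`SFTower.GaugeInvOn.mul`), hence for all of `𝒢` when the two classes COVER at `j` — every `u = a * b` with `a`
admissible and `b` residual for the term at `X` (`SFTower.CoversAt`, `SFTower.GaugeInvOn.allGauge_of_covers`); K2) THE LIFT IS THE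
RESIDUAL-CLASS CLAUSES: `SFGaugeLift T c adm K ↔ ∀ k < K, SFHyp T c k → SFNewTermOn T c adm k → T.GaugeInvOn c res (k+1)` whenever
`adm`, `res` cover at every new index (`sfGaugeLift_iff_residual`), and over the abstract one-step law of Part I2 B12 Theorem 3's
per-step obligation splits as `SFStepObligationOnS … adm ∧ SFResidualS … adm res` (`sfStepObligationS_iff_on_and_residual`, from
Part J's `sfStepObligationS_iff_on_and_lift`); K3) THE BLOCK INSTANCE per scale and domain: for idempotent block-averaging
homomorphisms `bt j X : 𝒢 →* 𝒢` ("u ↦ ū" for the term `E^{(j)}(X,·)`, the module's gloss) the block class `bt j X u = u` — indeed any class containing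
each `bt j X u` — and the OFF-BLOCK class `bt j X u = 1` cover (`u = ū · (ū⁻¹u)`; `SFTower.coversAt_block_offBlock`,
`coversAt_offBlock_of_contains`), so the lift ⟺ the clauses for the off-block transformations of the new terms
(`sfGaugeLift_iff_offBlock`, `sfStepObligationS_iff_on_and_offBlock`); with `bt j X := bc j` constant in `X` these are the statements
of `B12Inv329.sfGaugeLift_iff_fine` / `sfGaugeLift_blockConstantClass_iff` up to the `Set` phrasing, and with the □₀-local block
averaging of G-adv7-7 the off-block class at `(k+1, X)` is exactly its (∗)-class.  NOTHING about Bałaban's `E^{(k+1)}` is asserted: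
which class the printed step delivers, and whether the residual clauses hold (repair R1 of G-adv7-7 «covariant re-gauging — …»; «one unprinted lemma of the
G-IF-05 family» in the words of the cell journal NOTE adv7-g8 2026-08-18T19:22:41Z), are the referees' and the instantiating readers' business — GAPS G-adv7-7 / C-adv7-17 / C-b03g5-3 / C-f2.13, the
cell's `STEP.md` v10 §5.2 and §11 row O-J1.
-/

section GaugeClassFactor
variable {P : Params} {G : Type*} [GaugeGroup G] {Φ 𝒢 : Type*}

namespace SFTower

section MulClasses
variable [Mul 𝒢]

/-- The pointwise PRODUCT of two classes, per scale and localization domain: `u` is in the product class at `(j, X)` iff `u = a * b`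
with `a` in `adm₁ j X` and `b` in `adm₂ j X`. [folklore] -/
def mulClass (T : SFTower P G Φ 𝒢) (adm₁ adm₂ : ∀ j, (T.sys j).Dom → 𝒢 → Prop) : ∀ j, (T.sys j).Dom → 𝒢 → Prop :=
  fun j X u => ∃ a b, adm₁ j X a ∧ adm₂ j X b ∧ u = a * b

/-- `adm₁` and `adm₂` COVER at the index `j`: for every localization domain `X` of scale `j` every transformation factors as
(admissible for `adm₁`) · (admissible for `adm₂`) — in the cell's GAPS G-adv7-7, `u = ũ · (ũ⁻¹u)` with `ũ` block-constant on `□₀ ⊂ X`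
and `ũ⁻¹u` «= 1 at block centres and outside □₀». [folklore] -/
def CoversAt (T : SFTower P G Φ 𝒢) (adm₁ adm₂ : ∀ j, (T.sys j).Dom → 𝒢 → Prop) (j : ℕ) : Prop :=
  ∀ X u, T.mulClass adm₁ adm₂ j X u

/-- Covering is MONOTONE in both classes. [folklore] -/
theorem CoversAt.mono {T : SFTower P G Φ 𝒢} {adm₁ adm₂ adm₁' adm₂' : ∀ j, (T.sys j).Dom → 𝒢 → Prop} {j : ℕ}
    (h : T.CoversAt adm₁ adm₂ j) (h₁ : ∀ X u, adm₁ j X u → adm₁' j X u) (h₂ : ∀ X u, adm₂ j X u → adm₂' j X u) :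
    T.CoversAt adm₁' adm₂' j := by
  intro X u
  obtain ⟨a, b, ha, hb, hab⟩ := h X u
  exact ⟨a, b, h₁ X a ha, h₂ X b hb, hab⟩

/-- PRODUCT RULE: under the composition law of the action ((1.10): `T.act (a * b) = T.act a ∘ T.act b`) the gauge clauses at `j` for
two classes give them for the product class — `E(𝐔^{ab}) = E((𝐔^b)^a) = E(𝐔^b) = E(𝐔)`, and the space is stable in two steps.
[cite: Balaban1987RG1, (1.10) p.262; (1.19) p.263] -/
theorem GaugeInvOn.mul {T : SFTower P G Φ 𝒢} {c : SFConsts} {adm₁ adm₂ : ∀ j, (T.sys j).Dom → 𝒢 → Prop} {j : ℕ}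
    (hact : ∀ (u v : 𝒢) (φ : Φ), T.act (u * v) φ = T.act u (T.act v φ))
    (h₁ : T.GaugeInvOn c adm₁ j) (h₂ : T.GaugeInvOn c adm₂ j) : T.GaugeInvOn c (T.mulClass adm₁ adm₂) j where
  spaceInv := by
    rintro X u φ ⟨a, b, ha, hb, rfl⟩ hφ
    rw [hact]
    exact h₁.spaceInv X a (T.act b φ) ha (h₂.spaceInv X b φ hb hφ)
  gaugeInv119 := by
    rintro X g u φ ⟨a, b, ha, hb, rfl⟩
    rw [hact, h₁.gaugeInv119 X g a (T.act b φ) ha, h₂.gaugeInv119 X g b φ hb]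

/-- If two classes cover at `j`, their gauge clauses give the clauses for ALL of `𝒢` at `j`. [folklore] -/
theorem GaugeInvOn.allGauge_of_covers {T : SFTower P G Φ 𝒢} {c : SFConsts} {adm₁ adm₂ : ∀ j, (T.sys j).Dom → 𝒢 → Prop}
    {j : ℕ} (hact : ∀ (u v : 𝒢) (φ : Φ), T.act (u * v) φ = T.act u (T.act v φ)) (hcov : T.CoversAt adm₁ adm₂ j)
    (h₁ : T.GaugeInvOn c adm₁ j) (h₂ : T.GaugeInvOn c adm₂ j) : T.GaugeInvOn c T.allGauge j :=
  (h₁.mul hact h₂).anti fun X u _ => hcov X u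

end MulClasses

section Blocks
variable [Group 𝒢]

/-- THE BLOCK CLASS of a family of block-averaging homomorphisms `bt j X : 𝒢 →* 𝒢` ("u ↦ ū", the module's gloss, per scale AND localization domain —
[Balaban1987RG1] p.278 «where ū_j is a gauge transformation constant on blocks naturally connected with the function U_n(X,·), and
equal to u_j at centers of the blocks.»): `u` admissible at `(j, X)` iff `bt j X u = u`.  With `bt j X` independent of `X` this is
`B12Inv329.blockConstantClass` of the cell's b03 module.  A shape: no block averaging of Bałaban's is constructed here.
[cite: Balaban1987RG1, (3.38) p.278] -/
def blockClass (T : SFTower P G Φ 𝒢) (bt : ∀ j, (T.sys j).Dom → (𝒢 →* 𝒢)) : ∀ j, (T.sys j).Dom → 𝒢 → Prop :=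
  fun j X u => bt j X u = u

/-- THE OFF-BLOCK (purely fine) CLASS: `bt j X u = 1` — for the □₀-local block averaging of the cell's GAPS G-adv7-7 these are its
residual transformations `g = ũ⁻¹u` («= 1 at block centres and outside □₀»). [folklore] -/
def offBlockClass (T : SFTower P G Φ 𝒢) (bt : ∀ j, (T.sys j).Dom → (𝒢 →* 𝒢)) : ∀ j, (T.sys j).Dom → 𝒢 → Prop :=
  fun j X u => bt j X u = 1

/-- For IDEMPOTENT block averaging every `u = ū · (ū⁻¹u)` with `ū` in the block class and `ū⁻¹u` off-block, so the two classes cover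
at every index (the `(j, X)`-dependent form of `B12Inv329.range_mul_ker_eq_univ`). [folklore] -/
theorem coversAt_block_offBlock (T : SFTower P G Φ 𝒢) (bt : ∀ j, (T.sys j).Dom → (𝒢 →* 𝒢))
    (hidem : ∀ j X u, bt j X (bt j X u) = bt j X u) (j : ℕ) : T.CoversAt (T.blockClass bt) (T.offBlockClass bt) j := by
  intro X u
  refine ⟨bt j X u, (bt j X u)⁻¹ * u, hidem j X u, ?_, (mul_inv_cancel_left (bt j X u) u).symm⟩
  show bt j X ((bt j X u)⁻¹ * u) = 1
  rw [map_mul, map_inv, hidem, inv_mul_cancel]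

/-- More generally: any class CONTAINING each `bt j X u` covers together with the off-block class. [folklore] -/
theorem coversAt_offBlock_of_contains (T : SFTower P G Φ 𝒢) (bt : ∀ j, (T.sys j).Dom → (𝒢 →* 𝒢))
    (hidem : ∀ j X u, bt j X (bt j X u) = bt j X u) {adm : ∀ j, (T.sys j).Dom → 𝒢 → Prop}
    (hadm : ∀ j X u, adm j X (bt j X u)) (j : ℕ) : T.CoversAt adm (T.offBlockClass bt) j :=
  (T.coversAt_block_offBlock bt hidem j).mono (fun X u hu => hu ▸ hadm j X u) fun _ _ hu => hu

end Blocks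

end SFTower

/-! ### K2. The lift is the residual-class clauses; the split of Theorem 3's per-step obligation over the abstract law -/

section Residual
variable {av : ∀ j, Averaging P j G}

/-- THE RESIDUAL OBLIGATION over an abstract one-step law (cf. `SFGaugeLiftS`, Part J): for the generated sequence with the couplings
in the interval, at each step `k < K`, GIVEN the hypotheses at `k` (all of `𝒢`) and the class-relative delivery for `adm`, the gauge
clauses ((1.19) + the space clause) of the NEW term for the residual class `res` only.  With `adm` := the block class and `res` :=
the off-block class of the cell's GAPS G-adv7-7 this is its located unprinted statement (repair R1) in its sharpest form.  A shape,
not asserted. [cite: Balaban1988RG2Cluster, pp.21–22] -/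
def SFResidualS (law : (k : ℕ) → ℝ → Density P k G → Density P (k+1) G → Prop)
    (bg : Background P G av) (A : ∀ k, Density P k G) (T : SFTower P G Φ 𝒢) (c : SFConsts)
    (adm res : ∀ j, (T.sys j).Dom → 𝒢 → Prop) (K : ℕ) : Prop :=
  GeneratedBySteps law bg A T K → T.flow.InInterval c.γ K →
    ∀ k, k < K → SFHyp T c k → SFNewTermOn T c adm k → T.GaugeInvOn c res (k+1)

/-- The lift gives the residual obligation for EVERY residual class (no covering, no composition law needed). [folklore] -/
theorem SFGaugeLiftS.residualS {law : (k : ℕ) → ℝ → Density P k G → Density P (k+1) G → Prop}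
    {bg : Background P G av} {A : ∀ k, Density P k G} {T : SFTower P G Φ 𝒢} {c : SFConsts}
    {adm : ∀ j, (T.sys j).Dom → 𝒢 → Prop} {K : ℕ} (h : SFGaugeLiftS law bg A T c adm K)
    (res : ∀ j, (T.sys j).Dom → 𝒢 → Prop) : SFResidualS law bg A T c adm res K :=
  fun hgen hI k hk hH hn => (h hgen hI k hk hH hn).of_allGauge res

variable [Mul 𝒢]

/-- THE LIFT REDUCES TO THE RESIDUAL CLASS (law-free form): if `adm` and `res` cover at every new index `k+1 ≤ K`, then under the
composition law Part J's per-step gauge lift for `adm` ⟺ at each new index, GIVEN the hypotheses at `k` and the class-relative delivery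
for `adm`, the gauge clauses for `res`.  `B12Inv329.sfGaugeLift_iff_fine` (b03) is the instance with `X`-independent blocks. [folklore] -/
theorem sfGaugeLift_iff_residual {T : SFTower P G Φ 𝒢} {c : SFConsts} {adm res : ∀ j, (T.sys j).Dom → 𝒢 → Prop} {K : ℕ}
    (hact : ∀ (u v : 𝒢) (φ : Φ), T.act (u * v) φ = T.act u (T.act v φ))
    (hcov : ∀ k, k < K → T.CoversAt adm res (k+1)) :
    SFGaugeLift T c adm K ↔ ∀ k, k < K → SFHyp T c k → SFNewTermOn T c adm k → T.GaugeInvOn c res (k+1) :=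
  ⟨fun h k hk hH hn => (h k hk hH hn).of_allGauge res,
    fun h k hk hH hn => hn.gaugeOn.allGauge_of_covers hact (hcov k hk) (h k hk hH hn)⟩

/-- Sufficient form: residual-class clauses at every new index give the lift (no use of the data at `k`). [folklore] -/
theorem sfGaugeLift_of_residual {T : SFTower P G Φ 𝒢} {c : SFConsts} {adm res : ∀ j, (T.sys j).Dom → 𝒢 → Prop} {K : ℕ}
    (hact : ∀ (u v : 𝒢) (φ : Φ), T.act (u * v) φ = T.act u (T.act v φ))
    (hcov : ∀ k, k < K → T.CoversAt adm res (k+1)) (hres : ∀ k, k < K → T.GaugeInvOn c res (k+1)) :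
    SFGaugeLift T c adm K :=
  (sfGaugeLift_iff_residual hact hcov).mpr fun k hk _ _ => hres k hk

/-- Over the abstract law: `SFGaugeLiftS … adm ↔ SFResidualS … adm res` when the classes cover at the new indices. [folklore] -/
theorem sfGaugeLiftS_iff_residualS (law : (k : ℕ) → ℝ → Density P k G → Density P (k+1) G → Prop)
    (bg : Background P G av) (A : ∀ k, Density P k G) (T : SFTower P G Φ 𝒢) (c : SFConsts)
    {adm res : ∀ j, (T.sys j).Dom → 𝒢 → Prop} (K : ℕ)
    (hact : ∀ (u v : 𝒢) (φ : Φ), T.act (u * v) φ = T.act u (T.act v φ))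
    (hcov : ∀ k, k < K → T.CoversAt adm res (k+1)) :
    SFGaugeLiftS law bg A T c adm K ↔ SFResidualS law bg A T c adm res K :=
  ⟨fun h hgen hI => (sfGaugeLift_iff_residual hact hcov).mp (h hgen hI),
    fun h hgen hI => (sfGaugeLift_iff_residual hact hcov).mpr (h hgen hI)⟩

/-- B12 THEOREM 3'S PER-STEP OBLIGATION SPLITS AS (class-relative delivery) ∧ (residual-class clauses):
`SFStepObligationS ↔ SFStepObligationOnS adm ∧ SFResidualS adm res` for covering classes under the composition law — Part J's
`sfStepObligationS_iff_on_and_lift` with the lift conjunct rewritten by `sfGaugeLiftS_iff_residualS`.  Kernel-checked `Iff`; which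
conjunct the print proves for which classes is the object of GAPS G-adv7-7, not asserted here. [folklore] -/
theorem sfStepObligationS_iff_on_and_residual (law : (k : ℕ) → ℝ → Density P k G → Density P (k+1) G → Prop)
    (bg : Background P G av) (A : ∀ k, Density P k G) (T : SFTower P G Φ 𝒢) (c : SFConsts)
    {adm res : ∀ j, (T.sys j).Dom → 𝒢 → Prop} (K : ℕ)
    (hact : ∀ (u v : 𝒢) (φ : Φ), T.act (u * v) φ = T.act u (T.act v φ))
    (hcov : ∀ k, k < K → T.CoversAt adm res (k+1)) :
    SFStepObligationS law bg A T c K ↔ SFStepObligationOnS law bg A T c adm K ∧ SFResidualS law bg A T c adm res K := by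
  rw [sfStepObligationS_iff_on_and_lift law bg A T c adm K, sfGaugeLiftS_iff_residualS law bg A T c K hact hcov]

/-- Hence class-relative delivery and the residual-class clauses DISCHARGE Theorem 3's shape over the law (`B12Thm3ShapeS`, Part I2). [folklore] -/
theorem b12Thm3ShapeS_of_on_of_residual (law : (k : ℕ) → ℝ → Density P k G → Density P (k+1) G → Prop)
    (bg : Background P G av) (A : ∀ k, Density P k G) (T : SFTower P G Φ 𝒢) (c : SFConsts)
    {adm res : ∀ j, (T.sys j).Dom → 𝒢 → Prop} (K : ℕ)
    (hact : ∀ (u v : 𝒢) (φ : Φ), T.act (u * v) φ = T.act u (T.act v φ))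
    (hcov : ∀ k, k < K → T.CoversAt adm res (k+1))
    (hOn : SFStepObligationOnS law bg A T c adm K) (hres : SFResidualS law bg A T c adm res K) : B12Thm3ShapeS law bg A T c K :=
  b12Thm3ShapeS_of_on_of_lift law bg A T c adm K hOn ((sfGaugeLiftS_iff_residualS law bg A T c K hact hcov).mpr hres)

end Residual

/-! ### K3. The block instance: the lift is the off-block clauses, per scale and localization domain -/

section OffBlock
variable {av : ∀ j, Averaging P j G} [Group 𝒢]

/-- THE LIFT ⟺ THE OFF-BLOCK CLAUSES, for ANY class containing the block averages `bt j X u` (idempotent `bt`, per scale and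
domain) — the `(j, X)`-dependent form of `B12Inv329.sfGaugeLift_iff_fine`. [folklore] -/
theorem sfGaugeLift_iff_offBlock {T : SFTower P G Φ 𝒢} {c : SFConsts} {adm : ∀ j, (T.sys j).Dom → 𝒢 → Prop} {K : ℕ}
    (hact : ∀ (u v : 𝒢) (φ : Φ), T.act (u * v) φ = T.act u (T.act v φ))
    (bt : ∀ j, (T.sys j).Dom → (𝒢 →* 𝒢)) (hidem : ∀ j X u, bt j X (bt j X u) = bt j X u)
    (hadm : ∀ j X u, adm j X (bt j X u)) :
    SFGaugeLift T c adm K ↔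
      ∀ k, k < K → SFHyp T c k → SFNewTermOn T c adm k → T.GaugeInvOn c (T.offBlockClass bt) (k+1) :=
  sfGaugeLift_iff_residual hact fun k _ => T.coversAt_offBlock_of_contains bt hidem hadm (k+1)

/-- For the block class itself (the `(j, X)`-dependent form of `B12Inv329.sfGaugeLift_blockConstantClass_iff`). [folklore] -/
theorem sfGaugeLift_blockClass_iff {T : SFTower P G Φ 𝒢} {c : SFConsts} {K : ℕ}
    (hact : ∀ (u v : 𝒢) (φ : Φ), T.act (u * v) φ = T.act u (T.act v φ))
    (bt : ∀ j, (T.sys j).Dom → (𝒢 →* 𝒢)) (hidem : ∀ j X u, bt j X (bt j X u) = bt j X u) :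
    SFGaugeLift T c (T.blockClass bt) K ↔
      ∀ k, k < K → SFHyp T c k → SFNewTermOn T c (T.blockClass bt) k → T.GaugeInvOn c (T.offBlockClass bt) (k+1) :=
  sfGaugeLift_iff_offBlock hact bt hidem fun j X u => hidem j X u

/-- Over the abstract law: `SFStepObligationS ↔ SFStepObligationOnS adm ∧ SFResidualS adm (offBlockClass bt)` for any class containing
the block averages — B12 Theorem 3's per-step obligation = (delivery with (1.19) for `adm`) ∧ ((1.19) + space clause of the new terms
for the OFF-BLOCK transformations), by kernel; the second conjunct is the cell's located unprinted lemma (G-adv7-7 (∗) / R1). [folklore] -/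
theorem sfStepObligationS_iff_on_and_offBlock (law : (k : ℕ) → ℝ → Density P k G → Density P (k+1) G → Prop)
    (bg : Background P G av) (A : ∀ k, Density P k G) (T : SFTower P G Φ 𝒢) (c : SFConsts)
    {adm : ∀ j, (T.sys j).Dom → 𝒢 → Prop} (K : ℕ)
    (hact : ∀ (u v : 𝒢) (φ : Φ), T.act (u * v) φ = T.act u (T.act v φ))
    (bt : ∀ j, (T.sys j).Dom → (𝒢 →* 𝒢)) (hidem : ∀ j X u, bt j X (bt j X u) = bt j X u)
    (hadm : ∀ j X u, adm j X (bt j X u)) :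
    SFStepObligationS law bg A T c K ↔
      SFStepObligationOnS law bg A T c adm K ∧ SFResidualS law bg A T c adm (T.offBlockClass bt) K :=
  sfStepObligationS_iff_on_and_residual law bg A T c K hact fun k _ => T.coversAt_offBlock_of_contains bt hidem hadm (k+1)

end OffBlock

end GaugeClassFactor

/-! ## Part L — THE INPUT `R_n ≤ LR_j` OF THE MAJORANT (1.81) [B16 p.385] IS THE FIRST MEMBER OF (2.9) [B14 p.256]: the binder
`hR` of `Budget.majorant_181` (`Step` Part F, F1) DISCHARGED from a typed display (v11)

REACT-ONLY ADDITION (unit f2 gen 10) settling the cell's own objection GAPS G-f2.6 (filed with Part F, v3) against the record since.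
Part F's header and F1's docstring (module `Step`) call the uniform bound `R_n ≤ LR_j`, `j < n ≤ n₀ + R_j`, consumed by the middle
inequality of (1.81) of [Balaban1989LargeFieldII] p.385 — «Thus K ≤ n₀ − j + R_j, and we have Σ_{n=j+1}^{j+K} O(1)M^dR_n^{d+1}d′_n(S^{n−j}(Z))
≤ Σ_{n=j+1}^{n₀} O(1)M^dR_n^{d+1}3(126)^d2^{−(n−j)}d′_j(Z) + Σ_{n=n₀+1}^{n₀+R_j} O(1)M^d dR_n^{d+1}(64)^d ≤ O(1)3(126)^dM^dL^{d+1}R_j^{d+1}d′_j(Z)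
+ O(1)(64)^dM^dL^{d+1}R_j^{d+2} ≤ O(1)(64)^dM^dL^{d+1}R_j^{d+2}(d′_j(Z) + 1). (1.81)» — "the undisplayed input of (1.81)", and carry it
as the binder `hR : ∀ n ∈ Ioc j (n₀ + r), 0 ≤ R_n ∧ R_n^{d+1} ≤ ρ` of `Budget.majorant_181` (`ρ = (LR_j)^{d+1}` reproduces the print);
G-f2.6 added that along the horizon `R_n` "grows with n" and that the bound is "neither displayed nor argued".  THOSE TWO CLAUSES ARE
WITHDRAWN (the binder was and stays correct; nothing of `Step` is modified): the bound IS DISPLAYED one paper up the series, as the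
first member of (2.9) of [Balaban1988Convergent] p.256 — «where p is a positive integer. From the above inequalities we obtain …
and R_n ≤ LR_m , R_m ≤ L(1 + g_n²β′(n−m))^{β₀}R_n ≤ (L+1)(n−m)^{β₀}R_n . (2.9)» — for the pairs of flow indices «where n > m» (p.255),
the sizes being those of (2.5) p.255, «R_j is the smallest number of the form L^r such, that R_j ≥ (log g_j^{−2})^r .», and it is
ARGUED there ("From the above inequalities": (2.5)–(2.7)).  So `R_n` exceeds NO earlier `R_m` by more than the one factor `L`,
uniformly in the lag `n − m` — B16 p.385 names the case of equality: «The square root appears here, because for some steps we do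
not gain the scaling factor L^{−1} (then R_{m+1} = LR_m).» — and at `m = j` this is the input of (1.81) on its whole range.  The
cell's unit strat-b14 KERNEL-DERIVED the first member of (2.9) for all pairs `m < n ≤ K` from the first member of (2.7) («(log
g_n^{−2})^p ≤ (1+β₀)(log g_m^{−2})^p», p.255) at `p = r`, the minimality in (2.5) and `1 + β₀ ≤ L` (`B14FlowStep.flowIneq29_of_27`,
first conjunct of `B14FlowStep.FlowIneq29`; GAPS C-sb14-2), so that what remains unprinted here is exactly what remains of the first
member of (2.7) over long lags — the sign / partial sums of the β-functions along the flow, GAPS G-sb14-2 (T09.F of the cell's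
tables) — and nothing specific to B16 p.385.

TYPED HERE, in the raw-sequence style of F5's `LogPowMono` (this module imports `Step` only and `B14FlowStep` imports `Step`, so the
display is RESTATED for a real sequence `R : ℕ → ℝ` and a real factor `L`, and strat-b14's theorem is NAMED, not imported — one
source of truth for (2.7a) ⇒ (2.9a)): `Budget.RStepLe R L K` := `∀ m < n ≤ K, R n ≤ L·R m` (definitionally the first conjunct of
`B14FlowStep.FlowIneq29 R g L β′ β₀ K` at `R ↦ (R · : ℝ)`, `L ↦ (L : ℝ)`: bridge `RStepLe.of_and`, a projection); `hR_of_rStepLe`: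
(2.9a) on a horizon `K ≥ n₀ + r` together with `0 ≤ R_n` IS the binder `hR` of `majorant_181` with `ρ = (LR_j)^{d+1}`;
`majorant_181_of_rStepLe`: (1.81) with `hR` DISCHARGED, right side `O(1)M^d·L^{d+1}R_j^{d+1}·(A·d′_j(Z) + B·r)` — the `L^{d+1}R_j^{d+1}`
of the printed third expression of (1.81).  What the (1.81) skeleton still takes as hypotheses is then GEOMETRY of the operation `S`
only — the profile bounds `h1` (growth-and-scaling of the iterates, p.384) and `h2` («Then S^{n₀+1−j}(Z) is contained in a cube of the
size 64MR_{n₀+1}», p.385) and the horizon count «Thus K ≤ n₀ − j + R_j» (reader-owned, the cell's `STEP.md` §11 row O-F1) — plus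
`0 ≤ R_n`, immediate for the sizes (2.5) (powers of `L`; `Nat.cast_nonneg` for ℕ-valued sizes cast to `ℝ`).  Prose: `STEP.md` v11
§7.6, §9 (G-f2.6 RESOLVED), §11 row O-F1; GAPS C-f2.14. -/

namespace Budget

/-- B14 (2.9) p.256, FIRST MEMBER, verbatim: «R_n ≤ LR_m» for the pairs «where n > m» (p.255) of flow indices up to the horizon `K`
— along the flow a later size exceeds NO earlier one by more than the one factor `L`, uniformly in the lag.  A property of a raw
real sequence (Part A / F5 style); definitionally the first conjunct of `B14FlowStep.FlowIneq29 R g L β′ β₀ K` (module `B14FlowStep`,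
unit strat-b14, where `flowIneq29_of_27` derives it from the first member of (2.7), (2.5) and `1 + β₀ ≤ L`) at `R ↦ (R · : ℝ)`,
`L ↦ (L : ℝ)` — restated because this module imports `Step` only.  A typed display, not asserted. [cite: Balaban1988Convergent, (2.9) p.256] -/
def RStepLe (R : ℕ → ℝ) (L : ℝ) (K : ℕ) : Prop :=
  ∀ m n, m < n → n ≤ K → R n ≤ L * R m

/-- The bridge from any typed (2.9) carrying further members as right conjuncts (`B14FlowStep.FlowIneq29`: apply to `h29` itself):
project to the first member. [folklore] -/
theorem RStepLe.of_and {R : ℕ → ℝ} {L : ℝ} {K : ℕ} {Q : ℕ → ℕ → Prop}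
    (h : ∀ m n, m < n → n ≤ K → R n ≤ L * R m ∧ Q m n) : RStepLe R L K :=
  fun m n hmn hn => (h m n hmn hn).1

/-- (2.9a) restricts to shorter horizons. [folklore] -/
theorem RStepLe.mono {R : ℕ → ℝ} {L : ℝ} {K K' : ℕ} (hK : K' ≤ K) (h : RStepLe R L K) : RStepLe R L K' :=
  fun m n hmn hn => h m n hmn (le_trans hn hK)

/-- THE BINDER `hR` OF `majorant_181` FROM (2.9a): on the range `j < n ≤ n₀ + r` of (1.81) inside a horizon on which (2.9a) holds
(`n₀ + r ≤ K`; `majorant_181` leaves `r` free and its right side is monotone in `r`, so a flow ending before `n₀ + R_j` is served by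
`r = min(R_j, K − n₀)`), non-negative sizes satisfy `R_n^{d+1} ≤ (LR_j)^{d+1}` — the `ρ = (LR_j)^{d+1}` of F1's docstring, i.e. the
`L^{d+1}R_j^{d+1}` of the printed (1.81).  Elementary (`pow_le_pow_left₀`). [cite: Balaban1989LargeFieldII, (1.81) p.385] -/
theorem hR_of_rStepLe (b : Consts) (L : ℝ) (K j n₀ r : ℕ) (h29 : RStepLe b.R L K)
    (hR0 : ∀ n, n ≤ K → 0 ≤ b.R n) (hK : n₀ + r ≤ K) :
    ∀ n ∈ Finset.Ioc j (n₀ + r), 0 ≤ b.R n ∧ b.R n ^ (b.d + 1) ≤ (L * b.R j) ^ (b.d + 1) := by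
  intro n hn
  rw [Finset.mem_Ioc] at hn
  have hnK : n ≤ K := le_trans hn.2 hK
  exact ⟨hR0 n hnK, pow_le_pow_left₀ (hR0 n hnK) (h29 j n hn.1 hnK) _⟩

/-- (1.81) p.385 WITH ITS FLOW INPUT DISCHARGED: `majorant_181` (F1) with the binder `hR` supplied by (2.9a) [B14 p.256] on a horizon
`K ≥ n₀ + r` (`hR_of_rStepLe`) — `Σ_{n=j+1}^{n₀+r} O(1)M^dR_n^{d+1}d′_n(S^{n−j}(Z)) ≤ O(1)M^d L^{d+1}R_j^{d+1}(A·d′_j(Z) + B·r)`, the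
printed passage from the second to the third expression of (1.81).  Remaining hypotheses: the geometric profile bounds `h1`, `h2` of
F1 (reader-owned, O-F1), `0 ≤ L`, and `0 ≤ R_n` on the horizon.  Kernel-checked arithmetic over its inputs; nothing of B14/B16 is
asserted. [cite: Balaban1989LargeFieldII, (1.81) p.385] -/
theorem majorant_181_of_rStepLe (b : Consts) (L : ℝ) (K j n₀ r : ℕ) (hj : j ≤ n₀) (hK : n₀ + r ≤ K)
    (A B s₀ : ℝ) (s : ℕ → ℝ) (hC : 0 ≤ b.C) (hM : 0 ≤ b.M) (hA : 0 ≤ A) (hs₀ : 0 ≤ s₀) (hB : 0 ≤ B) (hL : 0 ≤ L)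
    (h29 : RStepLe b.R L K) (hR0 : ∀ n, n ≤ K → 0 ≤ b.R n)
    (h1 : ∀ n ∈ Finset.Ioc j n₀, s n ≤ A * (1 / 2 : ℝ) ^ (n - j) * s₀)
    (h2 : ∀ n ∈ Finset.Ioc n₀ (n₀ + r), s n ≤ B) :
    ∑ n ∈ Finset.Ioc j (n₀ + r), b.cost n (s n) ≤
      b.C * b.M ^ b.d * (L ^ (b.d + 1) * b.R j ^ (b.d + 1)) * (A * s₀ + B * r) := by
  have hRj : 0 ≤ b.R j := hR0 j (le_trans (le_trans hj (Nat.le_add_right n₀ r)) hK)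
  have hρ : 0 ≤ (L * b.R j) ^ (b.d + 1) := pow_nonneg (mul_nonneg hL hRj) _
  have h := majorant_181 b j n₀ r hj ((L * b.R j) ^ (b.d + 1)) A B s₀ s hC hM hA hs₀ hB hρ
    (hR_of_rStepLe b L K j n₀ r h29 hR0 hK) h1 h2
  simpa only [mul_pow] using h

end Budget

/-! ## Part M — FROM THE MAJORANT (1.81) TO THE INDUCTION OVER `j` [B16 p.385]: the printed THIRD EXPRESSION over the actual
control range of (1.80), the stopping rule «K ≤ n₀ − j + R_j» as THE named binder, and (1.80) at the creation scale from (1.82) (v12)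

REACT-ONLY ADDITION (unit f2 gen 14) taking up the cell's b02 lineage (unit b02 gen 9, module `B16SProfile`, an importer of this
module): there the two GEOMETRIC binders of `Budget.majorant_181` (`Step` Part F, F1) — `h1` (growth-and-scaling of the `S`-iterates,
pp.384–385: «d′_n(S^{n−j}(Z)) ≤ (63)^d(MR_n)^{−d}|Z^{(n−j)}| ≤ (63)^d 3·2^{d−1} d′_n(Z^{(n−j)}) if the linear size on the right-hand side is
different from 0» and «d′_n(Z^{(n−j)}) ≤ L^{−½(n−j)}d′_j(Z) ≤ 2^{−(n−j)}d′_j(Z) for n − j > 1») and `h2` («Then S^{n₀+1−j}(Z) is contained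
in a cube of the size 64MR_{n₀+1}», p.385) — are DISCHARGED in the ℤ^d index model of the operation `S(Z) = (Z′)^{~10}` (repaired constants
`A = 10·126^d` for `L ≥ 4`, `B = 5·126^d` for `L ≥ 3`, `B16SProfile.profile_h1` / `profile_h2`, under the two-sided drop control of the
size exponents `B16SProfile.DropCtl`, itself derived from (2.7)/(2.5) of [Balaban1988Convergent] and a located smallness,
`B16SProfile.dropCtl_of_27b`), and composed with Part L's `Budget.majorant_181_of_rStepLe` into `B16SProfile.majorant_181_of_flow` /
the end-to-end `B16SProfile.majorant_181_of_B14`, whose conclusion is the SECOND-TO-THIRD bound of (1.81) FOR EVERY TAIL LENGTH `r`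
inside the flow horizon: `∀ r, n₀ + r ≤ N → Σ_{n=j+1}^{n₀+r} O(1)M^dR_n^{d+1}d′_n(S^{n−j}(Z)) ≤ O(1)M^d(L^{d+1}R_j^{d+1})(A·d′_j(Z) + B·r)`
— "NOT supplied: the stopping rule `r ≤ R_j`" (its docstring).  WHAT THE INDUCTION OVER `j` CONSUMES is the printed THIRD expression over
the ACTUAL range of (1.80), verbatim p.385: «Thus K ≤ n₀ − j + R_j, and we have Σ_{n=j+1}^{j+K} O(1)M^dR_n^{d+1}d′_n(S^{n−j}(Z)) ≤ … ≤
O(1)3(126)^dM^dL^{d+1}R_j^{d+1}d′_j(Z) + O(1)(64)^dM^dL^{d+1}R_j^{d+2} ≤ O(1)(64)^dM^dL^{d+1}R_j^{d+2}(d′_j(Z) + 1). (1.81)» — the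
`hrhs : rhs ≤ Q·(s + 1)` of F2's `Budget.base_182` («Thus, by the estimate (1.81), the statement holds for j = 1, i.e., the inequality
(1.80) holds for j = 1, if ¼γ₀(14)^{−d}A₁²p₀²(g₁) ≥ O(1)2(64)^dM^dL^{d+1}R₁^{d+2}. This condition is satisfied for p₀ large, and g₁
sufficiently small.», p.385) and the currency `p` of `Budget.reset_p386`.  TYPED HERE, over `Step`'s `Budget.Consts` only (this module imports `Step`
only; b02's theorems are NAMED, their conclusion enters as the hypothesis `hmid` in exactly its shape): `Budget.third_181` — the last
inequality of (1.81) as pure arithmetic (`P·R_j^{d+1}(A·s₀ + B·r) ≤ A′·P·R_j^{d+2}(s₀ + 1)` for `r ≤ R_j`, `R_j ≥ 1`, `A, B ≤ A′`: the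
absorption of «3(126)^d» and of the tail's factor `R_j` into one constant); `Budget.sum_le_third_181` — THE SEAM: from `hmid`, the
horizon facts `n₀ ≤ N`, `j + K ≤ N`, `R_j ∈ ℕ`, `R_j ≥ 1` ((2.5): a power of `L`), non-negative sizes and profile, and THE STOPPING RULE
as the ONE binder `hstop : j + K ≤ n₀ + R_j` («hence it satisfies the condition (i), and doing at most R_j further steps we obtain a
domain satisfying both conditions (i), (ii). Thus K ≤ n₀ − j + R_j» — conditions (i), (ii) of [Balaban1989LargeFieldI] p.177 (invoked on p.384), reader-level geometry: the cell's `STEP.md` §11 row O-F1, whose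
profile half is now closed by name and whose residual is exactly `hstop`), the control sum over `(j, j+K]` is `≤ A′·O(1)M^dL^{d+1}R_j^{d+2}
·(d′_j(Z) + 1)` (extend the range to `(j, n₀ + r]` with `r = (j + K) ∸ n₀ ≤ R_j`, costs being non-negative; Part L's docstring remark "a
flow ending before `n₀ + R_j` is served by `r = min(R_j, K − n₀)`" made a theorem); `Budget.cost_le_third_181` — the subtracted cost of
(1.82) is within the same currency (the `hcost` of `base_182`); `Budget.controls_of_182` — (1.80) AT THE CREATION SCALE END TO END
modulo its named inputs: (1.82) (`h182`), the located condition (`hcond : 2Q ≤ a`, O-F2), `hmid`, the horizon facts and `hstop` ⊢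
`Controls b j K κ s` (= `base_182` with both majorant hypotheses discharged).  Uptake against the tree producer (kernel-checked in the
cell's scratch `b2b-balaban-f2-g14/partM_dev.lean`, not imported here): from the conclusion of `B16SProfile.majorant_181_of_B14` and
`hstop`, `Σ_{n=j+1}^{j+K} cost_n(d′_n(S^{n−j}(Z))) ≤ 10·126^d·C M^d L^{d+1}R_j^{d+2}·(d′_j(Z) + 1)` for every `K` with `j + K ≤ N`,
`j + K ≤ n₀ + R_j`, and `Controls` from (1.82) + `hcond` — so that after v12 the base case of the induction over `j` takes from outside
this directory's kernel exactly: the flow displays of [Balaban1988Convergent] §2 ((2.5), (2.7), (2.9a), the interval), the located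
smallness of p.385 (O-F2) and of `B16SProfile.theta_le_pow` (`β₀ ≤ ½`, `g_n²β′ ≤ 1`), (1.82) itself (b02's typed (1.79)/(1.82)), and the
stopping rule `hstop`.  READING NOTE (b02 gen 9 advisory, cell GAPS G-b02g9-2, recorded not adjudicated): Part L's gloss of p.385's
parenthetical «(then R_{m+1} = LR_m)» as "the case of equality" of (2.9a) is one reading; in b02's index model the steps that «do not
gain the scaling factor L^{−1}» are those with `q_m = 1`, i.e. `R_{m+1} = L^{−1}R_m` — the direction of the parenthetical is a print-level
question there; no theorem of Part L or of this Part depends on it (both use the first member of (2.9) only, never a uniform lower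
member, which (2.9) does not provide: its third member «(L+1)(n−m)^{β₀}R_n» is lag-dependent).  Prose: `STEP.md` v11.4 §7.6, §9
(C-f2.18), §11 row O-F1; GAPS C-f2.18. -/

namespace Budget

/-- (1.81) p.385, THE LAST INEQUALITY (second-to-third ⇒ third expression), verbatim «≤ O(1)3(126)^dM^dL^{d+1}R_j^{d+1}d′_j(Z)
+ O(1)(64)^dM^dL^{d+1}R_j^{d+2} ≤ O(1)(64)^dM^dL^{d+1}R_j^{d+2}(d′_j(Z) + 1). (1.81)»: with `P = O(1)M^dL^{d+1}`, a tail of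
`r ≤ R_j` steps («Thus K ≤ n₀ − j + R_j»), `R_j ≥ 1` and profile constants `A, B ≤ A′`, `P·R_j^{d+1}·(A·d′_j(Z) + B·r) ≤
A′·P·R_j^{d+2}·(d′_j(Z) + 1)` — the absorption of «3(126)^d» and of the factor `R_j` of the tail into one constant.  Pure
arithmetic (printed `A = 3(126)^d`, `B = (64)^d`; b02's index model has `A = A′ = 10·126^d`, `B = 5·126^d`,
`B16SProfile.profile_h1`/`profile_h2`). [cite: Balaban1989LargeFieldII, (1.81) p.385] -/
theorem third_181 (P Rj A B A' s₀ r : ℝ) (k : ℕ) (hP : 0 ≤ P) (hRj : 1 ≤ Rj) (hs₀ : 0 ≤ s₀)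
    (hr0 : 0 ≤ r) (hr : r ≤ Rj) (hA : 0 ≤ A) (hAA : A ≤ A') (hBA : B ≤ A') :
    P * Rj ^ (k + 1) * (A * s₀ + B * r) ≤ A' * (P * Rj ^ (k + 2)) * (s₀ + 1) := by
  have hA'0 : 0 ≤ A' := le_trans hA hAA
  have h1 : A * s₀ + B * r ≤ A' * (s₀ + Rj) := by
    have e1 : A * s₀ ≤ A' * s₀ := mul_le_mul_of_nonneg_right hAA hs₀
    have e2 : B * r ≤ A' * Rj := mul_le_mul hBA hr hr0 hA'0
    linarith
  have hPR : 0 ≤ P * Rj ^ (k + 1) := by positivity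
  have h2 : P * Rj ^ (k + 1) ≤ P * Rj ^ (k + 2) :=
    mul_le_mul_of_nonneg_left (pow_le_pow_right₀ hRj (by omega)) hP
  have h3 : A' * (P * Rj ^ (k + 1)) * s₀ ≤ A' * (P * Rj ^ (k + 2)) * s₀ :=
    mul_le_mul_of_nonneg_right (mul_le_mul_of_nonneg_left h2 hA'0) hs₀
  calc P * Rj ^ (k + 1) * (A * s₀ + B * r)
      ≤ P * Rj ^ (k + 1) * (A' * (s₀ + Rj)) := mul_le_mul_of_nonneg_left h1 hPR
    _ = A' * (P * Rj ^ (k + 1)) * s₀ + A' * (P * Rj ^ (k + 2)) := by ring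
    _ ≤ A' * (P * Rj ^ (k + 2)) * s₀ + A' * (P * Rj ^ (k + 2)) := by linarith
    _ = A' * (P * Rj ^ (k + 2)) * (s₀ + 1) := by ring

/-- THE SEAM FROM (1.81) TO THE INDUCTION OVER `j` (F2): the control sum of (1.80) over the ACTUAL range `j < n ≤ j + K` is at
most the printed third expression `Q·(d′_j(Z) + 1)`, `Q = A′·O(1)M^dL^{d+1}R_j^{d+2}` — the `hrhs : rhs ≤ Q·(s + 1)` of `base_182`
and the currency of `reset_p386` — GIVEN (a) the second-to-third bound of (1.81) for every tail length `r` inside the flow horizon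
`N` (the conclusion of `majorant_181_of_rStepLe`, Part L; delivered with `h1`/`h2` DISCHARGED in the ℤ^d index model of the
operation `S` by `B16SProfile.majorant_181_of_flow` / `majorant_181_of_B14`, unit b02, which leave `r` free), (b) the threshold
index `n₀ ≤ N` and the controlled steps inside the horizon (`j + K ≤ N`), (c) `R_j` a natural number `≥ 1` ((2.5): a power of `L`),
non-negative sizes and profile, and (d) THE STOPPING RULE, p.385 «Then S^{n₀+1−j}(Z) is contained in a cube of the size 64MR_{n₀+1},
hence it satisfies the condition (i), and doing at most R_j further steps we obtain a domain satisfying both conditions (i), (ii). Thus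
K ≤ n₀ − j + R_j» (conditions (i), (ii) of [Balaban1989LargeFieldI] p.177, invoked on p.384), as the ONE binder `hstop : j + K ≤ n₀ + R_j` — reader-level geometry of the conditions (i), (ii),
the cell's `STEP.md` §11 row O-F1 residual.  Proof: extend the range to `(j, n₀ + r]` with `r = (j + K) ∸ n₀ ≤ R_j` (costs are
non-negative), apply (a), then `third_181`.  Kernel-checked arithmetic over its inputs. [cite: Balaban1989LargeFieldII, (1.81) p.385] -/
theorem sum_le_third_181 (b : Consts) (L A B A' s₀ : ℝ) (N j n₀ K Rj : ℕ) (s : ℕ → ℝ)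
    (hC : 0 ≤ b.C) (hM : 0 ≤ b.M) (hL : 0 ≤ L) (hA : 0 ≤ A) (hAA : A ≤ A') (hBA : B ≤ A')
    (hs₀ : 0 ≤ s₀) (hn₀N : n₀ ≤ N) (hKN : j + K ≤ N) (hRj : b.R j = Rj) (h1Rj : 1 ≤ Rj)
    (hstop : j + K ≤ n₀ + Rj) (hR0 : ∀ n, n ≤ N → 0 ≤ b.R n) (hs : ∀ n, 0 ≤ s n)
    (hmid : ∀ r : ℕ, n₀ + r ≤ N → ∑ n ∈ Finset.Ioc j (n₀ + r), b.cost n (s n) ≤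
        b.C * b.M ^ b.d * (L ^ (b.d + 1) * b.R j ^ (b.d + 1)) * (A * s₀ + B * r)) :
    ∑ n ∈ Finset.Ioc j (j + K), b.cost n (s n) ≤
      A' * (b.C * b.M ^ b.d * L ^ (b.d + 1) * b.R j ^ (b.d + 2)) * (s₀ + 1) := by
  have hP : 0 ≤ b.C * b.M ^ b.d * L ^ (b.d + 1) := by positivity
  have h1Rj' : (1 : ℝ) ≤ (Rj : ℝ) := by exact_mod_cast h1Rj
  set r : ℕ := j + K - n₀ with hr_def
  have hr1 : j + K ≤ n₀ + r := by omega
  have hr2 : n₀ + r ≤ N := by omega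
  have hr3 : r ≤ Rj := by omega
  have hr3' : (r : ℝ) ≤ (Rj : ℝ) := by exact_mod_cast hr3
  calc ∑ n ∈ Finset.Ioc j (j + K), b.cost n (s n)
      ≤ ∑ n ∈ Finset.Ioc j (n₀ + r), b.cost n (s n) := by
        apply Finset.sum_le_sum_of_subset_of_nonneg (Finset.Ioc_subset_Ioc_right hr1)
        intro n hn _
        have hn' := Finset.mem_Ioc.mp hn
        have hRn := hR0 n (by omega)
        have hsn := hs n
        unfold Consts.cost
        positivity
    _ ≤ b.C * b.M ^ b.d * (L ^ (b.d + 1) * b.R j ^ (b.d + 1)) * (A * s₀ + B * r) := hmid r hr2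
    _ = (b.C * b.M ^ b.d * L ^ (b.d + 1)) * (Rj : ℝ) ^ (b.d + 1) * (A * s₀ + B * r) := by rw [hRj]; ring
    _ ≤ A' * ((b.C * b.M ^ b.d * L ^ (b.d + 1)) * (Rj : ℝ) ^ (b.d + 2)) * (s₀ + 1) :=
        third_181 _ _ A B A' s₀ r b.d hP h1Rj' hs₀ (Nat.cast_nonneg r) hr3' hA hAA hBA
    _ = A' * (b.C * b.M ^ b.d * L ^ (b.d + 1) * b.R j ^ (b.d + 2)) * (s₀ + 1) := by rw [hRj]

/-- The subtracted cost of (1.82)/(1.79) at the creation scale, «− O(1)M^dR_1^{d+1}d′_1(Z)» (`b.cost j d′_j(Z)`), is within the same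
currency: `O(1)M^dR_j^{d+1}d′_j(Z) ≤ Q·(d′_j(Z) + 1)` for `Q = A′·O(1)M^dL^{d+1}R_j^{d+2}` as soon as `A′, L, R_j ≥ 1` — the `hcost` of
`base_182`.  Arithmetic. [cite: Balaban1989LargeFieldII, (1.82) p.385] -/
theorem cost_le_third_181 (b : Consts) (L A' s₀ : ℝ) (j Rj : ℕ) (hC : 0 ≤ b.C) (hM : 0 ≤ b.M)
    (hL : 1 ≤ L) (hA' : 1 ≤ A') (hs₀ : 0 ≤ s₀) (hRj : b.R j = Rj) (h1Rj : 1 ≤ Rj) :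
    b.cost j s₀ ≤ A' * (b.C * b.M ^ b.d * L ^ (b.d + 1) * b.R j ^ (b.d + 2)) * (s₀ + 1) := by
  unfold Consts.cost
  rw [hRj]
  have h1Rj' : (1 : ℝ) ≤ Rj := by exact_mod_cast h1Rj
  have hA'0 : 0 ≤ A' := le_trans zero_le_one hA'
  have hL0 : 0 ≤ L := le_trans zero_le_one hL
  have hX : (1 : ℝ) ≤ A' * L ^ (b.d + 1) * Rj := by
    have hL' : (1 : ℝ) ≤ L ^ (b.d + 1) := one_le_pow₀ hL
    have h1 : (1 : ℝ) ≤ A' * L ^ (b.d + 1) := by nlinarith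
    nlinarith
  have hbase : 0 ≤ b.C * b.M ^ b.d * (Rj : ℝ) ^ (b.d + 1) * s₀ := by positivity
  calc b.C * b.M ^ b.d * (Rj : ℝ) ^ (b.d + 1) * s₀
      = (b.C * b.M ^ b.d * (Rj : ℝ) ^ (b.d + 1) * s₀) * 1 := (mul_one _).symm
    _ ≤ (b.C * b.M ^ b.d * (Rj : ℝ) ^ (b.d + 1) * s₀) * (A' * L ^ (b.d + 1) * Rj) :=
        mul_le_mul_of_nonneg_left hX hbase
    _ = A' * (b.C * b.M ^ b.d * L ^ (b.d + 1) * (Rj : ℝ) ^ (b.d + 2)) * s₀ := by ring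
    _ ≤ A' * (b.C * b.M ^ b.d * L ^ (b.d + 1) * (Rj : ℝ) ^ (b.d + 2)) * (s₀ + 1) :=
        mul_le_mul_of_nonneg_left (by linarith) (by positivity)

/-- (1.80) AT THE CREATION SCALE, END TO END MODULO ITS NAMED INPUTS (the base case `j = 1` of p.385, and the currency of the fresh
brackets of (1.85)): from (1.82) «κ_1(Z) ≥ ¼γ_0(14)^{−d}A_1²p_0²(g_1)(d′_1(Z) + 1) − O(1)M^dR_1^{d+1}d′_1(Z)» (`h182`, coefficient `a`),
the LOCATED CONDITION «¼γ_0(14)^{−d}A_1²p_0²(g_1) ≥ O(1)2(64)^dM^dL^{d+1}R_1^{d+2}» … «This condition is satisfied for p_0 large, and g_1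
sufficiently small» (`hcond : 2Q ≤ a`, O-F2), the second-to-third bound of (1.81) for every tail (`hmid`, Part L / unit b02), the
horizon facts and THE STOPPING RULE (`hstop`, O-F1 residual): `κ` CONTROLS the `K` steps — `Controls b j K κ s`, i.e. (1.80).
`base_182` ∘ `sum_le_third_181` ∘ `cost_le_third_181`. [cite: Balaban1989LargeFieldII, (1.80)–(1.82) p.384–385] -/
theorem controls_of_182 (b : Consts) (L A B A' s₀ κ a : ℝ) (N j n₀ K Rj : ℕ) (s : ℕ → ℝ)
    (hC : 0 ≤ b.C) (hM : 0 ≤ b.M) (hL : 1 ≤ L) (hA : 0 ≤ A) (hAA : A ≤ A') (hBA : B ≤ A') (hA' : 1 ≤ A')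
    (hs₀ : 0 ≤ s₀) (hn₀N : n₀ ≤ N) (hKN : j + K ≤ N) (hRj : b.R j = Rj) (h1Rj : 1 ≤ Rj)
    (hstop : j + K ≤ n₀ + Rj) (hR0 : ∀ n, n ≤ N → 0 ≤ b.R n) (hs : ∀ n, 0 ≤ s n)
    (hmid : ∀ r : ℕ, n₀ + r ≤ N → ∑ n ∈ Finset.Ioc j (n₀ + r), b.cost n (s n) ≤
        b.C * b.M ^ b.d * (L ^ (b.d + 1) * b.R j ^ (b.d + 1)) * (A * s₀ + B * r))
    (h182 : a * (s₀ + 1) - b.cost j s₀ ≤ κ)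
    (hcond : 2 * (A' * (b.C * b.M ^ b.d * L ^ (b.d + 1) * b.R j ^ (b.d + 2))) ≤ a) :
    Controls b j K κ s :=
  base_182 κ a (A' * (b.C * b.M ^ b.d * L ^ (b.d + 1) * b.R j ^ (b.d + 2))) (b.cost j s₀) _ s₀ hs₀ h182
    (sum_le_third_181 b L A B A' s₀ N j n₀ K Rj s hC hM (le_trans zero_le_one hL) hA hAA hBA hs₀ hn₀N hKN hRj h1Rj
      hstop hR0 hs hmid)
    (cost_le_third_181 b L A' s₀ j Rj hC hM hL hA' hs₀ hRj h1Rj) hcond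

end Budget

/-! ## Part N (v13) — AN AMORTISED FORM OF (1.80) — NOT PRINTED: the cell's substitute bookkeeping for case 2 of the induction
[B16 pp.386–387] after the refutation, in the ℤ^d index model of `S`, of the absorption sentence of p.387

REACT-ONLY ADDITION (unit f2 gen 17) answering the cell's b02 lineage (unit b02 gen 10; modules `B16Absorption`, `B16MergeHorizon`,
importers of this module; the cell's GAPS G-b02g10-1, whose item (4) names this repair as avenue ρ2 — «formulate the amortised (1.80) over
`Step.Budget` (new inductive invariant with a size-proportional reserve; check inheritance through `merge_step` and the birth budgets)»).
WHAT PRINT DOES (p.387 ll.3–16; the cell's `STEP.md` §7.6–§7.7, `Step` Part F).  In case 2 the inductive assumption (1.80) for `Z = X ∪ Y`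
at scale `j+1` is obtained from (1.85)–(1.86), the inductive assumptions for `X` and `Y`, and the sub-additivity of the (1.80)-sums over
the `S`-iterates with a UNIFORM remainder, «Σ_{n=j+2}^{j+1+K} O(1)M^dR_n^{d+1}d′_n(S^{n−j−1}(Z)) ≤ … + O(1)2(100M)^dR_{j+1}^{d+2}» (1.88) —
`Step`'s `Budget.merge_step` / `merge_controls`, binder `hsub : rhs Z ≤ rhs X + rhs Y + E` —, which rests on the absorption sentence
«applying n₁ times the operation S …, n₁ < 10, we obtain the domain S^{K₁+n₁}(Y) containing S^{K₁+n₁}(X)» (ll.12–15).  WHAT THE CELL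
FOUND (b02 gen 10, kernel-checked in the ℤ^d index model `S = collar^[10] ∘ closureIdx` of `B16SProfile`).  The absorption sentence FAILS
along an `L`-adic ladder family (`B16Absorption.no_uniform_absorption`: a one-cube `X` and a touching `Y`, as large as one pleases, with
`S^m(Y) ⊉ S^m(X)` for all `m ≤ n₁ + 1`, `n₁` free), and in the currency of (1.80) the weighted cube counts of the iterates of `Z = X ∪ Y`
exceed those of `Y` by at least the total weight `Σ_{m=1}^{n+1} w_m` of the first `n + 1` scales, `n` free (`B16Absorption.sum_card_defect`)
— so NO remainder `E` uniform in the pieces inhabits `hsub` along the printed route once the horizons are unbounded, while for pieces of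
comparable horizons print's `E` suffices reader-level (G-b02g10-1 (3d): `E := E₀ + O_d(1)M^dR^{d+1}(K₂ − K₁)`).  What survives in the
model: ONE-LAYER absorption with a uniform delay (`B16Absorption.one_layer_absorption_dropCtl`: `S^m(X) ⊆ (S^m(Y))^{~1}` from `m = 14`
on), the per-scale overhang count (`card_Siter_union_le`), and the HORIZON half of ll.12–15 (`B16MergeHorizon.find_stopAt_merge_le`:
`K_Z ≤ max(K₂ + 6, K₁ + 14) + N − 1`).  The binder `hsub` of `Step` Part F (F2 `merge_controls`, F4 `merge_controls_graph`, F5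
`merge_controls_index`) is the CONSEQUENCE of the printed sentence with uniform `E` — weaker than the sentence, still uninhabitable along
the printed route; `Step` is frozen and F2/F4/F5 remain correct kernel theorems over their binders (the cell's `STEP.md` §11 O-F4).
WHAT IS TYPED HERE — OURS, NOT BAŁABAN'S: every declaration below is labelled NOT PRINTED; the printed (1.80) is `Budget.Controls` and
is IMPLIED by the amortised statement (`ControlsAm.controls`), so (1.89) and everything downstream of (1.80) is untouched.  (N1)
`Budget.ControlsAm b θ j K κ s := (1 + θ)·Σ_{n=j+1}^{j+K} cost_n ≤ κ` — (1.80) with a multiplicative reserve `θ ≥ 0`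
(`controlsAm_zero_iff`: `θ = 0` IS (1.80); `controlsAm_K_zero_iff`: at `K = 0` it reads `κ ≥ 0`, as (1.80) does at `j = k`).  (N2) The
reserve survives THE PRINTED UPDATES of cases 1 and 1′ unchanged (`case1_am`: (1.83) `κ_{j+1}(Z) = κ_j(Z₀) − O(1)M^dR_{j+1}^{d+1}d′_{j+1}(Z)`;
`reset_am`: the reset of p.386 with its located smallness times `1 + θ`) and the base case (1.82) with the located condition of p.385
strengthened by the factor `1 + θ` (`bracket_am`, `base_182_am`; `controlsAm_of_182` = Part M's `controls_of_182` with `2(1+θ)Q ≤ a`).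
(N3) THE AMORTISED MERGER `merge_amortised` — ONE family `S` of pieces, N-ary (not the binary chain (1.86)–(1.88): along the leaf
induction of `merge_controls` every intermediate union would carry the reserve on its own creation-scale cost, which is then not
spendable), with the printed exponent gain and the printed cost sub-additivity SUMMED over the family (`sum_P_ge_of_binary` from F2's
binary `hP`, inhabited by F5 `hP_of_logPowMono`; `cost_le_sum_of_conn` / `cost_le_sum_of_gconn` from the connectivity-PREMISED binary
`hc` of b02's `B16MergeGeometry.merge_controls_conn`, inhabited there by `treeLen_fam_le` with `D = 2·O(1)M^dR_{j+1}^{d+1}` — NOT from F2's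
unpremised `hc`, which `B16MergeGeometry.unpremised_hc_fails` shows uninhabitable), and with print's uniform `hsub` REPLACED by the
DEAD-MASS HYPOTHESIS `hdm`: the future costs of `Z` exceed the sum of the pieces' OWN future costs by at most `η`·(the creation-scale
costs of the pieces) `+ (|S|−1)·Fee`, `(1+θ)η ≤ θ` — paid by the reserve released on the creation-scale costs (charged ONCE for `Z` in
(1.85)) and by the per-piece fee inside the printed exponent budget, `(1+θ)·Fee + D ≤ 2(1+β₀)⁻¹p₀(g_{j+1})` in place of print's
`E + D ≤ 2(1+β₀)⁻¹p₀(g_{j+1})` («for p₀ large and γ small enough», p.387).  (N4) The interface of `hdm` to geometry, `rhs_le_of_overhang`: a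
LIVE/DEAD DECOMPOSITION of the size profile of `Z`'s iterates — the iterates of the pieces still inside their own horizons, plus an
OVERHANG PROFILE `o` — bounds `Z`'s future costs by the pieces' own plus the cost of the overhang.  (N5) The end-to-end
`controlsAm_merge`: pieces satisfying the amortised statement at scale `j`, the summed printed inputs, the decomposition and THE OVERHANG
BUDGET `Σ_n cost_n(o_n) ≤ η·Σ_x O(1)M^dR_{j+1}^{d+1}d′_{j+1}(x) + (|S|−1)·Fee` ⊢ the amortised statement for `Z` at `j+1` with `κ_{j+1}(Z)`
given by (1.85) (`Budget.merge`).  WHAT IS NOT TYPED AND NOT CLAIMED: the overhang budget itself — the ONE new geometric statement this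
bookkeeping needs (the cell's `STEP.md` §7.11 (G-AMORT): in the index model, `o_n` := the cubes of `S^{n−j−1}(Z)` outside the iterates of
the pieces alive at `n`, one layer thick around them from 14 steps after a piece stops by `one_layer_absorption_dropCtl`; OPEN,
conjectured, handed to the b02 lineage with its cheapest falsifier); that Bałaban's proof intends any such bookkeeping (it prints none:
the cell's DIVERGENCE D-f2.21); the identification of the index model with print's domains (D-b02g9.1); summit progress.  The located
smallness conditions the amortised statement CHANGES (factor `1 + θ`, `θ = 1` with `η ≤ ½` in the cell's instance): p.385's
«¼γ₀(14)^{−d}A₁²p₀²(g₁) ≥ O(1)2(64)^dM^dL^{d+1}R₁^{d+2}» (`2(1+θ)Q ≤ a`), p.386's «because Z is a small domain» (`(1+θ)·Σ ≤ p₀(g_j)`),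
p.387's «for p₀ large and γ small enough» (`(1+θ)Fee + D ≤ 2(1+β₀)⁻¹p₀(g_{j+1})`) — the cell's `SMALLNESS.md`.  Every theorem below is
kernel-checked real arithmetic / finite-sum bookkeeping over its binders.  Prose companion: `STEP.md` v11.9 §7.11, §11 O-F4.
-/

namespace Budget

/-- Splitting the first summand off a (1.80)-type sum: `Σ_{n=j+1}^{j+K} f = f(j+1) + Σ_{n=j+2}^{j+K} f` for `K ≥ 1`. [folklore] -/
theorem sum_Ioc_succ_split (f : ℕ → ℝ) (j K : ℕ) (hK : 1 ≤ K) :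
    ∑ n ∈ Finset.Ioc j (j + K), f n = f (j + 1) + ∑ n ∈ Finset.Ioc (j + 1) (j + K), f n := by
  have hsplit := Finset.sum_Ioc_consecutive f (Nat.le_succ j) (show j + 1 ≤ j + K by omega)
  rw [Nat.Ioc_succ_singleton, Finset.sum_singleton] at hsplit
  linarith

/-- The cost is linear in the size: it distributes over finite sums of sizes. [folklore] -/
theorem Consts.cost_sum (b : Consts) (n : ℕ) {ι : Type*} (F : Finset ι) (f : ι → ℝ) :
    b.cost n (∑ x ∈ F, f x) = ∑ x ∈ F, b.cost n (f x) := by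
  unfold Consts.cost
  rw [Finset.mul_sum]

/-- The cost of a non-negative size is non-negative for non-negative constants. [folklore] -/
theorem Consts.cost_nonneg (b : Consts) (n : ℕ) {s : ℝ} (hC : 0 ≤ b.C) (hM : 0 ≤ b.M) (hR : 0 ≤ b.R n)
    (hs : 0 ≤ s) : 0 ≤ b.cost n s := by
  unfold Consts.cost
  positivity

/-- THE AMORTISED FORM OF (1.80) — NOT PRINTED, a cell construct (repair avenue ρ2 of the cell's `GAPS.md` G-b02g10-1):
the budget `κ` at scale `j` controls `K` steps WITH A MULTIPLICATIVE RESERVE `θ ≥ 0`,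
`(1 + θ)·Σ_{n=j+1}^{j+K} O(1)M^dR_n^{d+1}d′_n(S^{n−j}(Z)) ≤ κ_j(Z)`.  For `θ = 0` it is (1.80) (`controlsAm_zero_iff`); for
`θ ≥ 0` it implies (1.80) (`ControlsAm.controls`).  The reserve is what pays, at a merger, the cost of the `S`-iterates of
pieces that have stopped (the overhang that the printed absorption sentence of p.387 would make vanish and does not —
`B16Absorption.no_uniform_absorption`, unit b02). [folklore] -/
def ControlsAm (b : Consts) (θ : ℝ) (j K : ℕ) (κ : ℝ) (s : ℕ → ℝ) : Prop :=
  (1 + θ) * (∑ n ∈ Finset.Ioc j (j + K), b.cost n (s n)) ≤ κ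

/-- Reserve `θ = 0`: the amortised statement IS (1.80). [folklore] -/
theorem controlsAm_zero_iff (b : Consts) (j K : ℕ) (κ : ℝ) (s : ℕ → ℝ) :
    ControlsAm b 0 j K κ s ↔ Controls b j K κ s := by
  unfold ControlsAm Controls
  rw [add_zero, one_mul]

/-- The amortised statement implies (1.80) (reserve `θ ≥ 0`, non-negative cost sum). [folklore] -/
theorem ControlsAm.controls {b : Consts} {θ : ℝ} {j K : ℕ} {κ : ℝ} {s : ℕ → ℝ} (h : ControlsAm b θ j K κ s)
    (hθ : 0 ≤ θ) (hsum : 0 ≤ ∑ n ∈ Finset.Ioc j (j + K), b.cost n (s n)) : Controls b j K κ s := by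
  unfold ControlsAm at h
  unfold Controls
  nlinarith

/-- `K = 0`: the amortised statement reads `κ ≥ 0`, exactly as (1.80) does (`controls_zero_iff`; p.387, the conclusion at
`j = k`). [folklore] -/
theorem controlsAm_K_zero_iff (b : Consts) (θ : ℝ) (j : ℕ) (κ : ℝ) (s : ℕ → ℝ) :
    ControlsAm b θ j 0 κ s ↔ 0 ≤ κ := by
  simp [ControlsAm]

/-- Splitting the first controlled step off the amortised statement: `(1+θ)·(cost_{j+1} + Σ_{n=j+2}^{j+K}) ≤ κ` for `K ≥ 1`
— the form in which a piece alive at scale `j+1` enters a merger (`merge_amortised`'s `hsingle`). [folklore] -/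
theorem ControlsAm.split_first {b : Consts} {θ : ℝ} {j K : ℕ} {κ : ℝ} {s : ℕ → ℝ} (h : ControlsAm b θ j K κ s)
    (hK : 1 ≤ K) :
    (1 + θ) * (b.cost (j + 1) (s (j + 1)) + ∑ n ∈ Finset.Ioc (j + 1) (j + K), b.cost n (s n)) ≤ κ := by
  unfold ControlsAm at h
  rwa [sum_Ioc_succ_split (fun n => b.cost n (s n)) j K hK] at h

/-- CASE 1 of the step `j → j+1` against the amortised statement, with THE PRINTED UPDATE (1.83) `κ_{j+1}(Z) = κ_j(Z₀) −
O(1)M^dR_{j+1}^{d+1}d′_{j+1}(Z)` unchanged: the horizon drops by one, the budget by the actual cost once, and the reserve on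
that cost (`θ·cost_{j+1} ≥ 0`) is released unused.  Kernel-checked arithmetic; NOT a printed statement. [folklore] -/
theorem case1_am (b : Consts) (θ : ℝ) (j K : ℕ) (hK : 1 ≤ K) (κ : ℝ) (s : ℕ → ℝ) (hθ : 0 ≤ θ)
    (hc0 : 0 ≤ b.cost (j + 1) (s (j + 1))) (h : ControlsAm b θ j K κ s) :
    ControlsAm b θ (j + 1) (K - 1) (κ - b.cost (j + 1) (s (j + 1))) s := by
  have h1 := h.split_first hK
  unfold ControlsAm
  have hjK : j + 1 + (K - 1) = j + K := by omega
  rw [hjK]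
  have : 0 ≤ θ * b.cost (j + 1) (s (j + 1)) := mul_nonneg hθ hc0
  nlinarith

/-- CASE 1′ (the RESET of p.386 line 2, `κ_{j+1}(Z) = p₀(g_j) − O(1)M^dR_{j+1}^{d+1}d′_{j+1}(Z)`, `K = R_{j+1}`) against the
amortised statement: the located smallness «because Z is a small domain» now reads `(1+θ)·Σ_{n=j+1}^{j+1+K′} cost_n ≤ p₀(g_j)`
(`hsmall`, the printed one times `1 + θ`).  Kernel-checked arithmetic; NOT a printed statement. [folklore] -/
theorem reset_am (b : Consts) (θ : ℝ) (j K' : ℕ) (p : ℝ) (s : ℕ → ℝ) (hθ : 0 ≤ θ)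
    (hc0 : 0 ≤ b.cost (j + 1) (s (j + 1)))
    (hsmall : (1 + θ) * (∑ n ∈ Finset.Ioc j (j + 1 + K'), b.cost n (s n)) ≤ p) :
    ControlsAm b θ (j + 1) K' (p - b.cost (j + 1) (s (j + 1))) s := by
  unfold ControlsAm
  have hsplit := Finset.sum_Ioc_consecutive (fun n => b.cost n (s n)) (Nat.le_succ j)
    (show j + 1 ≤ j + 1 + K' by omega)
  rw [Nat.Ioc_succ_singleton, Finset.sum_singleton] at hsplit
  have : 0 ≤ θ * b.cost (j + 1) (s (j + 1)) := mul_nonneg hθ hc0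
  rw [← hsplit] at hsmall
  nlinarith

/-- THE BRACKET OF A NEW REGION against the amortised statement: with the majorant currency `Q·(s + 1)` of (1.81) for the
future costs (`hrhs`) and for the creation-scale cost (`hcost`), the located condition of p.385 STRENGTHENED BY THE FACTOR
`1 + θ` — `2(1+θ)·Q ≤ a` in place of «¼γ₀(14)^{−d}A₁²p₀²(g₁) ≥ O(1)2(64)^dM^dL^{d+1}R₁^{d+2}» (`2Q ≤ a`, `base_182`) — gives
`(1+θ)·(cost + rhs) ≤ a·(s + 1)`: the bracket `γ₀A₁²p₀²(g_{j+1})(d′_{j+1} + 1)` of (1.85) pays the amortised costs of its region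
(`merge_amortised`'s `hsingle` for a new piece).  Kernel-checked arithmetic; NOT a printed statement. [folklore] -/
theorem bracket_am (a Q cost rhs s θ : ℝ) (hs : 0 ≤ s) (hθ : 0 ≤ θ) (hrhs : rhs ≤ Q * (s + 1))
    (hcost : cost ≤ Q * (s + 1)) (hcond : 2 * (1 + θ) * Q ≤ a) : (1 + θ) * (cost + rhs) ≤ a * (s + 1) := by
  have h1 : cost + rhs ≤ 2 * Q * (s + 1) := by linarith
  have h2 := mul_le_mul_of_nonneg_left h1 (show (0 : ℝ) ≤ 1 + θ by linarith)
  have h3 := mul_le_mul_of_nonneg_right hcond (show (0 : ℝ) ≤ s + 1 by linarith)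
  linarith

/-- THE BASE CASE (1.82) against the amortised statement: `κ ≥ a(s+1) − cost` (`hκ`, (1.82)), the two majorant bounds and the
strengthened located condition `2(1+θ)Q ≤ a` give `(1+θ)·rhs ≤ κ` (the reserve on the already subtracted creation cost is not
needed: `θ·cost ≥ 0`).  `base_182` is the case `θ = 0`.  Kernel-checked arithmetic; NOT a printed statement. [folklore] -/
theorem base_182_am (κ a Q cost rhs s θ : ℝ) (hs : 0 ≤ s) (hθ : 0 ≤ θ) (hcost0 : 0 ≤ cost)
    (hκ : a * (s + 1) - cost ≤ κ) (hrhs : rhs ≤ Q * (s + 1)) (hcost : cost ≤ Q * (s + 1))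
    (hcond : 2 * (1 + θ) * Q ≤ a) : (1 + θ) * rhs ≤ κ := by
  have h := bracket_am a Q cost rhs s θ hs hθ hrhs hcost hcond
  have : 0 ≤ θ * cost := mul_nonneg hθ hcost0
  nlinarith

/-- (1.80)-AMORTISED AT THE CREATION SCALE, END TO END MODULO ITS NAMED INPUTS — `controls_of_182` (Part M) with the located
condition strengthened to `2(1+θ)·Q ≤ a` and the conclusion strengthened to `ControlsAm`: from (1.82) (`h182`), the
second-to-third bound of (1.81) for every tail (`hmid`, Part L / unit b02), the horizon facts and the stopping rule (`hstop`).
`base_182_am` ∘ `sum_le_third_181` ∘ `cost_le_third_181`.  NOT a printed statement. [folklore] -/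
theorem controlsAm_of_182 (b : Consts) (θ L A B A' s₀ κ a : ℝ) (N j n₀ K Rj : ℕ) (s : ℕ → ℝ) (hθ : 0 ≤ θ)
    (hC : 0 ≤ b.C) (hM : 0 ≤ b.M) (hL : 1 ≤ L) (hA : 0 ≤ A) (hAA : A ≤ A') (hBA : B ≤ A') (hA' : 1 ≤ A')
    (hs₀ : 0 ≤ s₀) (hn₀N : n₀ ≤ N) (hKN : j + K ≤ N) (hRj : b.R j = Rj) (h1Rj : 1 ≤ Rj)
    (hstop : j + K ≤ n₀ + Rj) (hR0 : ∀ n, n ≤ N → 0 ≤ b.R n) (hs : ∀ n, 0 ≤ s n)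
    (hmid : ∀ r : ℕ, n₀ + r ≤ N → ∑ n ∈ Finset.Ioc j (n₀ + r), b.cost n (s n) ≤
        b.C * b.M ^ b.d * (L ^ (b.d + 1) * b.R j ^ (b.d + 1)) * (A * s₀ + B * r))
    (h182 : a * (s₀ + 1) - b.cost j s₀ ≤ κ)
    (hcond : 2 * (1 + θ) * (A' * (b.C * b.M ^ b.d * L ^ (b.d + 1) * b.R j ^ (b.d + 2))) ≤ a) :
    ControlsAm b θ j K κ s := by
  have hRj0 : 0 ≤ b.R j := by rw [hRj]; positivity
  exact base_182_am κ a (A' * (b.C * b.M ^ b.d * L ^ (b.d + 1) * b.R j ^ (b.d + 2))) (b.cost j s₀) _ s₀ θ hs₀ hθ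
    (Consts.cost_nonneg b j hC hM hRj0 hs₀) h182
    (sum_le_third_181 b L A B A' s₀ N j n₀ K Rj s hC hM (le_trans zero_le_one hL) hA hAA hBA hs₀ hn₀N hKN hRj h1Rj
      hstop hR0 hs hmid)
    (cost_le_third_181 b L A' s₀ j Rj hC hM hL hA' hs₀ hRj h1Rj) hcond

/-- THE AMORTISED MERGER (replaces the chain (1.87)–(1.88) and its binder `hsub`; NOT PRINTED).  ONE family `S` of pieces merging
at scale `j+1` (old components `Z_j^{(n)}` and new regions `Z_{j+1}^{(i)}` alike), with per-piece data: the contribution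
`contrib x` to (1.85), the creation-scale cost `cx x = O(1)M^dR_{j+1}^{d+1}d′_{j+1}(x)`, the future costs `rx x` of the piece's OWN
iterates over its OWN horizon, the term `Px x = 2p₀(g_{j(x)})`; and family data: the cost `cS` of `Z = ⋃S` at `j+1`, the future
costs `rS` of `Z` over ITS horizon, `PS = 2p₀(g_{j(Z)})`.  HYPOTHESES: every piece pays its amortised costs and its `P`-term
(`hsingle`: cases 1/1′ via `ControlsAm.split_first`, new regions via `bracket_am`); the printed exponent gain summed over the
family (`hP`: `(|S|−1)·2(1+β₀)⁻¹p₀(g_{j+1}) ≤ Σ_x 2p₀(g_{j(x)}) − 2p₀(g_{j(Z)})`, = the binary «2p₀(g_{j(X)}) + 2p₀(g_{j(Y)}) −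
2p₀(g_{j(Z)}) ≥ 2(1+β₀)⁻¹p₀(g_{j+1})» peeled, `sum_P_ge_of_binary` + F5 `hP_of_logPowMono`); the printed cost sub-additivity
summed (`hc`: «d′_{j+1}(X) + d′_{j+1}(Y) + 2d ≥ d′_{j+1}(Z)» peeled over connected sub-families, `cost_le_sum_of_conn`; b02's
`B16MergeGeometry.treeLen_fam_le`); ONE located budget condition (`hbudget`: `(1+θ)·Fee + D ≤ 2(1+β₀)⁻¹p₀(g_{j+1})`, the printed
«for p₀ large and γ small enough» with the overhang fee `Fee` in place of print's `E = O(1)(100M)^dR_{j+1}^{d+2}`); and THE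
DEAD-MASS HYPOTHESIS `hdm`: the future costs of `Z` exceed the sum of the pieces' own future costs by at most `η·Σ_x cx x +
(|S|−1)·Fee`, `(1+θ)η ≤ θ` — the NEW geometric input (interface `rhs_le_of_overhang`; its inhabitation = the OVERHANG BUDGET of
the cell's `STEP.md` §7.11, OPEN, conjectured in b02's index model), replacing print's uniform `rhs Z ≤ rhs X + rhs Y + E`
(`merge_step`'s `hsub`), which `B16Absorption.sum_card_defect` shows uninhabitable along the printed route.  CONCLUSION:
`(1+θ)·rS ≤ κ_{j+1}(Z)` with `κ_{j+1}(Z)` given by (1.85) (`merge`) — the amortised statement for `Z` at `j+1`.  PROOF: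
`Σ contrib − cS − PS ≥ (1+θ)Σ rx + θ·Σ cx + (|S|−1)(q − D) ≥ (1+θ)·(Σ rx + η·Σ cx + (|S|−1)·Fee) ≥ (1+θ)·rS`: the reserve
on the creation-scale costs of ALL pieces (`θ·Σ cx`, released because `cS` is charged once) and the per-piece fee pay the dead
mass.  Kernel-checked arithmetic over its inputs. [folklore] -/
theorem merge_amortised {ι : Type*} (S : Finset ι) (hS : S.Nonempty) (contrib cx rx Px : ι → ℝ)
    (cS rS PS θ η q D Fee : ℝ) (hθ : 0 ≤ θ) (hη : (1 + θ) * η ≤ θ)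
    (hcost0 : ∀ x ∈ S, 0 ≤ cx x)
    (hsingle : ∀ x ∈ S, (1 + θ) * (cx x + rx x) + Px x ≤ contrib x)
    (hP : ((S.card : ℝ) - 1) * q ≤ (∑ x ∈ S, Px x) - PS)
    (hc : cS ≤ (∑ x ∈ S, cx x) + ((S.card : ℝ) - 1) * D)
    (hdm : rS ≤ (∑ x ∈ S, rx x) + η * (∑ x ∈ S, cx x) + ((S.card : ℝ) - 1) * Fee)
    (hbudget : (1 + θ) * Fee + D ≤ q) :
    (1 + θ) * rS ≤ merge contrib S cS PS := by
  unfold merge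
  have hm : (0 : ℝ) ≤ (S.card : ℝ) - 1 := by
    have : 1 ≤ S.card := Finset.card_pos.mpr hS
    have : (1 : ℝ) ≤ (S.card : ℝ) := by exact_mod_cast this
    linarith
  have hA : 0 ≤ ∑ x ∈ S, cx x := Finset.sum_nonneg hcost0
  have h1 : (∑ x ∈ S, ((1 + θ) * (cx x + rx x) + Px x)) ≤ ∑ x ∈ S, contrib x := Finset.sum_le_sum hsingle
  have h1' : (∑ x ∈ S, ((1 + θ) * (cx x + rx x) + Px x)) =
      (1 + θ) * (∑ x ∈ S, cx x) + (1 + θ) * (∑ x ∈ S, rx x) + ∑ x ∈ S, Px x := by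
    rw [Finset.mul_sum, Finset.mul_sum, ← Finset.sum_add_distrib, ← Finset.sum_add_distrib]
    apply Finset.sum_congr rfl
    intro x _
    ring
  have h2 : (1 + θ) * η * (∑ x ∈ S, cx x) ≤ θ * (∑ x ∈ S, cx x) := mul_le_mul_of_nonneg_right hη hA
  have h3 : ((S.card : ℝ) - 1) * ((1 + θ) * Fee) ≤ ((S.card : ℝ) - 1) * (q - D) :=
    mul_le_mul_of_nonneg_left (by linarith) hm
  have h4 : (1 + θ) * rS ≤ (1 + θ) * ((∑ x ∈ S, rx x) + η * (∑ x ∈ S, cx x) + ((S.card : ℝ) - 1) * Fee) :=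
    mul_le_mul_of_nonneg_left hdm (by linarith)
  rw [h1'] at h1
  linarith

/-- THE EXPONENT GAIN SUMMED OVER THE FAMILY from the binary form: if `q ≤ P{x} + P(S∖x) − P S` for every member `x` of every
family `S` with at least two pieces (the `hP` of `merge_controls`; discharged for `P = 2p₀(g_{j(·)})` by F5 `hP_of_logPowMono`),
then `(|S|−1)·q ≤ Σ_{x∈S} P{x} − P S` for every non-empty family.  Induction on the family (peel any piece). [folklore] -/
theorem sum_P_ge_of_binary {ι : Type*} [DecidableEq ι] (P : Finset ι → ℝ) (q : ℝ)
    (hP : ∀ S x, x ∈ S → 2 ≤ S.card → q ≤ P {x} + P (S.erase x) - P S) :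
    ∀ S : Finset ι, S.Nonempty → ((S.card : ℝ) - 1) * q ≤ (∑ x ∈ S, P {x}) - P S := by
  intro S
  induction S using Finset.strongInduction with
  | H S ih =>
    intro hne
    by_cases h2 : 2 ≤ S.card
    · obtain ⟨x, hx⟩ := hne
      have hYne : (S.erase x).Nonempty := by
        rw [← Finset.card_pos, Finset.card_erase_of_mem hx]
        omega
      have ihY := ih (S.erase x) (Finset.erase_ssubset hx) hYne
      have hcard : ((S.erase x).card : ℝ) = (S.card : ℝ) - 1 := by
        rw [Finset.card_erase_of_mem hx, Nat.cast_sub (by omega), Nat.cast_one]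
      have hsum := Finset.add_sum_erase S (fun y => P {y}) hx
      have hb := hP S x hx h2
      rw [hcard] at ihY
      rw [← hsum]
      linarith
    · have hcard : S.card = 1 := by
        have := Finset.card_pos.mpr hne
        omega
      obtain ⟨y, rfl⟩ := Finset.card_eq_one.mp hcard
      simp

/-- THE COST SUB-ADDITIVITY SUMMED OVER A CONNECTED FAMILY from the binary, connectivity-premised form (the `hc` of b02's
`B16MergeGeometry.merge_controls_conn`: «d′_{j+1}(X) + d′_{j+1}(Y) + 2d ≥ d′_{j+1}(Z)» for `X` a piece and `Y = Z ∖ X` connected,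
discharged there by `treeLen_fam_le` with `D = 2·O(1)M^dR_{j+1}^{d+1}`): `cost S ≤ Σ_{x∈S} cost{x} + (|S|−1)·D` for every
connected non-empty family, peeling endpoints of a maximal tree (`hleaf`, p.386; = `gconn_leaf` for `GConn`). [folklore] -/
theorem cost_le_sum_of_conn {ι : Type*} [DecidableEq ι] (cost : Finset ι → ℝ) (Conn : Finset ι → Prop) (D : ℝ)
    (hleaf : ∀ S, Conn S → 2 ≤ S.card → ∃ x ∈ S, Conn (S.erase x))
    (hc : ∀ S x, x ∈ S → 2 ≤ S.card → Conn S → Conn (S.erase x) → cost S ≤ cost {x} + cost (S.erase x) + D) :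
    ∀ S, Conn S → S.Nonempty → cost S ≤ (∑ x ∈ S, cost {x}) + ((S.card : ℝ) - 1) * D := by
  intro S
  induction S using Finset.strongInduction with
  | H S ih =>
    intro hconn hne
    by_cases h2 : 2 ≤ S.card
    · obtain ⟨x, hx, hconnY⟩ := hleaf S hconn h2
      have hYne : (S.erase x).Nonempty := by
        rw [← Finset.card_pos, Finset.card_erase_of_mem hx]
        omega
      have ihY := ih (S.erase x) (Finset.erase_ssubset hx) hconnY hYne
      have hcard : ((S.erase x).card : ℝ) = (S.card : ℝ) - 1 := by
        rw [Finset.card_erase_of_mem hx, Nat.cast_sub (by omega), Nat.cast_one]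
      have hsum := Finset.add_sum_erase S (fun y => cost {y}) hx
      have hb := hc S x hx h2 hconn hconnY
      rw [hcard] at ihY
      rw [← hsum]
      linarith
    · have hcard : S.card = 1 := by
        have := Finset.card_pos.mpr hne
        omega
      obtain ⟨y, rfl⟩ := Finset.card_eq_one.mp hcard
      simp

/-- Graph form of `cost_le_sum_of_conn` (`Conn := GConn G`, endpoints by `gconn_leaf`, non-emptiness by `gconn_nonempty`). [folklore] -/
theorem cost_le_sum_of_gconn {ι : Type*} [DecidableEq ι] (G : SimpleGraph ι) (cost : Finset ι → ℝ) (D : ℝ)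
    (hc : ∀ S x, x ∈ S → 2 ≤ S.card → GConn G S → GConn G (S.erase x) → cost S ≤ cost {x} + cost (S.erase x) + D) :
    ∀ S, GConn G S → cost S ≤ (∑ x ∈ S, cost {x}) + ((S.card : ℝ) - 1) * D :=
  fun S hS => cost_le_sum_of_conn cost (GConn G) D (fun T hT h2 => gconn_leaf G T hT h2) hc S hS
    (gconn_nonempty G S hS)

/-- THE INTERFACE TO THE GEOMETRY OF THE DEAD MASS (NOT PRINTED).  If at every future scale `n` of the merged component `Z`
(horizon `K_Z`) the size of its iterate is at most the sizes of the iterates of the pieces STILL ALIVE at `n` (piece `x` is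
alive for `n ≤ j + K_x`, its own horizon from scale `j`) plus an OVERHANG PROFILE `o n` (`hZ` — in b02's index model: the
orbit boxes of the stopped pieces outside the live iterates, ONE layer thick from 14 steps after stopping on,
`B16Absorption.one_layer_absorption_dropCtl` / `card_Siter_union_le`), then the future costs of `Z` are at most the sum of
the pieces' OWN future costs plus the cost of the overhang profile.  Cost linear and monotone in the size; exchange of the two
summations; a piece's terms beyond `Z`'s horizon are dropped (non-negative).  Kernel-checked. [folklore] -/
theorem rhs_le_of_overhang (b : Consts) {ι : Type*} (S : Finset ι) (j KZ : ℕ) (Kx : ι → ℕ)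
    (sZ o : ℕ → ℝ) (sx : ι → ℕ → ℝ) (hC : 0 ≤ b.C) (hM : 0 ≤ b.M) (hR : ∀ n, 0 ≤ b.R n)
    (hs : ∀ x ∈ S, ∀ n, 0 ≤ sx x n)
    (hZ : ∀ n ∈ Finset.Ioc (j + 1) (j + 1 + KZ),
      sZ n ≤ (∑ x ∈ S.filter (fun x => n ≤ j + Kx x), sx x n) + o n) :
    ∑ n ∈ Finset.Ioc (j + 1) (j + 1 + KZ), b.cost n (sZ n) ≤
      (∑ x ∈ S, ∑ n ∈ Finset.Ioc (j + 1) (j + Kx x), b.cost n (sx x n))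
        + ∑ n ∈ Finset.Ioc (j + 1) (j + 1 + KZ), b.cost n (o n) := by
  have step1 : ∀ n ∈ Finset.Ioc (j + 1) (j + 1 + KZ), b.cost n (sZ n) ≤
      (∑ x ∈ S.filter (fun x => n ≤ j + Kx x), b.cost n (sx x n)) + b.cost n (o n) := by
    intro n hn
    calc b.cost n (sZ n) ≤ b.cost n ((∑ x ∈ S.filter (fun x => n ≤ j + Kx x), sx x n) + o n) :=
          b.cost_mono n hC hM (hR n) (hZ n hn)
      _ = (∑ x ∈ S.filter (fun x => n ≤ j + Kx x), b.cost n (sx x n)) + b.cost n (o n) := by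
          rw [Consts.cost_add, Consts.cost_sum]
  have step2 : (∑ n ∈ Finset.Ioc (j + 1) (j + 1 + KZ), ∑ x ∈ S.filter (fun x => n ≤ j + Kx x), b.cost n (sx x n))
      ≤ ∑ x ∈ S, ∑ n ∈ Finset.Ioc (j + 1) (j + Kx x), b.cost n (sx x n) := by
    have e : (∑ n ∈ Finset.Ioc (j + 1) (j + 1 + KZ), ∑ x ∈ S.filter (fun x => n ≤ j + Kx x), b.cost n (sx x n))
        = ∑ n ∈ Finset.Ioc (j + 1) (j + 1 + KZ), ∑ x ∈ S, (if n ≤ j + Kx x then b.cost n (sx x n) else 0) := by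
      apply Finset.sum_congr rfl
      intro n _
      rw [Finset.sum_filter]
    rw [e, Finset.sum_comm]
    apply Finset.sum_le_sum
    intro x hx
    rw [← Finset.sum_filter]
    apply Finset.sum_le_sum_of_subset_of_nonneg
    · intro n hn
      rw [Finset.mem_filter, Finset.mem_Ioc] at hn
      rw [Finset.mem_Ioc]
      omega
    · intro n _ _
      exact Consts.cost_nonneg b n hC hM (hR n) (hs x hx n)
  calc ∑ n ∈ Finset.Ioc (j + 1) (j + 1 + KZ), b.cost n (sZ n)
      ≤ ∑ n ∈ Finset.Ioc (j + 1) (j + 1 + KZ),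
          ((∑ x ∈ S.filter (fun x => n ≤ j + Kx x), b.cost n (sx x n)) + b.cost n (o n)) := Finset.sum_le_sum step1
    _ = (∑ n ∈ Finset.Ioc (j + 1) (j + 1 + KZ), ∑ x ∈ S.filter (fun x => n ≤ j + Kx x), b.cost n (sx x n))
          + ∑ n ∈ Finset.Ioc (j + 1) (j + 1 + KZ), b.cost n (o n) := Finset.sum_add_distrib
    _ ≤ (∑ x ∈ S, ∑ n ∈ Finset.Ioc (j + 1) (j + Kx x), b.cost n (sx x n))
          + ∑ n ∈ Finset.Ioc (j + 1) (j + 1 + KZ), b.cost n (o n) := by linarith [step2]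

/-- THE AMORTISED STATEMENT AT SCALE `j+1` FOR A MERGED COMPONENT, END TO END MODULO ITS NAMED INPUTS (NOT PRINTED; the cell's
substitute for case 2 of the printed induction, p.386–387).  Pieces `x ∈ S` with budgets `κ x` before the scale-`j+1` cost
(old components: `κ_j(Z_j^{(n)})`; new regions: the bracket `γ₀A₁²p₀²(g_{j+1})(d′_{j+1} + 1)` of (1.85)), terms `Pp x = 2p₀(g_{j(x)})`,
size profiles `sx x` and horizons `K_x ≥ 1` from scale `j`, EACH satisfying the amortised statement at scale `j` (`hpiece`:
cases 1/1′ for old components — `case1_am`/`reset_am` one scale earlier —, `bracket_am` for new regions); the merged `Z` with size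
profile `sZ`, horizon `K_Z` (b02's `B16MergeHorizon`: `K ≤ max(K₂ + 6, K₁ + 14) + N − 1`) and `PZ = 2p₀(g_{j(Z)})`; the summed
exponent gain (`hP`), the summed cost sub-additivity at `j+1` (`hc`), the LIVE/DEAD DECOMPOSITION of `Z`'s iterates (`hZ`) and
THE OVERHANG BUDGET (`hover`: the cost of the overhang profile is at most `η` times the creation-scale costs of the pieces plus
`(|S|−1)·Fee` — the OPEN geometric statement of the cell's `STEP.md` §7.11 (G-AMORT)), the reserve bookkeeping `(1+θ)η ≤ θ` and
the located budget `(1+θ)Fee + D ≤ q`: THEN `κ_{j+1}(Z)` as given by (1.85) — `merge (κ + Pp) S cost_{j+1}(d′_{j+1}(Z)) PZ` —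
satisfies the amortised statement at `j+1` with horizon `K_Z`, hence (1.80) (`ControlsAm.controls`).  `merge_amortised` ∘
`ControlsAm.split_first` ∘ `rhs_le_of_overhang`.  Kernel-checked over its inputs. [folklore] -/
theorem controlsAm_merge (b : Consts) {ι : Type*} (S : Finset ι) (hS : S.Nonempty) (θ η q D Fee : ℝ)
    (j KZ : ℕ) (Kx : ι → ℕ) (κ Pp : ι → ℝ) (PZ : ℝ) (sx : ι → ℕ → ℝ) (sZ o : ℕ → ℝ)
    (hθ : 0 ≤ θ) (hη : (1 + θ) * η ≤ θ) (hC : 0 ≤ b.C) (hM : 0 ≤ b.M) (hR : ∀ n, 0 ≤ b.R n)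
    (hs : ∀ x ∈ S, ∀ n, 0 ≤ sx x n)
    (hpiece : ∀ x ∈ S, 1 ≤ Kx x ∧ ControlsAm b θ j (Kx x) (κ x) (sx x))
    (hP : ((S.card : ℝ) - 1) * q ≤ (∑ x ∈ S, Pp x) - PZ)
    (hc : b.cost (j + 1) (sZ (j + 1)) ≤ (∑ x ∈ S, b.cost (j + 1) (sx x (j + 1))) + ((S.card : ℝ) - 1) * D)
    (hZ : ∀ n ∈ Finset.Ioc (j + 1) (j + 1 + KZ),
      sZ n ≤ (∑ x ∈ S.filter (fun x => n ≤ j + Kx x), sx x n) + o n)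
    (hover : ∑ n ∈ Finset.Ioc (j + 1) (j + 1 + KZ), b.cost n (o n) ≤
      η * (∑ x ∈ S, b.cost (j + 1) (sx x (j + 1))) + ((S.card : ℝ) - 1) * Fee)
    (hbudget : (1 + θ) * Fee + D ≤ q) :
    ControlsAm b θ (j + 1) KZ (merge (fun x => κ x + Pp x) S (b.cost (j + 1) (sZ (j + 1))) PZ) sZ := by
  unfold ControlsAm
  have hdm := rhs_le_of_overhang b S j KZ Kx sZ o sx hC hM hR hs hZ
  refine merge_amortised S hS (fun x => κ x + Pp x) (fun x => b.cost (j + 1) (sx x (j + 1)))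
    (fun x => ∑ n ∈ Finset.Ioc (j + 1) (j + Kx x), b.cost n (sx x n)) Pp
    (b.cost (j + 1) (sZ (j + 1))) _ PZ θ η q D Fee hθ hη ?_ ?_ hP hc (by linarith [hdm, hover]) hbudget
  · intro x hx
    exact Consts.cost_nonneg b (j + 1) hC hM (hR (j + 1)) (hs x hx (j + 1))
  · intro x hx
    obtain ⟨hK, hx'⟩ := hpiece x hx
    have := hx'.split_first hK
    show (1 + θ) * (b.cost (j + 1) (sx x (j + 1)) + ∑ n ∈ Finset.Ioc (j + 1) (j + Kx x), b.cost n (sx x n)) + Pp x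
      ≤ κ x + Pp x
    linarith

end Budget

end Literature.MathematicalPhysics.QuantumFieldTheory.Balaban1983to89.Step
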